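import Summits.BirchSwinnertonDyer.BirchSwinnertonDyer.Theses.ByReductionTypeAtTwo
import Summits.BirchSwinnertonDyer.BirchSwinnertonDyer.Theorems.ByReductionTypeAtTwoRankOneAtTwoBigImageOddLocalOneDoorFullC
import Summits.BirchSwinnertonDyer.BirchSwinnertonDyer.Theorems.ByReductionTypeAtTwoRankOneAtTwoBigImageOddLocalOneDoorAnalyticAssemblyC
import Summits.BirchSwinnertonDyer.BirchSwinnertonDyer.Theorems.ByReductionTypeAtTwoRankOneAtTwoBigImageOddLocalOneDoorValuation
import Literature.NumberTheory.EllipticCurves.HeegnerPointsOfConductor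
import Literature.NumberTheory.EllipticCurves.ModularCurveEtaQuotientsProofs
import Literature.NumberTheory.EllipticCurves.Greenberg1999.TwoTorsionMuInvariant
import Literature.NumberTheory.EllipticCurves.Wuthrich2014.ShaBoundProofs
import Literature.NumberTheory.EllipticCurves.ComplexMultiplicationLFunctionIsogenyHoldsProofs
import Mathlib.RingTheory.DedekindDomain.AdicValuation
import Literature.NumberTheory.EllipticCurves.HeegnerPointReflectionHolds
import Literature.NumberTheory.EllipticCurves.ModularSymbolsProofs
import Literature.NumberTheory.EllipticCurves.LeadingTermPPartProofs
import Literature.NumberTheory.EllipticCurves.BSDRootNumberOddParityProofs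
import Literature.NumberTheory.EllipticCurves.BSDRootNumberTwoSubModularityProofs
import Literature.NumberTheory.EllipticCurves.BSDRootNumberProofs
import Literature.NumberTheory.EllipticCurves.LeadingTermHeegnerProofs
import Literature.NumberTheory.QuadraticFields.SquareRootGenerator
import HarnessLib

/-!
# Line `eisenstein_kummer_genus_at_two` — v4.9 (gen 4, 2026-08-28; v4 = gen 3): the ARCHIMEDEAN genus re-cut

Crux `RankOneAtTwoOffBigImageOddLocal` (stmt-BirchSwinnertonDyer-23716, route `ByReductionTypeAtTwo`), idea card
`Ideas/eisenstein-kummer-genus-at-two.md`.  Skeleton: §0 the crux split into its `E(ℚ)[2] = 0` half (the sibling line's target,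
stub 1) and its TYPE-A half; §1 the general one-door identity `DoorIdentityAt` and its proved equivalence with `BSD₂` for EVERY
analytic-rank-one curve (verbatim from v3, sorry-free); §2 the type-A objects of v4 — ALL AT THE REAL PLACE; §3 the gen-3
AUDIT THEOREMS (proved, sorry-free): in analytic rank one the Heegner point is `ℚ`-rational on the nose; §3b the half-period
law (proved); §3c (gen 4, PROVED) the KUMMER ALGEBRA of the `2`-isogeny over any field and the theorem that the real Kummer sign
`δ_∞ = sign ∘ kummerValQ` is a HOMOMORPHISM on `E(ℚ)`; §3d (gen 4, PROVED) the same for `realKummerSign` on the REAL points of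
`E(ℂ)` (`conjPoint`-fixed; stub 3's own currency) and `δ_∞(2P) = 1`; §4 the six stub STATEMENTS, of which STUBS 3 AND 4 ARE NOW
THEOREMS (§4d, gen 4, PROVED: the real genus sign law; §4b, gen 4, PROVED: the odd-index law) — FOUR `sorry`s remain; §4c (gen 4,
PROVED) the bridge `E(ℚ) → E(ℂ)` (images of rational points are real and `realKummerSign ∘ ι ∘ incl = sign ∘ kummerValQ`); §4d (gen 4,
PROVED) the conjugation INVOLUTION `π` of the Heegner representatives, `conj φ(τ_{πQ}) = φ(τ_Q)` in analytic rank one, and the sign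
law itself; §4e (gen 4, PROVED) the half-period SIGN law: at a Fricke-real point each factor of `archSign` is the real Kummer sign of
the explicit half-period `2`-torsion point `uniformize (c·{∞, γ∞}_f / 2)` (`δ_∞` kills `uniformize(ℝ)`); §4f (gen 4, PROVED) `archSign`
is the product over the FRICKE-REAL representatives (`(CN, B, A/N) ∼_{Γ₀(N)} Q`, decidable by reduction theory) — the other real
summands cancel in `π`-pairs — each with its symmetry `γ_Q • τ_Q = w_N • (J • τ_Q)`, `γ_Q ∈ Γ₀(N)`; §4g–§4i (gen 4, PROVED) the
CLOSED FORM `archSign = δ_∞(uniformize (c·Σ_{Q Fricke-real} {∞, γ_Q∞}_f / 2))` — ONE real `2`-torsion point —, the PARITY LAW (if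
`c·{∞, γ_Q∞}_f = m_Q·ω` with `uniformize ω = O` then `archSign = 1` for `Σ m_Q` even and `= δ_∞(uniformize (ω/2))` for `Σ m_Q` odd: the
minus-symbol reading (ii′) as a theorem a certificate can discharge) and the END-TO-END criterion (`Σ m_Q` odd ∧ `δ_∞(uniformize(ω/2)) = −1`
⇒ the Heegner point is divisible by exactly `2^{hb}` up to torsion in `E(K)`: S3 + parity law + S4) and the FLOOR CERTIFICATE
`onArchFloor_of_odd_symbols` (S5's hypothesis `OnArchFloor` from finite data: `Δ > 0`, `δ_∞ = +1` on `E(ℚ)[2]`, no rational point of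
order `4` — `torsionSignTrivial_of_twoTorsion`, §3c, PROVED —, odd minus-symbol sum, `δ_∞(uniformize(ω/2)) = −1`); §5 the proved compositions — v4.7, the REGISTRABLE shape (line 1 g6 lesson: `#h21_check_skeleton` takes the crux-concluding theorem and
rejects `Prop` hypotheses that are not registered stubs): `RankOneAtTwoOffBigImageOddLocal_of : <crux by name>` with NO hypotheses, the term
`RankOneAtTwoOffBigImageOddLocal_of_hyps stub_halfZero … stub_archResidual` (`_of_hyps : stub₁-statement → … → stub₆-statement → Crux`, `Crux` the local
name of the route decl; stub names and statements UNCHANGED), `RankOneAtTwoOffBigImageOddLocal_of_five` (stub 4 discharged) and `RankOneAtTwoOffBigImageOddLocal_of_four` (stubs 3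
and 4 discharged); §6 (gen 4, PROVED) the CERTIFICATE `archLedger_of_bsdp_two` / `bsdp_two_iff_archLedger_of_onArchFloor`: on an
arch-floor row with trivial `Ш[2]`'s the research stub 5 is EQUIVALENT to `BSD₂(W)` modulo print and the twin (stub 3 being proved).
NOTHING HERE PROVES THE CRUX OR THE SUMMIT: four `sorry`s, all inside `stub_*` (stubs 1, 2, 5, 6).

## What gen 4 adds (all PROVED, zero new `sorry`; the registered stub names / signatures and `_of` are UNCHANGED)
(a) §3c `kummer_chord_sq`, `kummer_twoTorsion_add` (Silverman AEC X.4.9 in Mathlib's five-coefficient generality: for a chord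
`P₁ + P₂ + P₃' = O` off `T`, `(x₁−e)(x₂−e)(x₃−e)` is the SQUARE of the value of the chord at `x = e` minus `y_T`; and
`(x(T+P) − e)(x(P) − e) = δ_T := 3e² + b₂e/2 + b₄/2`), `deltaT_ne_zero`, and `sign_kummerValQ_add`: `δ_∞(P + Q) = δ_∞(P)·δ_∞(Q)` on
ALL of `E(ℚ)` (five cases), with `δ_∞(n•P) = δ_∞(P)^{|n|}`; (b) §4b `oddIndexOfNegativeSignAtTwo_holds`: STUB 4 from (a), a
Mordell–Weil generator of `E(K)/tors` and Galois descent of `σ`-fixed points — so `stub_oddIndexOfNegativeSign` is a theorem;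
(c) §6 the `BSD₂ ⟺ ArchLedger` certificate on floor rows (uses the sibling line's `hasTwoDivisibilityUpToTorsion_unique`);
(d) §3d/§4c the `E(ℝ) ⊂ E(ℂ)` algebra of stub 3 (c)–(d): `realKummerSign_add` (homomorphism on `conjPoint`-fixed points — the chord
slope through real points is real by `baseChange_slope` along `conj`, so the chord square is a positive real), `realKummerSign_ne_zero`,
`realKummerSign_add_self`, `IsRealPoint.add/neg`, `isRealPoint_some_iff`, `realKummerSign_map_incl`, `isRealPoint_map_incl`;
(e) §4d `realGenusSignLawAtTwo_holds`: STUB 3 PROVED — `exists_conj_involution` (the representative of `(CN, B, A/N)` is an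
involution `π` of `H.reps` with `w_N • τ_Q ∼_{Γ₀(N)} J • τ_{πQ}`), `exists_conj_perm_heegnerSummands` (`conj φ(τ_{πQ}) = φ(τ_Q)` when
`ord_{s=1} L(E,s) = 1`: `ε = −w(E) = +1` and `φ(0) = O`), `realKummerSign_add_conjPoint` (`δ_∞(y + ȳ) = +1`, by `2`-divisibility of
`E(ℂ)`), and the finite-sum lemmas `realKummerSign_sum_real` / `realKummerSign_sum_nonreal` (strong induction on `π`-stable sets of
non-real summands) — so `stub_realGenusSignLaw` is a theorem;
(f) §4e `realKummerSign_φ_eq_half_period[_of_analyticRank_eq_one]`: for `γ • τ = w_N • (J • τ)`, `φ τ` is real and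
`δ_∞(φ τ) = δ_∞(uniformize (c·{∞, γ∞}_f / 2))` (from §3b: `φ τ + uniformize(c{∞,γ∞}/2) ∈ uniformize(ℝ) = 2•uniformize(ℝ/2)`, and
`realKummerSign_uniformize_ofReal = 1`), the rank-one inputs `λ_N = 1`, `{∞,0}_f = 0` discharged inside;
(g) §4f `archSign_eq_prod_frickeReal`: `archSign = ∏_{Q ∈ reps, (CN,B,A/N) ∼ Q} δ_∞(φ τ_Q)` (`Finset.prod_involution` on the
`π`-pairs of non-Fricke-real real summands, `δ_∞(y)² = 1`), `exists_symmetry_of_frickeReal` (`J`, `w_N` normalise `Γ₀(N)`,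
`J² = w_N² = 1` on `ℍ`) and `realKummerSign_φ_heegnerTau_of_frickeReal` (each Fricke-real factor = `δ_∞` of its half-period point):
stub 5's `archSign` input is now an exact finite computation in modular symbols and real `2`-torsion;
(h) §4g `archSign_eq_realKummerSign_uniformize_sum` / `sign_kummerValQ_eq_realKummerSign_uniformize_sum` (`δ_∞` is a homomorphism and
`uniformize` is additive, so the Fricke-real product collapses to `δ_∞` of ONE half-period point `uniformize (c·Σ_Q {∞,γ_Q∞}_f / 2)`), §4h
`archSign_eq_of_symbols_eq_zsmul` (the PARITY LAW: write the scaled symbols as `m_Q·ω` against any `ω ∈ ker uniformize`; then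
`archSign = if Even (Σ m_Q) then 1 else δ_∞(uniformize (ω/2))`, because `uniformize (ω/2) ∈ E[2]`), §4i
`hasTwoDivisibilityUpToTorsion_of_odd_symbols` (type A, `δ_∞|tors = 1`, `rank E(K) = 1`: `Σ m_Q` odd ∧ `δ_∞(uniformize(ω/2)) = −1` ⇒
`HasTwoDivisibilityUpToTorsion W K P hb` — the door bit from finite curve-and-door data, kernel-checked end to end);
(i) §3c `torsionSignTrivial_of_twoTorsion` (`TorsionSignTrivial` is a FINITE CHECK: `δ_∞ = +1` on `E(ℚ)[2]` and no rational point of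
order `4` ⇒ `δ_∞ = +1` on `E(ℚ)_tors`, since `δ_∞` is `{±1}`-valued and `2^k • s = 0 ⇒ 2 • s = 0` without `4`-torsion) and §4j
`onArchFloor_of_odd_symbols` (the FLOOR CERTIFICATE: S5's row hypothesis `OnArchFloor W e Dt H` from that finite data plus an odd
minus-symbol sum with `δ_∞(uniformize(ω/2)) = −1`);
(j) v4.7 the REGISTRABLE skeleton shape: `def Crux` (local name of the route decl), `RankOneAtTwoOffBigImageOddLocal_of_hyps : stub-statements → Crux`,
and the hypothesis-free `RankOneAtTwoOffBigImageOddLocal_of : <route decl>` applied to the six `stub_*` — so `#h21_check_skeleton` finds exactly one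
crux-concluding theorem, with no `Prop` binders, whose direct sorries are the four open `stub_*` (line 1 g6 met `skeleton.extra-hypothesis ×7` on
the hypothesis-carrying shape; this spares a fallback lead the reshape).  Stub names and statements are byte-identical to v4–v4.6;
(k) v4.8 §3c the torsion hypothesis in LEDGER CURRENCY: `torsionOrder_eq_card_torsion` (instance bridge — `W.torsionOrder` is stated under
`open scoped Classical`), `two_nsmul_eq_zero_of_not_four_dvd_card_torsion` (any abelian group: `4 ∤ #G_tors ⇒` no element of order `4`; `4 ∤ Nat.card`
already forces finiteness), `two_nsmul_eq_zero_of_not_four_dvd_torsionOrder` and `torsionSignTrivial_of_not_four_dvd_torsionOrder`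
(`TorsionSignTrivial W e ⟸ δ_∞ = +1 on E(ℚ)[2] ∧ ¬ 4 ∣ W.torsionOrder` — on type A with one rational `2`-torsion point this is `v₂ #E(ℚ)_tors = 1`,
the same `v₂ #E(ℚ)_tors` that enters `ArchLedger`);
(l) v4.9 §3c the torsion hypothesis as `2`-DIVISION-CUBIC facts: `two_nsmul_some_eq_zero_imp` (`2•(x,y) = O ⇒ 2y + a₁x + a₃ = 0`),
`torsionSignTrivial_of_unique_twoDivisionRoot` (`e` the ONLY rational `2`-division root ∧ `δ_T > 0` ∧ no rational `4`-torsion ⇒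
`TorsionSignTrivial`), `torsionSignTrivial_of_unique_twoDivisionRoot_of_not_four_dvd` (… ∧ `¬ 4 ∣ W.torsionOrder`), and §4j
`onArchFloor_of_torsionSignTrivial_of_odd_symbols` (the floor certificate with `TorsionSignTrivial` abstract, fed by any of these).
Net: the line is `S_halfZero → S_inputs → ArchLedgerAtTwo → ArchResidualAtTwo → crux` (`RankOneAtTwoOffBigImageOddLocal_of_four`):
two by-name inputs, ONE research stub (5) certified to carry exactly the `BSD₂`-content of its rows, and the off-floor residual (6).

## Why v4 (autopsy of v3, decisive)
v3 put the lever at the FINITE primes: stub 5 gave the `η`-norm `N_{H/K} g_r(τ₁) ∈ K` the valuations `(−h·a_p(r), 0)` at the two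
primes over a split `p ∣ N`, and the floor asked for `h·a_p(r)` ODD.  But in analytic rank one `σ P_K + w(E)•P_K = h•φ(0)` and
`φ(0) = [L(E,1)] = O`, so `σ P_K = P_K`: **`P_K ∈ E(ℚ)`** (§3, `exists_incl_eq_heegnerPoint_of_analyticRank_eq_one`, kernel-checked;
Gross–Zagier saw it at `N = 37`).  Hence the `φ̂`-Kummer class of `P_K` is `[x(R) − e]` with `x(R) − e ∈ ℚ^×`, whose valuations at
the two primes over any split `p` are EQUAL: the v3 floor is EMPTY in rank one, `FloorReach W` never holds, stub 6 was vacuous and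
stub 7 was the whole type-A half.  (The empirical law `a_p(r) = v_p(δ_T)` of the gen-1 data — `14a1, 15a1, 21a1, 49a1` rank 0,
`65a1`: all `a_p = 0` — is this balance seen from the cusp side.)  A class of `ℚ^×/ℚ^{×2}` pulled back to `K` keeps exactly ONE bit
that no finite valuation sees and that is not killed by `ℚ^× → K^×`: its SIGN.  v4 is the same idea (Kummer map of the `2`-isogeny
with kernel `⟨T⟩` + genus theory of `K` acting on the Heegner summands) moved to the archimedean place, where it is not vacuous.

## The mechanism (v4)
(i) `P_K = Σ_{Q ∈ reps} y_Q`, `y_Q = φ(τ_Q) ∈ E(H) ⊂ E(ℂ)`.  Complex conjugation acts by `conj y_Q = φ(−τ̄_Q) = φ(w_N τ_{Q*}) =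
y_{Q*}` — `w_N` acts TRIVIALLY on `E` in analytic rank one (`λ_N = −w(E) = +1`, `φ(0) = O`: the same two facts), and `Q ↦ Q*`
(`[𝔞] ↦ [𝔞̄𝔫̄]⁻¹`-type) is an involution of `Cl(K)` whose fixed set is EMPTY or a `Cl(K)[2]`-TORSOR, cut out by GENUS CHARACTERS.
(ii) The real Kummer map `δ_∞ : E(ℝ) → ℝ^×/ℝ^{×2} = {±1}`, `R ↦ sign(x(R) − e)` (`T ↦ sign δ_T`), is a homomorphism killing
`2E(ℝ) ⊇ E⁰(ℝ)`; non-real summands pair into `y + ȳ ∈ E⁰(ℝ)`.  Hence the REAL GENUS SIGN LAW (stub 3):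
`sign(x(P_K) − e) = ∏_{Q : y_Q real} sign(x(y_Q) − e)` =: `archSign` — a finite product over the genus-fixed classes, each factor
the real position (egg / nose) of an explicit real CM point on `X₀(N)(ℝ)`'s Fricke-real locus.
(ii′) HALF-PERIOD LAW (§3b, PROVED here, sorry-free): if `γ•τ = w_N•(−τ̄)` with `γ ∈ Γ₀(N)` (a Fricke-real point) then
`c·{∞,γ∞}_f = z̄ − z` for `z = c·2πi∫_{i∞}^τ f`, so `φ(τ) + uniformize(c·{∞,γ∞}_f / 2) = uniformize(Re z)`: every real summand
`y_Q` is CONGRUENT MODULO THE IDENTITY COMPONENT `E⁰(ℝ) = uniformize(ℝ)` to the `2`-TORSION POINT `uniformize(c·{∞,γ_Q∞}_f/2)`,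
i.e. its egg/nose bit is the PARITY OF THE MINUS PERIOD `m⁻(γ_Q)` of its symmetry element (`Δ > 0`: `Λ_E = ℤΩ⁺ ⊕ ℤΩ⁻i`).  So
`archSign = (−1)^{Σ_Q m⁻(γ_Q)} = χ⁻(∏_Q γ_Q)` with `χ⁻ = (m⁻ mod 2) ∈ Hom(Γ₀(N), 𝔽₂)` — EXACT modular-symbol arithmetic, no
numerics; and on TYPE A with the rational `2`-torsion point on the nose (`T = Ω⁺/2`) the functional `m⁻ mod 2` is the projection
`Λ_E/2Λ_E = E[2] → E[2]/⟨T⟩ = 𝔽₂`, a class in `H¹(Γ₀(N), 𝔽₂)[𝔪]` at the EISENSTEIN maximal ideal `𝔪 = (2, T_ℓ − 1 − ℓ)` — the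
«Eisenstein» of the card, now at the real place: the plan for stubs 3 and 5 is to identify `χ⁻` on the Fricke-symmetric elements
`(a b; −Nb d)` with a quadratic Dirichlet character of `d` (multiplicity one at `𝔪 ∋ 2` is per-level — Kilford's non-Gorenstein
examples — so this is a plan, not a stub).
(iii) `P_K = n·g + t` in `E(ℚ)`; if `δ_∞` is trivial on `E(ℚ)_tors` then `δ_∞(P_K) = δ_∞(g)^n`, so `archSign = −1` FORCES `n` ODD,
i.e. the exact `2`-divisibility exponent of `P_K` in `E(K)` is `m = hb` (stub 4) — the Gross–Zagier index parity read off the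
real locus, with no Mordell–Weil generator, no height, no Kolyvagin prime.
(iv) On such ARCH-FLOOR rows the one-door identity at `m = hb` loses its `2·hb` on both sides and, with `Ш(E)[2] = Ш(E^d)[2] = 0`
(decidable by `2`-descent), becomes the explicit ARCH LEDGER (stub 5) — integer row arithmetic, BSD-consistent (it is implied by
`BSD₂(W)` through §1 and stubs 3–4), refutable row by row (certified numerics for `archSign`, `2`-descent for the rest).
(v) One arch-floor row anywhere in the isogeny class proves `BSD₂(W)` (`bsdp_two_of_archReach`, PROVED: door equivalence + twin +
Cassels); the complement is the declared residual (stub 6), census-able.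

## Stubs (§4) — S3–S5 carry the idea, S6 is the declared residual
1 `S_halfZero` (other half, sibling line by name) · 2 `S_inputs` (print facts + the route's four rank-0 items, by name) ·
3 `RealGenusSignLawAtTwo` — PROVED in gen 4 (§4d; the conjugation involution of the Heegner representatives + Atkin–Lehner in
rank 1 + Kummer over `ℝ ⊂ ℂ`) ·
4 `OddIndexOfNegativeSignAtTwo` — PROVED in gen 4 (§4b; Kummer over `ℚ ⊂ ℝ` + the structure of `E(K)/tors` in rank 1) ·
5 `ArchLedgerAtTwo` (XL, the research stub: the explicit ledger on arch-floor rows) · 6 `ArchResidualAtTwo` (XL, residual).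

## Relation to the tree's archimedean programme (found in gen 3; honest placement)
The cell `bsd-f1-sign2` (`Summit.BirchSwinnertonDyer.Rank1Residual.F1Sign2`) already runs the «egg bit» on the SLICE
`E(ℚ)[2] = 0`: `EggLemmaAtTwo` (`eggLemma` PROVED: `Δ > 0 ∧ E(ℚ)[2] = 0 ∧ P` on the egg ⇒ `NotTwiceUpToTorsion`), the conjectures
AN-13 `HeegnerPointOnEggAtTwo` / AN-13⁺ `HeegnerEggLawAtTwo` (bit predicted from `ε`, admissibility and `c·∏c_ℓ` parity; censuses
4 388/4 388, 4 732/4 732), the sibling line `Cruxes/RankOneAtTwoBigImageOddLocal/Lines/egg_kolyvagin_two.lean` (23715) and the card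
`Ideas/cuspidal-egg-c3-at-two.md` (γ₁, square level, cusps).  What v4 adds: (a) TYPE A, where `eggLemma` fails (`E(K)[2] ≠ 0`) —
the component character is replaced by the `φ̂`-KUMMER SIGN `δ_∞` with `TorsionSignTrivial` (stub 4); (b) the bit is COMPUTED,
not predicted: genus pairing `Q ↦ Q*` + the half-period law (§3b) make `archSign` a product of minus-period parities over the
`Cl(K)[2]`-torsor of Fricke-real classes, for every admissible `K` (composite discriminants included); (c) the Eisenstein reading
of `m⁻ mod 2` on type A (plan above).  REF2 of that cell records «the archimedean reading is unprinted»; nothing here uses AN-13.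

## Barriers / dead lines
`DescentDefectUnbounded` (Literature/Barriers/BSD): not met on the floor — no `2^k`-descent depth is used, the index parity comes
from the real place; met head-on only inside the residual (declared, no evasion claimed).  Dead lines honoured: no Kato /
Skinner–Urban / GV / Kriz–Li / CGLS at `p = 2`, no Kolyvagin primitivity at `2`, no twist-family induction, no isogeny to reach the
slice, no hand-picked `2`-power law (the ledger is the §1 identity with every local `2` carried), and — new — no finite-prime
valuation of a Kummer class of `P_K` (gen-3 rationality barrier, §3).
-/
set_option autoImplicit false

noncomputable section

open scoped Classical

set_option linter.dupNamespace false

namespace Summit.BirchSwinnertonDyer.BirchSwinnertonDyer.Cruxes.RankOneAtTwoOffBigImageOddLocal.EisensteinKummerGenus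

open WeierstrassCurve NumberField IsDedekindDomain Rat.HeightOneSpectrum Literature.NumberTheory.EllipticCurves
  Literature.NumberTheory.EllipticCurves.ModularForms
  Literature.NumberTheory.EllipticCurves.KrizLi2019
  Literature.NumberTheory.EllipticCurves.Greenberg1999
  Summit.BirchSwinnertonDyer.Rank1Residual.F1Sign2
  Summit.BirchSwinnertonDyer.Rank1Residual.F1Sign2.TranspositionDoor
  Summit.BirchSwinnertonDyer.Rank1Residual
  Summit.BirchSwinnertonDyer.BirchSwinnertonDyer.Theorems.RankOneAtTwoOneDoor
  Summit.BirchSwinnertonDyer.BirchSwinnertonDyer.Theses.ByReductionTypeAtTwo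

/-! ## §0  The crux and its natural split (`E(ℚ)[2] = 0` versus type A) — shared with ideator 1's sketch -/

/-- The slice predicate of the sibling crux 23715 (big `2`-adic image, odd torsion, odd Tamagawa product). -/
def OnSlice (W : WeierstrassCurve ℚ) [W.IsElliptic] [W.IsGloballyMinimal] : Prop :=
  (∀ n : ℕ, W.HasSurjectiveModNGaloisRep ((2 ^ n : ℕ) : ℤ)) ∧ Odd W.torsionOrder ∧ Odd W.tamagawaProduct

/-- The `E(ℚ)[2] = 0` half of the crux (off-slice curves without rational `2`-torsion) — the sibling line's target. -/
def NoTwoTorsionHalf : Prop :=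
  ∀ (W : WeierstrassCurve ℚ) [W.IsElliptic] [W.IsGloballyMinimal], ¬ W.HasCM → NoRationalTwoTorsion W →
    ¬ OnSlice W → W.analyticRank = 1 → BSDp W 2

/-- The TYPE-A half of the crux: curves WITH a rational `2`-torsion point (automatically off-slice). -/
def TwoTorsionHalf : Prop :=
  ∀ (W : WeierstrassCurve ℚ) [W.IsElliptic] [W.IsGloballyMinimal], ¬ W.HasCM → ¬ NoRationalTwoTorsion W →
    W.analyticRank = 1 → BSDp W 2

/-- Local name for the route crux (so that the split lemma and the hypothesis-carrying compositions of §5 are not themselves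
crux-concluding theorems: only `RankOneAtTwoOffBigImageOddLocal_of` carries the route decl as its literal type — the shape
`ledger skeleton check` registers (`#h21_check_skeleton` (i)/(ii); line 1 g6 lesson, v4.7). -/
def Crux : Prop :=
  Summit.BirchSwinnertonDyer.BirchSwinnertonDyer.Theses.ByReductionTypeAtTwo.RankOneAtTwoOffBigImageOddLocal

/-- **Structural split (proved):** the crux is the conjunction of its two halves. -/
theorem offBigImage_of_halves (hA : NoTwoTorsionHalf) (hB : TwoTorsionHalf) : Crux := by
  unfold Crux
  intro W _ _ hcm hoff hr
  by_cases h2 : NoRationalTwoTorsion W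
  · exact hA W hcm h2 hoff hr
  · exact hB W hcm h2 hr

/-! ## §1  The general one-door identity (every local `2` carried) -/

/-- The halvability bit of the door: `1` iff every point of `E(ℚ)` becomes twice a point in `E(K)` modulo torsion
(the exponent `k ∈ {1, 2}` of `P2.bsdp_two_iff_of_heegner_rankOne` is `2^{hb}`). -/
def halvBit (W : WeierstrassCurve ℚ) (K : Type) [Field K] [NumberField K] : ℕ :=
  if (∀ y : W.toAffine.Point, ∃ Q : (W.baseChange K).toAffine.Point,
      QuadraticDescent.incl K W y - (2 : ℤ) • Q ∈ AddCommGroup.torsion (W.baseChange K).toAffine.Point)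
  then 1 else 0

/-- **The one-door identity at exponent `m`** (the `2`-part of the Gross–Zagier–BSD ledger with every local `2` carried):
`2m + [Δ<0] + 2·v₂#E(ℚ)_tors + 2·v₂#E^d(ℚ)_tors = s_E + s_d + t + 2s + 2·v₂(c_{Dt}) + 2·v₂∏c_ℓ(E) + 2·hb`.
On the slice (`#E(ℚ)_tors`, `∏c_ℓ` odd, hence `#E^d(ℚ)_tors` odd and `hb = 0`) it is the law AN-28c of line v8.4. -/
def DoorIdentityAt (W : WeierstrassCurve ℚ) [W.IsElliptic] [W.IsGloballyMinimal] [NeZero (W.conductorNorm ℤ)]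
    (K : Type) [Field K] [NumberField K] (Dt : ModularParametrizationData W (W.conductorNorm ℤ))
    (Wd : WeierstrassCurve ℚ) [Wd.IsElliptic] (m : ℕ) : Prop :=
  2 * m + (if W.Δ < 0 then 1 else 0) + 2 * padicValNat 2 W.torsionOrder + 2 * padicValNat 2 Wd.torsionOrder =
    padicValNat 2 (Nat.card (AddCommGroup.primaryComponent W.sha 2)) +
      padicValNat 2 (Nat.card (AddCommGroup.primaryComponent Wd.sha 2)) +
      transpCount W (NumberField.discr K) + 2 * identCount W (NumberField.discr K) +
      2 * padicValInt 2 Dt.c + 2 * padicValNat 2 W.tamagawaProduct + 2 * halvBit W K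

/-- **The one door is an EQUIVALENCE for every analytic-rank-one curve — no slice hypothesis.**  `W/ℚ` globally minimal of
analytic rank `1`; `K` imaginary quadratic with `d_K` door-admissible, Heegner hypothesis for `N_E`, `L(E^{(d_K)},1) ≠ 0`;
`Dt` ANY parametrisation datum of level `N_E`, `H`, `ι`, `P ∈ E(K)` mapping to the complex Heegner point; a globally minimal
model `Wd` of the twist with `BSD(Wd, 2)`; published inputs Gross–Zagier / Kolyvagin at `(N_E, W, K)`, GZK, modularity, and
the (proved) Tamagawa receptacle.  THEN `Ш(W)[2^∞]`, `Ш(Wd)[2^∞]` are finite, `P` has infinite order, `rank E(K) = 1`, and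
`BSDp W 2 ↔ ∃ m, HasTwoDivisibilityUpToTorsion W K P m ∧ DoorIdentityAt W K Dt Wd m`.
This is `bsdp_two_iff_doorLawFullC_at` (line v8.4 of the sibling crux) with the four parity simplifications undone.
[cite: GrossZagier1986, Thm. I.6.3 and V.§2] -/
theorem bsdp_two_iff_doorIdentity_at
    (hGZK : rank_eq_analyticRank_of_analyticRank_le_one) (hmod : hasEntireLFunction_rat) (hTam : DoorTwistTamagawaAtTwo)
    (W : WeierstrassCurve ℚ) [W.IsElliptic] [W.IsGloballyMinimal] [NeZero (W.conductorNorm ℤ)]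
    (hr : W.analyticRank = 1)
    (K : Type) [Field K] [NumberField K] (hK : IsImaginaryQuadratic K)
    (hGZ : gross_zagier (W.conductorNorm ℤ) W K) (hKo : kolyvagin (W.conductorNorm ℤ) W K)
    (hadm : DoorAdmissible W (NumberField.discr K))
    (hHN : SatisfiesHeegnerHypothesis (W.conductorNorm ℤ) K)
    (hLt : (W.quadraticTwist (NumberField.discr K : ℚ)).entireLFunction 1 ≠ 0)
    (Dt : ModularParametrizationData W (W.conductorNorm ℤ))
    (H : HeegnerDatum (W.conductorNorm ℤ) (NumberField.discr K)) (ι : K →+* ℂ)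
    (P : (W.baseChange K).toAffine.Point)
    (hP : WeierstrassCurve.Affine.Point.map ι.toRatAlgHom P = heegnerPointComplex Dt H)
    (Wd : WeierstrassCurve ℚ) [Wd.IsElliptic] [Wd.IsGloballyMinimal] (Cd : VariableChange ℚ)
    (hWd : Cd • W.quadraticTwist (NumberField.discr K : ℚ) = Wd) (hBd : BSDp Wd 2) :
    Finite (AddCommGroup.primaryComponent W.sha 2) ∧ Finite (AddCommGroup.primaryComponent Wd.sha 2) ∧
      ¬ IsOfFinAddOrder P ∧ (W.baseChange K).mordellWeilRank = 1 ∧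
      (BSDp W 2 ↔ ∃ m : ℕ, HasTwoDivisibilityUpToTorsion W K P m ∧ DoorIdentityAt W K Dt Wd m) := by
  haveI : Fact (Nat.Prime 2) := ⟨Nat.prime_two⟩
  have h2 : Module.finrank ℚ K = 2 := hK.1
  haveI : IsTotallyComplex K := hK.2
  -- the twist model: `L(Wd,1) ≠ 0`, analytic rank `0`, `BSD(Wd,2)` unpacked in rank `0`
  have hD0 : (NumberField.discr K : ℚ) ≠ 0 := by exact_mod_cast NumberField.discr_ne_zero K
  haveI hEt : (W.quadraticTwist (NumberField.discr K : ℚ)).IsElliptic := W.isElliptic_quadraticTwist hD0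
  have hLeq : Wd.entireLFunction = (W.quadraticTwist (NumberField.discr K : ℚ)).entireLFunction := by
    rw [← hWd, entireLFunction_smul]
  have hLd : Wd.entireLFunction 1 ≠ 0 := by rw [hLeq]; exact hLt
  have hrd : Wd.analyticRank = 0 := (Wd.analyticRank_eq_zero_iff_holds (hmod Wd)).2 hLd
  obtain ⟨hrankd, hfind, q', hq', hv'⟩ := hBd
  haveI := hfind
  have hrkd : Wd.mordellWeilRank = 0 := by rw [hrankd, hrd]
  -- the value `q_d = L(Wd,1)/Ω(Wd)` and its valuation `s_d + v₂ ∏c_ℓ(Wd) - 2 v₂ #Wd(ℚ)_tors`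
  have hlead : Wd.leadingLCoeff = Wd.entireLFunction 1 :=
    WeierstrassCurve.leadingLCoeff_eq_of_analyticRank_eq_zero Wd hrd
  have hreg : Wd.regulator = 1 := Wd.regulator_eq_one_of_rank_zero hrkd
  have hΩdpos : 0 < Wd.realPeriodRat := Wd.realPeriodRat_pos_holds
  have hΩdC : (Wd.realPeriodRat : ℂ) ≠ 0 := by exact_mod_cast hΩdpos.ne'
  have hTd0 : 0 < Wd.torsionOrder := Wd.torsionOrder_pos_holds
  have hcd0 : 0 < Wd.tamagawaProduct := Wd.tamagawaProduct_pos_holds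
  set qd : ℚ := q' * Wd.tamagawaProduct / (Wd.torsionOrder : ℚ) ^ 2 with hqd_def
  have hsha := hq'
  rw [shaAn_def, hlead, hreg, Complex.ofReal_one, mul_one] at hsha
  have hqd : Wd.entireLFunction 1 / (Wd.realPeriodRat : ℂ) = (qd : ℂ) := by
    have hTC : (Wd.torsionOrder : ℂ) ≠ 0 := by exact_mod_cast hTd0.ne'
    have hcC : (Wd.tamagawaProduct : ℂ) ≠ 0 := by exact_mod_cast hcd0.ne'
    have h1 : Wd.entireLFunction 1 * (Wd.torsionOrder : ℂ) ^ 2 =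
        (q' : ℂ) * ((Wd.realPeriodRat : ℂ) * (Wd.tamagawaProduct : ℂ)) := by
      rw [← hsha]; field_simp
    rw [hqd_def]
    push_cast
    field_simp
    linear_combination h1
  have hq'0 : q' ≠ 0 := by
    intro h0
    apply hLd
    have := hqd
    rw [hqd_def, h0, zero_mul, zero_div, Rat.cast_zero, div_eq_zero_iff] at this
    rcases this with h | h
    · exact h
    · exact absurd h hΩdC
  have hTq : (Wd.torsionOrder : ℚ) ≠ 0 := by exact_mod_cast hTd0.ne'
  have hcq : (Wd.tamagawaProduct : ℚ) ≠ 0 := by exact_mod_cast hcd0.ne'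
  have hqd0 : qd ≠ 0 := by
    rw [hqd_def]; exact div_ne_zero (mul_ne_zero hq'0 hcq) (pow_ne_zero _ hTq)
  have hvqd : padicValRat 2 qd =
      (padicValNat 2 (Nat.card (AddCommGroup.primaryComponent Wd.sha 2)) : ℤ) +
        padicValNat 2 W.tamagawaProduct + transpCount W (NumberField.discr K) + 2 * identCount W (NumberField.discr K) -
        2 * (padicValNat 2 Wd.torsionOrder : ℤ) := by
    rw [hqd_def, padicValRat.div (mul_ne_zero hq'0 hcq) (pow_ne_zero _ hTq), padicValRat.mul hq'0 hcq,
      padicValRat.pow, padicValRat.of_nat, padicValRat.of_nat, hv', hTam W (NumberField.discr K) hadm Wd Cd hWd]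
    push_cast
    ring
  have hc0 : Dt.c ≠ 0 := Dt.maninConstant_ne_zero_holds
  -- the door
  obtain ⟨k, hk12, hkiff, hdoor⟩ :=
    P2.bsdp_two_iff_of_heegner_rankOne W (W.conductorNorm ℤ) K Dt H ι P hGZ hKo hGZK hmod hK hHN hP hc0 hr hLt Wd Cd
      hWd qd hqd
  ------------------------------------------------------------------ rank `E(K) = 1`, `Ш(E)` finite, `P` of infinite order
  haveI hEK : (W.baseChange K).IsElliptic := isElliptic_baseChange' W K
  have hL0 : W.entireLFunction 1 = 0 := entireLFunction_one_eq_zero_of_analyticRank_eq_one hr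
  obtain ⟨-, hderiv⟩ := leadingLCoeff_eq_deriv_of_analyticRank_eq_one hr
  have hprod := lDerivEK_eq_deriv_mul W K hmod hL0
  have hLK : LDerivEK W K ≠ 0 := by rw [hprod]; exact mul_ne_zero hderiv hLt
  have hPH : IsHeegnerPoint (W.conductorNorm ℤ) W K P := ⟨Dt, H, ι, hP⟩
  have hPinf : ¬ IsOfFinAddOrder P :=
    (lDerivEK_ne_zero_iff_not_isOfFinAddOrder W (W.conductorNorm ℤ) K hGZ hK hHN hPH).mp hLK
  obtain ⟨hrkK, hShaK⟩ := hKo hK hHN hPH hPinf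
  have hShaW : W.ShaFinite := Literature.NumberTheory.EllipticCurves.shaFinite_of_baseChange W K hShaK
  haveI hfinW : Finite W.sha := hShaW
  have hfin2 : Finite (AddCommGroup.primaryComponent W.sha 2) := inferInstance
  ------------------------------------------------------------------ the generator of `E(K)/tors`
  obtain ⟨gK, hgK, hgenK, huniqK, -⟩ :=
    exists_generator_regulator_eq_of_mordellWeilRank_eq_one (W.baseChange K) hrkK
  ------------------------------------------------------------------ `w_K = 2`, `|u| = 1`, the halvability bit
  have hw2 : Units.torsionOrder K = 2 :=
    Literature.NumberTheory.QuadraticFields.Quadratic.torsionOrder_eq_two_of_discr_lt_neg_four h2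
      (discr_lt_neg_four_of_doorAdmissible hadm)
  have hu1 : |(Cd.u : ℚ)| = 1 := by
    rcases W.u_eq_one_or_eq_neg_one_of_smul_quadraticTwist_of_squarefree (emod_four_of_doorAdmissible hadm)
        hadm.2.1 (good_or_mult_at_dvd_of_doorAdmissible W hadm) Wd Cd hWd with h | h <;> rw [h] <;> simp
  have hk0 : ((k : ℕ) : ℚ) ≠ 0 := by
    rcases hk12 with h | h <;> rw [h] <;> norm_num
  have hvk : padicValRat 2 ((k : ℕ) : ℚ) = (halvBit W K : ℤ) := by
    rcases hk12 with h | h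
    · have hnot : ¬ (∀ y : W.toAffine.Point, ∃ Q : (W.baseChange K).toAffine.Point,
          QuadraticDescent.incl K W y - (2 : ℤ) • Q ∈ AddCommGroup.torsion (W.baseChange K).toAffine.Point) := by
        intro hall
        have h2' := hkiff.mpr hall
        omega
      have hb0 : halvBit W K = 0 := by
        unfold halvBit
        rw [if_neg hnot]
      rw [h, hb0, Nat.cast_one, padicValRat.one, Nat.cast_zero]
    · have hb1 : halvBit W K = 1 := by
        unfold halvBit
        rw [if_pos (hkiff.mp h)]
      rw [h, hb1, padicValRat.self one_lt_two, Nat.cast_one]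
  ------------------------------------------------------------------ the valuation, for ANY exponent `m` of `P`
  have hΔ0 : W.Δ ≠ 0 := W.isUnit_Δ.ne_zero
  have htW' : (W.torsionOrder : ℚ) ≠ 0 := by exact_mod_cast (W.torsionOrder_pos_holds).ne'
  have htK' : ((W.baseChange K).torsionOrder : ℚ) ≠ 0 := by
    exact_mod_cast ((W.baseChange K).torsionOrder_pos_holds).ne'
  have hcW' : (W.tamagawaProduct : ℚ) ≠ 0 := by exact_mod_cast (W.tamagawaProduct_pos_holds).ne'
  have hcM : (Dt.c : ℚ) ≠ 0 := by exact_mod_cast hc0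
  have hw' : (Units.torsionOrder K : ℚ) ≠ 0 := by rw [hw2]; norm_num
  have hua : |(Cd.u : ℚ)| ≠ 0 := abs_ne_zero.mpr Cd.u.ne_zero
  have hn12 : (W.baseChange ℝ).numRealComponents = 1 ∨ (W.baseChange ℝ).numRealComponents = 2 :=
    numRealComponents_eq_one_or W
  have hn' : ((W.baseChange ℝ).numRealComponents : ℚ) ≠ 0 := by
    rcases hn12 with h | h <;> rw [h] <;> norm_num
  have h8 : padicValRat 2 (8 : ℚ) = 3 := by
    rw [show (8 : ℚ) = ((2 : ℕ) : ℚ) ^ 3 by norm_num, padicValRat.pow, padicValRat.self one_lt_two]; norm_num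
  have hvtW : padicValRat 2 (W.torsionOrder : ℚ) = (padicValNat 2 W.torsionOrder : ℤ) := padicValRat.of_nat
  have hvtKq : padicValRat 2 ((W.baseChange K).torsionOrder : ℚ) =
      (padicValNat 2 (W.baseChange K).torsionOrder : ℤ) := padicValRat.of_nat
  have hvcW : padicValRat 2 (W.tamagawaProduct : ℚ) = (padicValNat 2 W.tamagawaProduct : ℤ) := padicValRat.of_nat
  have hvc : padicValRat 2 (Dt.c : ℚ) = (padicValInt 2 Dt.c : ℤ) := padicValRat.of_int
  have hvw : padicValRat 2 (Units.torsionOrder K : ℚ) = 1 := by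
    rw [hw2]; exact padicValRat.self one_lt_two
  have hvu : padicValRat 2 |(Cd.u : ℚ)| = 0 := by rw [hu1]; exact padicValRat.one
  have hD1 : ((W.baseChange ℝ).numRealComponents : ℚ) * ((k : ℕ) : ℚ) ^ 2 ≠ 0 :=
    mul_ne_zero hn' (pow_ne_zero _ hk0)
  have hD2 : ((W.baseChange ℝ).numRealComponents : ℚ) * ((k : ℕ) : ℚ) ^ 2 *
      ((W.baseChange K).torsionOrder : ℚ) ^ 2 ≠ 0 := mul_ne_zero hD1 (pow_ne_zero _ htK')
  have hD3 : ((W.baseChange ℝ).numRealComponents : ℚ) * ((k : ℕ) : ℚ) ^ 2 *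
      ((W.baseChange K).torsionOrder : ℚ) ^ 2 * (Dt.c : ℚ) ^ 2 ≠ 0 := mul_ne_zero hD2 (pow_ne_zero _ hcM)
  have hD4 : ((W.baseChange ℝ).numRealComponents : ℚ) * ((k : ℕ) : ℚ) ^ 2 *
      ((W.baseChange K).torsionOrder : ℚ) ^ 2 * (Dt.c : ℚ) ^ 2 * (Units.torsionOrder K : ℚ) ^ 2 ≠ 0 :=
    mul_ne_zero hD3 (pow_ne_zero _ hw')
  have hD5 : ((W.baseChange ℝ).numRealComponents : ℚ) * ((k : ℕ) : ℚ) ^ 2 *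
      ((W.baseChange K).torsionOrder : ℚ) ^ 2 * (Dt.c : ℚ) ^ 2 * (Units.torsionOrder K : ℚ) ^ 2 * qd ≠ 0 :=
    mul_ne_zero hD4 hqd0
  have hD6 : ((W.baseChange ℝ).numRealComponents : ℚ) * ((k : ℕ) : ℚ) ^ 2 *
      ((W.baseChange K).torsionOrder : ℚ) ^ 2 * (Dt.c : ℚ) ^ 2 * (Units.torsionOrder K : ℚ) ^ 2 * qd *
      |(Cd.u : ℚ)| ≠ 0 := mul_ne_zero hD5 hua
  have hD7 : ((W.baseChange ℝ).numRealComponents : ℚ) * ((k : ℕ) : ℚ) ^ 2 *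
      ((W.baseChange K).torsionOrder : ℚ) ^ 2 * (Dt.c : ℚ) ^ 2 * (Units.torsionOrder K : ℚ) ^ 2 * qd *
      |(Cd.u : ℚ)| * (W.tamagawaProduct : ℚ) ≠ 0 := mul_ne_zero hD6 hcW'
  have hden : padicValRat 2 (((W.baseChange ℝ).numRealComponents : ℚ) * ((k : ℕ) : ℚ) ^ 2 *
      ((W.baseChange K).torsionOrder : ℚ) ^ 2 * (Dt.c : ℚ) ^ 2 * (Units.torsionOrder K : ℚ) ^ 2 * qd *
      |(Cd.u : ℚ)| * (W.tamagawaProduct : ℚ)) =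
      padicValRat 2 ((W.baseChange ℝ).numRealComponents : ℚ) + 2 * (halvBit W K : ℤ) +
        2 * (padicValNat 2 (W.baseChange K).torsionOrder : ℤ) + 2 * (padicValInt 2 Dt.c : ℤ) + 2 +
        ((padicValNat 2 (Nat.card (AddCommGroup.primaryComponent Wd.sha 2)) : ℤ) +
          (padicValNat 2 W.tamagawaProduct : ℤ) + (transpCount W (NumberField.discr K) : ℤ) +
          2 * (identCount W (NumberField.discr K) : ℤ) - 2 * (padicValNat 2 Wd.torsionOrder : ℤ)) +
        (padicValNat 2 W.tamagawaProduct : ℤ) := by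
    rw [padicValRat.mul hD6 hcW', padicValRat.mul hD5 hua, padicValRat.mul hD4 hqd0,
      padicValRat.mul hD3 (pow_ne_zero _ hw'), padicValRat.mul hD2 (pow_ne_zero _ hcM),
      padicValRat.mul hD1 (pow_ne_zero _ htK'), padicValRat.mul hn' (pow_ne_zero _ hk0),
      padicValRat.pow, padicValRat.pow, padicValRat.pow, padicValRat.pow,
      hvk, hvtKq, hvc, hvw, hvqd, hvu, hvcW]
    ring
  have hprim : padicValNat 2 (Nat.card (AddCommGroup.primaryComponent W.sha 2)) =
      padicValNat 2 (Nat.card W.sha) := padicValNat_card_addPrimaryComponent 2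
  -- `[Δ<0]` and `v₂ n` add up to `1`
  have hsign : padicValRat 2 ((W.baseChange ℝ).numRealComponents : ℚ) + (if W.Δ < 0 then 1 else 0 : ℕ) = 1 := by
    rcases lt_or_gt_of_ne hΔ0 with hneg | hpos
    · rw [if_pos hneg, P2.numRealComponents_eq_one_of_Δ_neg hneg, Nat.cast_one, padicValRat.one]; norm_num
    · rw [if_neg (not_lt.mpr hpos.le), P2.numRealComponents_eq_two_of_Δ_pos hpos, padicValRat.self one_lt_two]
      norm_num
  -- the valuation of the door's rational for a point with exponent `m`
  have hval : ∀ {m : ℕ} {Q : (W.baseChange K).toAffine.Point},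
      P - (2 ^ m) • Q ∈ AddCommGroup.torsion (W.baseChange K).toAffine.Point →
      (¬ ∃ Q' : (W.baseChange K).toAffine.Point,
          Q - 2 • Q' ∈ AddCommGroup.torsion (W.baseChange K).toAffine.Point) →
      padicValRat 2
          (8 * ((AddSubgroup.zmultiples P).index : ℚ) ^ 2 * (W.torsionOrder : ℚ) ^ 2 /
            (((W.baseChange ℝ).numRealComponents : ℚ) * (k : ℚ) ^ 2 *
              ((W.baseChange K).torsionOrder : ℚ) ^ 2 * (Dt.c : ℚ) ^ 2 *
              (Units.torsionOrder K : ℚ) ^ 2 * qd * |(Cd.u : ℚ)| * (W.tamagawaProduct : ℚ))) =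
        3 + 2 * ((m : ℤ) + (padicValNat 2 (W.baseChange K).torsionOrder : ℤ)) +
            2 * (padicValNat 2 W.torsionOrder : ℤ) -
          (padicValRat 2 ((W.baseChange ℝ).numRealComponents : ℚ) + 2 * (halvBit W K : ℤ) +
            2 * (padicValNat 2 (W.baseChange K).torsionOrder : ℤ) + 2 * (padicValInt 2 Dt.c : ℤ) + 2 +
            ((padicValNat 2 (Nat.card (AddCommGroup.primaryComponent Wd.sha 2)) : ℤ) +
              (padicValNat 2 W.tamagawaProduct : ℤ) + (transpCount W (NumberField.discr K) : ℤ) +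
              2 * (identCount W (NumberField.discr K) : ℤ) - 2 * (padicValNat 2 Wd.torsionOrder : ℤ)) +
            (padicValNat 2 W.tamagawaProduct : ℤ)) := by
    intro m Q hPQ hQ
    obtain ⟨hI0, hvIdx⟩ := padicValNat_index_of_twoDivisibility (W.baseChange K) hgK hgenK hPQ hQ
    have hI' : ((AddSubgroup.zmultiples P).index : ℚ) ≠ 0 := by exact_mod_cast hI0
    have hvI : padicValRat 2 ((AddSubgroup.zmultiples P).index : ℚ) =
        (m : ℤ) + (padicValNat 2 (W.baseChange K).torsionOrder : ℤ) := by
      rw [padicValRat.of_nat, hvIdx, Nat.cast_add]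
    have hA1 : (8 : ℚ) * ((AddSubgroup.zmultiples P).index : ℚ) ^ 2 ≠ 0 :=
      mul_ne_zero (by norm_num) (pow_ne_zero _ hI')
    have hA2 : (8 : ℚ) * ((AddSubgroup.zmultiples P).index : ℚ) ^ 2 * (W.torsionOrder : ℚ) ^ 2 ≠ 0 :=
      mul_ne_zero hA1 (pow_ne_zero _ htW')
    have hnum : padicValRat 2 ((8 : ℚ) * ((AddSubgroup.zmultiples P).index : ℚ) ^ 2 * (W.torsionOrder : ℚ) ^ 2) =
        3 + 2 * ((m : ℤ) + (padicValNat 2 (W.baseChange K).torsionOrder : ℤ)) +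
          2 * (padicValNat 2 W.torsionOrder : ℤ) := by
      rw [padicValRat.mul hA1 (pow_ne_zero _ htW'), padicValRat.mul (by norm_num) (pow_ne_zero _ hI'),
        padicValRat.pow, padicValRat.pow, h8, hvI, hvtW]
      ring
    rw [padicValRat.div hA2 hD7, hnum, hden]
  refine ⟨hfin2, hfind, hPinf, hrkK, ?_⟩
  constructor
  · ---------------------------------------------------------------- BSD₂ ⇒ the identity at the point's own exponent
    intro hB
    obtain ⟨m, Q, hPQ, hQ⟩ := exists_twoDivisibility_of_rankOne (W.baseChange K) hgenK huniqK hPinf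
    refine ⟨m, ⟨Q, hPQ, hQ⟩, ?_⟩
    have hv := (hdoor.mp hB)
    rw [hval hPQ hQ, ← hprim] at hv
    have hv' := hsign
    unfold DoorIdentityAt
    zify
    push_cast at hv hv' ⊢
    linarith
  · ---------------------------------------------------------------- the identity ⇒ BSD₂
    rintro ⟨m, ⟨Q, hPQ, hQ⟩, hlaw⟩
    apply hdoor.mpr
    have hQ' : ¬ ∃ Q' : (W.baseChange K).toAffine.Point,
        Q - 2 • Q' ∈ AddCommGroup.torsion (W.baseChange K).toAffine.Point := hQ
    rw [hval hPQ hQ', ← hprim]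
    unfold DoorIdentityAt at hlaw
    have hlawZ : (2 * m : ℤ) + ((if W.Δ < 0 then 1 else 0 : ℕ) : ℤ) + 2 * (padicValNat 2 W.torsionOrder : ℤ) +
        2 * (padicValNat 2 Wd.torsionOrder : ℤ) =
        (padicValNat 2 (Nat.card (AddCommGroup.primaryComponent W.sha 2)) : ℤ) +
          padicValNat 2 (Nat.card (AddCommGroup.primaryComponent Wd.sha 2)) +
          transpCount W (NumberField.discr K) + 2 * identCount W (NumberField.discr K) +
          2 * (padicValInt 2 Dt.c : ℤ) + 2 * (padicValNat 2 W.tamagawaProduct : ℤ) + 2 * (halvBit W K : ℤ) := by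
      exact_mod_cast hlaw
    have hv' := hsign
    linarith

/-! ## §2  The type-A objects of v4 — at the REAL place: Kummer values, the real Kummer sign `δ_∞`, real Heegner summands,
the arch floor, the arch ledger, the arch reach -/

/-- `δ_T = f'(e) = 3e² + (b₂/2)e + b₄/2`: the coefficient `b` of the model `Y² = X³ + aX² + bX` obtained by `X = x − e`; the
Kummer map sends `T ↦ δ_T`. [Silverman AEC X.4.9] -/
def deltaT (W : WeierstrassCurve ℚ) (e : ℚ) : ℚ := 3 * e ^ 2 + W.b₂ / 2 * e + W.b₄ / 2

/-- The `φ̂`-KUMMER VALUE of an `F`-rational point, `F` any field over `ℚ` (Silverman X.4.9 transported to `T = (e,·)`):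
`O ↦ 1`, `T ↦ δ_T`, `(x, y) ↦ x − e` otherwise.  Used at `F = ℂ` on the complex Heegner summands. -/
def kummerValK (F : Type) [Field F] [Algebra ℚ F] (W : WeierstrassCurve ℚ) (e : ℚ) : (W.baseChange F).toAffine.Point → F
  | .zero => 1
  | .some x _ _ => if x = algebraMap ℚ F e then algebraMap ℚ F (deltaT W e) else x - algebraMap ℚ F e

/-- The `φ̂`-Kummer value of a `ℚ`-RATIONAL point (`O ↦ 1`, `T ↦ δ_T`, `(x, y) ↦ x − e`).  By §3 the Heegner point of an
analytic-rank-one curve IS (the image of) such a point; this rational number carries the whole lever. -/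
def kummerValQ (W : WeierstrassCurve ℚ) (e : ℚ) : W.toAffine.Point → ℚ
  | .zero => 1
  | .some x _ _ => if x = e then deltaT W e else x - e

/-- **The real Kummer sign `δ_∞`** of a complex point: the sign of the real part of its Kummer value.  On `E(ℝ) ⊂ E(ℂ)` this is
the archimedean Kummer map `E(ℝ) → ℝ^×/ℝ^{×2} = {±1}` of the `2`-isogeny with kernel `⟨T⟩` — a homomorphism killing
`2E(ℝ) ⊇ E⁰(ℝ)`; it is the component character of `E(ℝ)` when `Δ > 0` and `e` is not the smallest real `2`-division root, and
trivial otherwise. [cite: SilvermanAEC2009, X.4.9] -/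
def realKummerSign (W : WeierstrassCurve ℚ) (e : ℚ) (y : (W.baseChange ℂ).toAffine.Point) : SignType :=
  SignType.sign (kummerValK ℂ W e y).re

/-- A complex point is REAL iff complex conjugation (`conjPoint W`) fixes it. -/
def IsRealPoint (W : WeierstrassCurve ℚ) (y : (W.baseChange ℂ).toAffine.Point) : Prop :=
  conjPoint W y = y

/-- **The archimedean genus sign of a door** `(W, e, Dt, H)`: the product of `δ_∞` over the REAL Heegner summands `y_Q = φ(τ_Q)`,
`Q ∈ H.reps`.  In analytic rank one `conj y_Q = y_{Q*}` for the involution `Q ↦ Q*` induced by `w_N ∘ (τ ↦ −τ̄)` on Heegner forms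
(fixed classes: a genus condition — a `Cl(K)[2]`-torsor or nothing), the non-real summands pair off into `E⁰(ℝ) ⊆ 2E(ℝ)`, and
`δ_∞(P_K)` is this finite product (stub 3).  Each factor is the sign of the real number `x(φ(τ_Q)) − e`: decidable per row by
certified numerics. -/
def archSign (W : WeierstrassCurve ℚ) {N : ℕ} [NeZero N] (e : ℚ) (Dt : ModularParametrizationData W N) {D : ℤ}
    (H : HeegnerDatum N D) : SignType :=
  ∏ Q ∈ H.reps.filter (fun Q => IsRealPoint W (Dt.φ (heegnerTau Q))), realKummerSign W e (Dt.φ (heegnerTau Q))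

/-- **Torsion sign triviality** (decidable row datum — finitely many torsion points): `δ_∞ = +1` on `E(ℚ)_tors`.  Then
`δ_∞(n·g + t) = δ_∞(g)^n`, so `δ_∞(P) = −1` forces the index `n` of `P` in `E(ℚ)/tors` to be ODD. -/
def TorsionSignTrivial (W : WeierstrassCurve ℚ) (e : ℚ) : Prop :=
  ∀ t : W.toAffine.Point, t ∈ AddCommGroup.torsion W.toAffine.Point → SignType.sign (kummerValQ W e t) = 1

/-- **ON THE ARCH FLOOR**: `Δ_W > 0` (two real components), `δ_∞` trivial on `E(ℚ)_tors`, and the archimedean genus sign of the door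
is `−1`.  Curve-and-door data only: no `Ш`, no `L`-value, no Mordell–Weil generator, no height. -/
def OnArchFloor (W : WeierstrassCurve ℚ) {N : ℕ} [NeZero N] (e : ℚ) (Dt : ModularParametrizationData W N) {D : ℤ}
    (H : HeegnerDatum N D) : Prop :=
  0 < W.Δ ∧ TorsionSignTrivial W e ∧ archSign W e Dt H = -1

/-- `Ш(W/ℚ)[2^∞]` is trivial (equivalently `Ш(W/ℚ)[2] = 0`; decidable per curve by a complete `2`-descent). -/
def ShaTwoTrivial (W : WeierstrassCurve ℚ) [W.IsElliptic] : Prop :=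
  Nat.card (AddCommGroup.primaryComponent W.sha 2) = 1

/-- **THE ARCH LEDGER** — the one-door identity at `m = hb` with BOTH `Ш`-terms erased (the `2·hb` of the two sides cancel):
`[Δ<0] + 2·v₂#E(ℚ)_tors + 2·v₂#E^d(ℚ)_tors = t + 2s + 2·v₂(c_{Dt}) + 2·v₂∏c_ℓ(E)`.  Integer arithmetic per row. -/
def ArchLedger (W : WeierstrassCurve ℚ) [W.IsElliptic] [W.IsGloballyMinimal] [NeZero (W.conductorNorm ℤ)]
    (K : Type) [Field K] [NumberField K] (Dt : ModularParametrizationData W (W.conductorNorm ℤ))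
    (Wd : WeierstrassCurve ℚ) [Wd.IsElliptic] : Prop :=
  (if W.Δ < 0 then 1 else 0) + 2 * padicValNat 2 W.torsionOrder + 2 * padicValNat 2 Wd.torsionOrder =
    transpCount W (NumberField.discr K) + 2 * identCount W (NumberField.discr K) +
      2 * padicValInt 2 Dt.c + 2 * padicValNat 2 W.tamagawaProduct

/-- **Ledger glue (proved):** with both `Ш[2^∞]` trivial, `ArchLedger` is `DoorIdentityAt … hb` on the nose. -/
theorem doorIdentityAt_halvBit_of_archLedger {W : WeierstrassCurve ℚ} [W.IsElliptic] [W.IsGloballyMinimal]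
    [NeZero (W.conductorNorm ℤ)] {K : Type} [Field K] [NumberField K] {Dt : ModularParametrizationData W (W.conductorNorm ℤ)}
    {Wd : WeierstrassCurve ℚ} [Wd.IsElliptic] (hW : ShaTwoTrivial W) (hWd : ShaTwoTrivial Wd)
    (h : ArchLedger W K Dt Wd) : DoorIdentityAt W K Dt Wd (halvBit W K) := by
  unfold ShaTwoTrivial at hW hWd
  unfold ArchLedger at h
  unfold DoorIdentityAt
  rw [hW, hWd, padicValNat_one_right]
  omega

/-- **ARCH REACH (curve-global, modulo isogeny).**  `W` REACHES THE ARCH FLOOR if SOME globally minimal `W'` isogenous to `W`,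
of type A (`T' = (e', ·)`) and non-CM, has a door row ON THE ARCH FLOOR — an imaginary quadratic door field `K` (`d_K`
door-admissible, `L(W'^{(d_K)}, 1) ≠ 0`, Heegner hypothesis for `N'`), a datum `Dt`, `H`, `ι`, a point `P ∈ W'(K)` over the complex
Heegner point, a globally minimal model `Wd` of the twist — with `Ш(W'/ℚ)[2] = Ш(Wd/ℚ)[2] = 0`.  ONE such row proves `BSD₂(W)`
(`bsdp_two_of_archReach`). -/
def ArchReach (W : WeierstrassCurve ℚ) [W.IsElliptic] : Prop :=
  ∃ (W' : WeierstrassCurve ℚ) (_ : W'.IsElliptic) (_ : W'.IsGloballyMinimal) (_ : NeZero (W'.conductorNorm ℤ)) (e' : ℚ)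
    (K : Type) (_ : Field K) (_ : NumberField K) (ι : K →+* ℂ)
    (Dt : ModularParametrizationData W' (W'.conductorNorm ℤ)) (H : HeegnerDatum (W'.conductorNorm ℤ) (NumberField.discr K))
    (P : (W'.baseChange K).toAffine.Point)
    (Wd : WeierstrassCurve ℚ) (_ : Wd.IsElliptic) (_ : Wd.IsGloballyMinimal) (Cd : WeierstrassCurve.VariableChange ℚ),
    W.IsIsogenous W' ∧ HasRationalTwoTorsionX W' e' ∧ ¬ W'.HasCM ∧ IsImaginaryQuadratic K ∧
      DoorAdmissible W' (NumberField.discr K) ∧ (W'.quadraticTwist (NumberField.discr K : ℚ)).entireLFunction 1 ≠ 0 ∧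
      SatisfiesHeegnerHypothesis (W'.conductorNorm ℤ) K ∧
      WeierstrassCurve.Affine.Point.map ι.toRatAlgHom P = heegnerPointComplex Dt H ∧
      Cd • W'.quadraticTwist (NumberField.discr K : ℚ) = Wd ∧
      OnArchFloor W' e' Dt H ∧ ShaTwoTrivial W' ∧ ShaTwoTrivial Wd

/-! ## §3  Gen-3 AUDIT THEOREMS (proved): in analytic rank `≥ 1` the Heegner point is (anti-)rational ON THE NOSE

`σ P + w(E) • P = 0` exactly (not only up to torsion) as soon as `L(E,1) = 0`, because the torsion defect `h • φ(0)` of Darmon's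
Prop. 3.11 is `h • uniformize (c · {∞,0}_f)` and `{∞,0}_f = L(E,1)`.  Consequences: `rank_an = 1 ⇒ P_K = ι R`, `R ∈ E(ℚ)` (this
kills v3's finite-prime floor and feeds stubs 3–4 of v4); `rank_an` even `≥ 2 ⇒ σ P_K = −P_K`. -/

section Audit

open CongruenceSubgroup ComplexConjugate
open scoped MatrixGroups ModularForm UpperHalfPlane

variable {N : ℕ} [NeZero N] {W : WeierstrassCurve ℚ}

/-- **`φ(0) = O` when `L(E, 1) = 0`.** The image of the cusp `0` under a modular parametrisation
`φ : X₀(N) → E` with `φ(∞) = O` is `uniformize (c · {∞,0}_f)` and `{∞,0}_f = L(E,1)`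
(`IsNewformOf.modularSymbol_zero_eq_entireLFunction_one`). [folklore] -/
theorem cuspZeroPoint_eq_zero_of_entireLFunction_one_eq_zero [W.IsElliptic]
    (Dt : ModularParametrizationData W N) (hL : W.entireLFunction 1 = 0) :
    Dt.cuspZeroPoint = 0 := by
  rw [ModularParametrizationData.cuspZeroPoint,
    Dt.isNewformOf.modularSymbol_zero_eq_entireLFunction_one, hL, mul_zero, map_zero]

/-- **Exact reflection law in analytic rank `≥ 1`.** For `E/ℚ` (globally minimal `W`, conductor
`N`), `K` imaginary quadratic with the Heegner hypothesis, a Heegner point `P ∈ E(K)` of level `N`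
and the non-trivial automorphism `σ` of `K`: if `L(E, 1) = 0` then `σ P + w(E) • P = O` **exactly**.
Proof = the tree's proof of Darmon's Prop. 3.11 (`heegnerPoint_conj_add_rootNumber_smul_of`) with
its last step replaced by `φ(0) = O` (`cuspZeroPoint_eq_zero_of_entireLFunction_one_eq_zero`).
[cite: Darmon2004, Prop. 3.11 and §3.9] [cite: GrossZagier1986, V.(2.3) and the example `N = 37`, p. 311] -/
theorem heegnerPoint_map_add_rootNumber_smul_eq_zero
    (W : WeierstrassCurve ℚ) [W.IsElliptic] [W.IsGloballyMinimal] [NeZero (W.conductorNorm ℤ)]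
    (K : Type) [Field K] [NumberField K] (hK : IsImaginaryQuadratic K)
    (hH : SatisfiesHeegnerHypothesis (W.conductorNorm ℤ) K)
    {P : (W.baseChange K).toAffine.Point} (hP : IsHeegnerPoint (W.conductorNorm ℤ) W K P)
    (hL : W.entireLFunction 1 = 0) (σ : K →ₐ[ℚ] K) (hσ : σ ≠ AlgHom.id ℚ K) :
    WeierstrassCurve.Affine.Point.map (W' := W) σ P + W.rootNumber • P = 0 := by
  obtain ⟨Dt, H, ι, hPH⟩ := hP
  have hAL : ∀ (N : ℕ) [NeZero N],
      IsNewform0.exists_frickeInvolution_eq_smul (N := N) (k := (2 : ℤ)) :=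
    fun N _ ↦ isNewform0_exists_frickeInvolution_eq_smul_two N
  -- Atkin–Lehner: `w_N f = ε f`, `ε = ε(f) = ±1`, as an integer `e`
  have hw : frickeInvolution (W.conductorNorm ℤ) 2 Dt.f = frickeEigenvalue Dt.f • Dt.f :=
    IsNewform0.frickeInvolution_eq_smul_of (hAL (W.conductorNorm ℤ)) Dt.isNewformOf.1
  obtain ⟨e, -, he⟩ : ∃ e : ℤ, (e = 1 ∨ e = -1) ∧ (e : ℂ) = frickeEigenvalue Dt.f := by
    rcases IsNewform0.frickeEigenvalue_eq_one_or_eq_neg_one_of (hAL (W.conductorNorm ℤ))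
      Dt.isNewformOf.1 with h | h
    · exact ⟨1, Or.inl rfl, by rw [h]; norm_num⟩
    · exact ⟨-1, Or.inr rfl, by rw [h]; norm_num⟩
  have hW : IsFrickeEigen (W.conductorNorm ℤ) Dt.f (e : ℂ) := by
    rw [he]
    exact isFrickeEigen_of_frickeInvolution_eq_smul _ hw
  have hroot : W.rootNumber = -e := by
    have h := rootNumber_eq_neg_frickeEigenvalue
      (IsNewform0.exists_functional_equation_two_of_frickeInvolution_eq_smul
        fun N _ ↦ IsNewform0.frickeInvolution_eq_smul_of (hAL N))
      (fun N _ ↦ IsNewform0.frickeEigenvalue_eq_one_or_eq_neg_one_of (hAL N)) Dt.isNewformOf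
    rw [← he] at h
    exact_mod_cast h
  -- `Γ₀(N)`-invariance of `φ`
  have hΦ : ∀ γ : SL(2, ℤ), γ ∈ Gamma0 (W.conductorNorm ℤ) → ∀ τ : ℍ, Dt.φ (γ • τ) = Dt.φ τ :=
    fun γ hγ τ ↦ Dt.φ_gamma0_smul_holds (eichlerIntegral_gamma_smul_holds Dt.f) ⟨γ, hγ⟩ τ
  have hD0 : NumberField.discr K < 0 := hK.discr_neg
  have hND : ∀ p : ℕ, p.Prime → p ∣ W.conductorNorm ℤ → ¬ (p : ℤ) ∣ NumberField.discr K :=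
    fun p hp hpN ↦ not_dvd_discr_of_satisfiesHeegnerHypothesis hK hH hp hpN
  -- the other embedding: `ι (σ P) = conj (ι P) = conj P_H`
  have hισ : WeierstrassCurve.Affine.Point.map (W' := W) ι.toRatAlgHom
      (WeierstrassCurve.Affine.Point.map (W' := W) σ P) =
      conjPoint W (heegnerPointComplex Dt H) := by
    have hcomp : ι.toRatAlgHom.comp σ = conjRatAlgHom.comp ι.toRatAlgHom := by
      apply AlgHom.ext
      intro x
      have := RingHom.congr_fun (comp_eq_conjugate_of_ne_id hK ι hσ) x
      simpa using this
    rw [WeierstrassCurve.Affine.Point.map_map, ← hPH]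
    change _ = WeierstrassCurve.Affine.Point.map (W' := W) conjRatAlgHom
      (WeierstrassCurve.Affine.Point.map (W' := W) ι.toRatAlgHom P)
    rw [WeierstrassCurve.Affine.Point.map_map, hcomp]
  -- `ι (σ P + w P) = conj P_H + w P_H = ε P_H + h φ(0) - ε P_H = h φ(0) = O`
  have key : WeierstrassCurve.Affine.Point.map (W' := W) ι.toRatAlgHom
      (WeierstrassCurve.Affine.Point.map (W' := W) σ P + W.rootNumber • P) =
      H.reps.card • Dt.cuspZeroPoint := by
    rw [map_add, map_zsmul, hισ, hPH, conjPoint_heegnerPointComplex Dt H,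
      ← H.sum_fricke_smul_eq_sum_J_smul hD0 hND Dt.φ hΦ, sum_φ_frickeGL_smul Dt hW H, hroot,
      neg_zsmul, add_right_comm, add_neg_cancel, zero_add]
  apply WeierstrassCurve.Affine.Point.map_injective (f := ι.toRatAlgHom)
  rw [key, cuspZeroPoint_eq_zero_of_entireLFunction_one_eq_zero Dt hL, nsmul_zero, map_zero]

/-- **Root number `−1` ⇒ the Heegner point is `σ`-fixed**: `σ P = P` exactly (`L(E,1) = 0` is
automatic from `w(E) = −1`, `entireLFunction_one_eq_zero_of_rootNumber_eq_neg_one`).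
[cite: Darmon2004, Prop. 3.11 and §3.9] -/
theorem heegnerPoint_map_eq_self_of_rootNumber_eq_neg_one
    (W : WeierstrassCurve ℚ) [W.IsElliptic] [W.IsGloballyMinimal] [NeZero (W.conductorNorm ℤ)]
    (K : Type) [Field K] [NumberField K] (hK : IsImaginaryQuadratic K)
    (hH : SatisfiesHeegnerHypothesis (W.conductorNorm ℤ) K)
    {P : (W.baseChange K).toAffine.Point} (hP : IsHeegnerPoint (W.conductorNorm ℤ) W K P)
    (hw : W.rootNumber = -1) (σ : K →ₐ[ℚ] K) (hσ : σ ≠ AlgHom.id ℚ K) :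
    WeierstrassCurve.Affine.Point.map (W' := W) σ P = P := by
  have h := heegnerPoint_map_add_rootNumber_smul_eq_zero W K hK hH hP
    (entireLFunction_one_eq_zero_of_rootNumber_eq_neg_one hw) σ hσ
  rwa [hw, neg_one_zsmul, ← sub_eq_add_neg, sub_eq_zero] at h

/-- **Root number `+1` and `L(E,1) = 0` (analytic rank even `≥ 2`) ⇒ `σ P = −P` exactly.**
[cite: Darmon2004, Prop. 3.11 and §3.9] -/
theorem heegnerPoint_map_eq_neg_of_rootNumber_eq_one
    (W : WeierstrassCurve ℚ) [W.IsElliptic] [W.IsGloballyMinimal] [NeZero (W.conductorNorm ℤ)]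
    (K : Type) [Field K] [NumberField K] (hK : IsImaginaryQuadratic K)
    (hH : SatisfiesHeegnerHypothesis (W.conductorNorm ℤ) K)
    {P : (W.baseChange K).toAffine.Point} (hP : IsHeegnerPoint (W.conductorNorm ℤ) W K P)
    (hL : W.entireLFunction 1 = 0) (hw : W.rootNumber = 1) (σ : K →ₐ[ℚ] K)
    (hσ : σ ≠ AlgHom.id ℚ K) :
    WeierstrassCurve.Affine.Point.map (W' := W) σ P = -P := by
  have h := heegnerPoint_map_add_rootNumber_smul_eq_zero W K hK hH hP hL σ hσ
  rwa [hw, one_zsmul, add_eq_zero_iff_eq_neg] at h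

/-- **Analytic rank one ⇒ root number `−1`** for a curve carrying a modular parametrisation of
level `N_E` (Hecke's functional equation with sign `−ε_f = w(E)`, and the parity of the order of
vanishing equals the sign). [cite: SilvermanAEC2009, App. C §16, Thm. C.16.3] -/
theorem rootNumber_eq_neg_one_of_analyticRank_eq_one
    (W : WeierstrassCurve ℚ) [W.IsElliptic] [NeZero (W.conductorNorm ℤ)]
    (Dt : ModularParametrizationData W (W.conductorNorm ℤ)) (h1 : W.analyticRank = 1) :
    W.rootNumber = -1 := by
  have hpar := even_analyticRank_iff_rootNumber_eq_one_of_hasFunctionalEquationSign_rootNumber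
    (W.hasFunctionalEquationSign_rootNumber_of_isNewformOf Dt.isNewformOf)
  rcases W.rootNumber_eq_one_or with h | h
  · exact absurd (hpar.mpr h) (by rw [h1]; decide)
  · exact h

/-- **The Heegner point of an analytic-rank-one curve is `ℚ`-rational.** With `W`, `K`, `P`, `σ`
as above and `ord_{s=1} L(E,s) = 1`: `P = ι R` for a (unique) `R ∈ E(ℚ)`, `ι : E(ℚ) ↪ E(K)`.
(Gross–Zagier 1986, V §2 for `N = 37`: "`y_K ∈ E(ℚ)`"; Gross–Kohnen–Zagier 1987.) This is the
gen-3 audit input: every Kummer class of `P` is the base change of a class over `ℚ`, so its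
valuations at the two primes of `K` over a split `p` coincide. [cite: GrossZagier1986, V §2, p. 311]
[cite: Darmon2004, Prop. 3.11 and §3.9] -/
theorem exists_incl_eq_heegnerPoint_of_analyticRank_eq_one
    (W : WeierstrassCurve ℚ) [W.IsElliptic] [W.IsGloballyMinimal] [NeZero (W.conductorNorm ℤ)]
    (K : Type) [Field K] [NumberField K] (hK : IsImaginaryQuadratic K)
    (hH : SatisfiesHeegnerHypothesis (W.conductorNorm ℤ) K)
    {P : (W.baseChange K).toAffine.Point} (hP : IsHeegnerPoint (W.conductorNorm ℤ) W K P)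
    (h1 : W.analyticRank = 1) (σ : K →ₐ[ℚ] K) (hσ : σ ≠ AlgHom.id ℚ K) :
    ∃ R : W.toAffine.Point, QuadraticDescent.incl K W R = P := by
  obtain ⟨Dt, -, -, -⟩ := id hP
  exact QuadraticDescent.exists_incl_eq_of_conjMap_eq hK.1 W hσ
    (heegnerPoint_map_eq_self_of_rootNumber_eq_neg_one W K hK hH hP
      (rootNumber_eq_neg_one_of_analyticRank_eq_one W Dt h1) σ hσ)


/-- A quadratic field has a non-trivial `ℚ`-automorphism (the conjugation of a square-root generator). [folklore] -/
theorem exists_algHom_ne_id (K : Type) [Field K] [NumberField K] (hK : IsImaginaryQuadratic K) :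
    ∃ σ : K →ₐ[ℚ] K, σ ≠ AlgHom.id ℚ K := by
  obtain ⟨θ, c, hθ, hc⟩ :=
    Literature.NumberTheory.QuadraticFields.Quadratic.exists_sq_eq_algebraMap (F := ℚ) (K := K) hK.1
  refine ⟨Literature.NumberTheory.QuadraticFields.Quadratic.conj hK.1 hθ hc, fun hid => ?_⟩
  have h1' : Literature.NumberTheory.QuadraticFields.Quadratic.conj hK.1 hθ hc θ = -θ :=
    Literature.NumberTheory.QuadraticFields.Quadratic.conj_gen hK.1 hθ hc
  rw [hid, AlgHom.id_apply] at h1'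
  have h2θ : (2 : K) * θ = 0 := by linear_combination h1'
  exact Literature.NumberTheory.QuadraticFields.Quadratic.ne_zero_of_not_mem_range hθ
    ((mul_eq_zero.mp h2θ).resolve_left two_ne_zero)

/-- **σ-free form of the rationality theorem**: the Heegner point of an analytic-rank-one curve over a Heegner field `K` is the
image of a point of `E(ℚ)`. [cite: GrossZagier1986, V §2, p. 311] [cite: Darmon2004, Prop. 3.11 and §3.9] -/
theorem exists_incl_eq_of_isHeegnerPoint_of_analyticRank_eq_one
    (W : WeierstrassCurve ℚ) [W.IsElliptic] [W.IsGloballyMinimal] [NeZero (W.conductorNorm ℤ)]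
    (K : Type) [Field K] [NumberField K] (hK : IsImaginaryQuadratic K)
    (hH : SatisfiesHeegnerHypothesis (W.conductorNorm ℤ) K)
    {P : (W.baseChange K).toAffine.Point} (hP : IsHeegnerPoint (W.conductorNorm ℤ) W K P)
    (h1 : W.analyticRank = 1) :
    ∃ R : W.toAffine.Point, QuadraticDescent.incl K W R = P := by
  obtain ⟨σ, hσ⟩ := exists_algHom_ne_id K hK
  exact exists_incl_eq_heegnerPoint_of_analyticRank_eq_one W K hK hH hP h1 σ hσ

end Audit

/-! ## §3b  The HALF-PERIOD LAW (gen 3, PROVED): a Fricke-real point is a half-period `2`-torsion point modulo `E⁰(ℝ)`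

For `f` Fricke-invariant (`ε = +1`) with `{∞,0}_f = 0` — both automatic in analytic rank one (§3) — and `τ` with
`γ • τ = w_N • (J • τ)`, `γ ∈ Γ₀(N)`: `c·{∞, γ∞}_f = conj z − z`, `z = c · 2πi ∫_{i∞}^τ f` (so the period is purely imaginary) and
`φ(τ) + uniformize(c·{∞,γ∞}_f / 2) = uniformize(Re z)`.  Ingredients, all tree facts by name: `eichlerIntegral_smul_sub_holds`
(Manin), `IsFrickeEigen.eichlerIntegral_frickeGL_smul` (Cremona (2.10.6)), `eichlerIntegral_J_smul`.  Consequence used by the plan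
for stubs 3 and 5: the real Kummer sign of a real Heegner summand `y_Q` equals that of the `2`-torsion point
`uniformize(c·{∞,γ_Q∞}_f/2)`, i.e. `(−1)^{m⁻(γ_Q)}` when `Δ > 0`. -/

section HalfPeriod

open CongruenceSubgroup ComplexConjugate UpperHalfPlane
open scoped MatrixGroups ModularForm UpperHalfPlane

variable {N : ℕ} [NeZero N] {W : WeierstrassCurve ℚ}

/-- **Half-period law (exact form).** If `f` is Fricke-invariant (`ε = +1`), `{∞,0}_f = 0` and `τ` is Fricke-real,
`γ • τ = w_N • (J • τ)` with `γ ∈ Γ₀(N)`, then `c·{∞, γ∞}_f = conj z − z` for `z = c · 2πi∫_{i∞}^τ f`. [new] -/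
theorem smul_cuspSymbol_eq_conj_sub (Dt : ModularParametrizationData W N) (τ : ℍ) (γ : Gamma0 N)
    (hW : IsFrickeEigen N Dt.f (1 : ℂ)) (h0 : modularSymbol Dt.f 0 = 0)
    (hγ : (γ : SL(2, ℤ)) • τ = glCast (frickeGL N : GL (Fin 2) ℚ) • (J • τ)) :
    (Dt.c : ℂ) * cuspSymbol Dt.f γ
      = conj ((Dt.c : ℂ) * eichlerIntegral Dt.f τ) - (Dt.c : ℂ) * eichlerIntegral Dt.f τ := by
  have h1 := eichlerIntegral_smul_sub_holds Dt.f γ τ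
  rw [hγ, hW.eichlerIntegral_frickeGL_smul, h0, add_zero, one_mul,
    eichlerIntegral_J_smul Dt.f (conj_cuspCoeff_of_isNewformOf Dt.isNewformOf)] at h1
  rw [← h1, mul_sub, map_mul, map_intCast]

/-- The period of the symmetry element of a Fricke-real point is purely imaginary. [new] -/
theorem smul_cuspSymbol_re_eq_zero (Dt : ModularParametrizationData W N) (τ : ℍ) (γ : Gamma0 N)
    (hW : IsFrickeEigen N Dt.f (1 : ℂ)) (h0 : modularSymbol Dt.f 0 = 0)
    (hγ : (γ : SL(2, ℤ)) • τ = glCast (frickeGL N : GL (Fin 2) ℚ) • (J • τ)) :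
    ((Dt.c : ℂ) * cuspSymbol Dt.f γ).re = 0 := by
  rw [smul_cuspSymbol_eq_conj_sub Dt τ γ hW h0 hγ, Complex.sub_re, Complex.conj_re, sub_self]

/-- **Half-period law (point form).** Under the same hypotheses
`φ(τ) + uniformize(c·{∞,γ∞}_f / 2) = uniformize(Re z)`: a Fricke-real point of `X₀(N)` differs from the half-period
`2`-torsion point of its symmetry element by the image of a REAL number, i.e. by a point of `E⁰(ℝ)`. [new] -/
theorem φ_add_uniformize_half_period (Dt : ModularParametrizationData W N) (τ : ℍ) (γ : Gamma0 N)
    (hW : IsFrickeEigen N Dt.f (1 : ℂ)) (h0 : modularSymbol Dt.f 0 = 0)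
    (hγ : (γ : SL(2, ℤ)) • τ = glCast (frickeGL N : GL (Fin 2) ℚ) • (J • τ)) :
    Dt.φ τ + Dt.uniformize ((Dt.c : ℂ) * cuspSymbol Dt.f γ / 2)
      = Dt.uniformize ((((Dt.c : ℂ) * eichlerIntegral Dt.f τ).re : ℝ) : ℂ) := by
  rw [ModularParametrizationData.φ, ← map_add]
  congr 1
  rw [smul_cuspSymbol_eq_conj_sub Dt τ γ hW h0 hγ]
  set z : ℂ := (Dt.c : ℂ) * eichlerIntegral Dt.f τ
  rw [show z + (conj z - z) / 2 = (z + conj z) / 2 by ring, Complex.add_conj]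
  push_cast
  ring

/-- The half-period point is `2`-torsion: `2 • uniformize(c·{∞,γ∞}_f / 2) = O` (`c Λ_f ⊆ Λ_E`). [folklore] -/
theorem two_nsmul_uniformize_half_period (Dt : ModularParametrizationData W N) (γ : Gamma0 N) :
    2 • Dt.uniformize ((Dt.c : ℂ) * cuspSymbol Dt.f γ / 2) = 0 := by
  rw [← map_nsmul, nsmul_eq_mul, Nat.cast_ofNat, mul_div_cancel₀ _ (two_ne_zero' ℂ),
    Dt.uniformize_eq_zero_iff]
  exact Dt.smul_periodLattice_le _ (cuspSymbol_mem_periodLattice Dt.f γ)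

end HalfPeriod

/-! ## §3c  KUMMER ALGEBRA (gen 4, PROVED): the `φ̂`-Kummer map at a `2`-torsion point is multiplicative up to SQUARES
(Silverman AEC X.4.9 in Mathlib's five-coefficient generality, sorry-free), and its SIGN `δ_∞` is a homomorphism on `E(ℚ)`

These are the algebraic heart of stubs 3(c) and 4: for `T = (e, yₑ)` of order `2` on `V` and `P₁ + P₂ + P₃ = O` generic,
`(x₁ − e)(x₂ − e)(x₃ − e) = ℓ_T²` with `ℓ_T` the value at `x = e` of the chord through `P₁, P₂` minus `yₑ`
(`kummer_chord_sq`); and `(x(T + P) − e)(x(P) − e) = δ_T` (`kummer_twoTorsion_add`, stated `×2` to be characteristic-free).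
Over `ℚ ⊂ ℝ` the sign of the Kummer value is therefore a homomorphism `E(ℚ) → {±1}` (`sign_kummerValQ_add`). -/

section KummerAlgebra

variable {F : Type*} [Field F] [DecidableEq F] {V : Affine F}

omit [DecidableEq F] in
/-- Evaluating Mathlib's `addPolynomial x₁ y₁ ℓ` (the Weierstrass polynomial restricted to the line `y = ℓ(x − x₁) + y₁`)
at an arbitrary abscissa. [folklore] -/
theorem eval_addPolynomial_eq (x₁ y₁ ℓ x : F) :
    (V.addPolynomial x₁ y₁ ℓ).eval x =
      (ℓ * (x - x₁) + y₁) ^ 2 + V.a₁ * x * (ℓ * (x - x₁) + y₁) + V.a₃ * (ℓ * (x - x₁) + y₁) -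
        (x ^ 3 + V.a₂ * x ^ 2 + V.a₄ * x + V.a₆) := by
  simp only [Affine.addPolynomial, Affine.linePolynomial, Affine.polynomial, Polynomial.eval_add,
    Polynomial.eval_sub, Polynomial.eval_mul, Polynomial.eval_pow, Polynomial.eval_C, Polynomial.eval_X]
  ring

omit [DecidableEq F] in
/-- At a `2`-division abscissa the `y`-fibre of the curve is ONE point: `V.Equation e y → y = yₑ`. [folklore] -/
theorem y_eq_of_equation_twoTorsionX {e ye y : F} (hT : V.Equation e ye) (h2 : ye = V.negY e ye)
    (hP : V.Equation e y) : y = ye := by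
  rcases Affine.Y_eq_of_X_eq hP hT rfl with h | h
  · exact h
  · rw [h, ← h2]

/-- **AEC X.4.9, chord form (all characteristics).**  `T = (e, yₑ)` on `V` with `yₑ = negY e yₑ` (a point of order `2`),
`P₁ = (x₁, y₁)`, `P₂ = (x₂, y₂)` on `V` with `P₁ ≠ −P₂`, `x₃ = x(P₁ + P₂)` (Mathlib `addX` at the chord/tangent slope).  Then
`(x₁ − e)(x₂ − e)(x₃ − e) = (ℓ·(e − x₁) + y₁ − yₑ)²` — a SQUARE: the Kummer map `P ↦ x(P) − e` of the `2`-isogeny with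
kernel `⟨T⟩` is multiplicative modulo squares on generic sums.  Proof: evaluate Mathlib's factorisation
`addPolynomial = −(X − x₁)(X − x₂)(X − x₃)` at `X = e` and complete the square using `2yₑ + a₁e + a₃ = 0`.
[cite: SilvermanAEC2009, X.4.9] -/
theorem kummer_chord_sq {e ye x₁ y₁ x₂ y₂ : F} (hT : V.Equation e ye) (h2 : ye = V.negY e ye)
    (h₁ : V.Equation x₁ y₁) (h₂ : V.Equation x₂ y₂) (hxy : ¬(x₁ = x₂ ∧ y₁ = V.negY x₂ y₂)) :
    (x₁ - e) * (x₂ - e) * (V.addX x₁ x₂ (V.slope x₁ x₂ y₁ y₂) - e) =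
      (V.slope x₁ x₂ y₁ y₂ * (e - x₁) + y₁ - ye) ^ 2 := by
  have key := congrArg (Polynomial.eval e) (Affine.addPolynomial_slope h₁ h₂ hxy)
  rw [eval_addPolynomial_eq] at key
  simp only [Polynomial.eval_neg, Polynomial.eval_mul, Polynomial.eval_sub, Polynomial.eval_X,
    Polynomial.eval_C] at key
  rw [Affine.equation_iff] at hT
  rw [Affine.negY] at h2
  linear_combination -key + hT + (V.slope x₁ x₂ y₁ y₂ * (e - x₁) + y₁ - ye) * h2

/-- **AEC X.4.9, translation by `T` (all characteristics).**  `T = (e, yₑ)` of order `2` on `V`, `P = (x, y)` on `V` with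
`x ≠ e`.  Then `2·(x(T + P) − e)·(x(P) − e) = 6e² + b₂e + b₄` (`= 2δ_T`, `δ_T = 3e² + (b₂/2)e + b₄/2` the coefficient `b` of
the model `Y² = X(X² + aX + b)`, `X = x − e`): in that model `X(P + T)·X(P) = b` on the nose. [cite: SilvermanAEC2009, X.4.9] -/
theorem kummer_twoTorsion_add {e ye x y : F} (hT : V.Equation e ye) (h2 : ye = V.negY e ye)
    (hP : V.Equation x y) (hx : x ≠ e) :
    2 * ((V.addX e x (V.slope e x ye y) - e) * (x - e)) = 6 * e ^ 2 + V.b₂ * e + V.b₄ := by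
  have hex : e ≠ x := fun h => hx h.symm
  have hu : x - e ≠ 0 := sub_ne_zero.mpr hx
  have hu' : e - x ≠ 0 := sub_ne_zero.mpr hex
  rw [Affine.equation_iff] at hT hP
  rw [Affine.negY] at h2
  have hL : V.slope e x ye y * (x - e) = y - ye := by
    rw [Affine.slope_of_X_ne hex, div_mul_eq_mul_div, div_eq_iff hu']
    ring
  have hye2 : 2 * ye = -(V.a₁ * e + V.a₃) := by linear_combination h2
  have hPe : e ^ 3 + V.a₂ * e ^ 2 + V.a₄ * e + V.a₆ = -ye ^ 2 := by linear_combination -hT + ye * h2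
  have key : (2 * ((V.addX e x (V.slope e x ye y) - e) * (x - e)) - (6 * e ^ 2 + V.b₂ * e + V.b₄)) * (x - e) = 0 := by
    simp only [Affine.addX, WeierstrassCurve.b₂, WeierstrassCurve.b₄]
    linear_combination (2 * (V.slope e x ye y * (x - e) + y - ye) + 2 * V.a₁ * (x - e)) * hL + 2 * hP + 2 * hPe -
      (2 * y + V.a₁ * (x - e)) * hye2
  rcases mul_eq_zero.mp key with h | h
  · exact sub_eq_zero.mp h
  · exact absurd h hu

end KummerAlgebra

/-! ### The real Kummer sign on `E(ℚ)` is a homomorphism (gen 4, PROVED) -/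

section KummerSignQ

variable (W : WeierstrassCurve ℚ) (e : ℚ)

@[simp] theorem kummerValQ_zero : kummerValQ W e 0 = 1 := rfl

@[simp] theorem kummerValQ_some {x y : ℚ} (h : W.toAffine.Nonsingular x y) :
    kummerValQ W e (.some x y h) = if x = e then deltaT W e else x - e := rfl

/-- `x(−P) = x(P)`, so the Kummer value is even. [folklore] -/
@[simp] theorem kummerValQ_neg (P : W.toAffine.Point) : kummerValQ W e (-P) = kummerValQ W e P := by
  rcases P with _ | ⟨x, y, h⟩
  · rfl
  · rw [Affine.Point.neg_some]; rfl

variable {W e}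

/-- `2δ_T = 6e² + b₂e + b₄`. [folklore] -/
theorem two_mul_deltaT : 2 * deltaT W e = 6 * e ^ 2 + W.b₂ * e + W.b₄ := by
  unfold deltaT; ring

/-- **`δ_T ≠ 0` on an elliptic curve**: `δ_T = (3e² + 2a₂e + a₄) − a₁yₑ = −F_x(T)` while `F_y(T) = 2yₑ + a₁e + a₃ = 0`, so
`δ_T = 0` would make `T` singular. [cite: SilvermanAEC2009, X.4.9] -/
theorem deltaT_ne_zero [W.IsElliptic] (he : HasRationalTwoTorsionX W e) : deltaT W e ≠ 0 := by
  obtain ⟨ye, hE, h2⟩ := he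
  have hns := (Affine.equation_iff_nonsingular (W := W)).mp hE
  rw [Affine.nonsingular_iff'] at hns
  obtain ⟨-, hns⟩ := hns
  rcases hns with h | h
  · intro hδ
    apply h
    unfold deltaT at hδ
    simp only [WeierstrassCurve.b₂, WeierstrassCurve.b₄] at hδ
    linear_combination -hδ + (W.a₁ / 2) * h2
  · exact absurd h2 h

/-- The Kummer value of a rational point is never `0` (elliptic curve, `T = (e,·)` rational of order `2`). [folklore] -/
theorem kummerValQ_ne_zero [W.IsElliptic] (he : HasRationalTwoTorsionX W e) (P : W.toAffine.Point) :
    kummerValQ W e P ≠ 0 := by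
  rcases P with _ | ⟨x, y, h⟩
  · exact one_ne_zero
  · rw [kummerValQ_some]
    split_ifs with hx
    · exact deltaT_ne_zero he
    · exact sub_ne_zero.mpr hx

/-- Signs from a positive triple product. [folklore] -/
private theorem sign_eq_of_mul_mul_pos {a b c : ℚ} (h : 0 < a * b * c) :
    SignType.sign c = SignType.sign a * SignType.sign b := by
  have hab0 : a * b ≠ 0 := by
    intro h0; rw [h0, zero_mul] at h; exact lt_irrefl _ h
  have ha : a ≠ 0 := left_ne_zero_of_mul hab0
  have hb : b ≠ 0 := right_ne_zero_of_mul hab0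
  rcases lt_or_gt_of_ne ha with ha | ha <;> rcases lt_or_gt_of_ne hb with hb | hb
  · have hab : 0 < a * b := mul_pos_of_neg_of_neg ha hb
    have hc : 0 < c := by
      by_contra hc; rw [not_lt] at hc; nlinarith
    rw [sign_neg ha, sign_neg hb, sign_pos hc]; simp
  · have hab : a * b < 0 := mul_neg_of_neg_of_pos ha hb
    have hc : c < 0 := by
      by_contra hc; rw [not_lt] at hc; nlinarith
    rw [sign_neg ha, sign_pos hb, sign_neg hc]; simp
  · have hab : a * b < 0 := mul_neg_of_pos_of_neg ha hb
    have hc : c < 0 := by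
      by_contra hc; rw [not_lt] at hc; nlinarith
    rw [sign_pos ha, sign_neg hb, sign_neg hc]; simp
  · have hab : 0 < a * b := mul_pos ha hb
    have hc : 0 < c := by
      by_contra hc; rw [not_lt] at hc; nlinarith
    rw [sign_pos ha, sign_pos hb, sign_pos hc]; simp

/-- Signs from an exact product: `c·b = d`, `b ≠ 0` ⟹ `sign c = sign d · sign b`. [folklore] -/
private theorem sign_eq_of_mul_eq {b c d : ℚ} (h : c * b = d) (hb : b ≠ 0) :
    SignType.sign c = SignType.sign d * SignType.sign b := by
  rw [← h, sign_mul, mul_assoc, ← sign_mul, sign_pos (mul_self_pos.mpr hb), mul_one]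

/-- The `T`-translation case of the sign law: `x(P) ≠ e`, `δ_T ≠ 0` ⟹ `x(T + P) ≠ e` and
`sign(x(T+P) − e) = sign δ_T · sign(x(P) − e)`. [cite: SilvermanAEC2009, X.4.9] -/
theorem sign_addX_twoTorsion {ye x y : ℚ} (hT : W.toAffine.Equation e ye) (h2 : ye = W.toAffine.negY e ye)
    (hP : W.toAffine.Equation x y) (hx : x ≠ e) (hδ : deltaT W e ≠ 0) :
    W.toAffine.addX e x (W.toAffine.slope e x ye y) ≠ e ∧
      SignType.sign (W.toAffine.addX e x (W.toAffine.slope e x ye y) - e) =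
        SignType.sign (deltaT W e) * SignType.sign (x - e) := by
  have key : (W.toAffine.addX e x (W.toAffine.slope e x ye y) - e) * (x - e) = deltaT W e := by
    have h := kummer_twoTorsion_add (V := W.toAffine) hT h2 hP hx
    have h2δ := two_mul_deltaT (W := W) (e := e)
    linear_combination h / 2 - h2δ / 2
  refine ⟨fun h0 => hδ ?_, sign_eq_of_mul_eq key (sub_ne_zero.mpr hx)⟩
  rw [h0, sub_self, zero_mul] at key
  exact key.symm

/-- **THE REAL KUMMER SIGN `δ_∞` IS A HOMOMORPHISM ON `E(ℚ)`** (gen 4, PROVED; the algebraic heart of stubs 3(c) and 4).  For an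
elliptic curve `W/ℚ` with a rational point `T = (e, ·)` of order `2`:
`sign k(P + Q) = sign k(P) · sign k(Q)` for ALL `P, Q ∈ E(ℚ)`, `k = kummerValQ W e` (`O ↦ 1`, `T ↦ δ_T`, `(x,y) ↦ x − e`).
Cases: `O`; `Q = −P` (`k` even, `k ≠ 0`); `P = T` or `Q = T` (translation identity); generic chord with `P + Q ≠ T` (the chord
identity: a non-zero square is positive); generic chord with `P + Q = T` (then `Q = T − P`: translation identity again).
[cite: SilvermanAEC2009, X.4.9] -/
theorem sign_kummerValQ_add [W.IsElliptic] (he : HasRationalTwoTorsionX W e) (P Q : W.toAffine.Point) :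
    SignType.sign (kummerValQ W e (P + Q)) = SignType.sign (kummerValQ W e P) * SignType.sign (kummerValQ W e Q) := by
  obtain ⟨ye, hTe, h2e⟩ := he
  have hδ : deltaT W e ≠ 0 := deltaT_ne_zero ⟨ye, hTe, h2e⟩
  have hk0 : ∀ R : W.toAffine.Point, kummerValQ W e R ≠ 0 := kummerValQ_ne_zero ⟨ye, hTe, h2e⟩
  have h2 : ye = W.toAffine.negY e ye := by rw [Affine.negY]; linear_combination h2e
  have hTns : W.toAffine.Nonsingular e ye := (Affine.equation_iff_nonsingular (W := W)).mp hTe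
  -- the affine/affine case with the FIRST point equal to `T`
  have hTcase : ∀ {x₁ y₁ x₂ y₂ : ℚ} (h₁ : W.toAffine.Nonsingular x₁ y₁) (h₂ : W.toAffine.Nonsingular x₂ y₂),
      x₁ = e → x₂ ≠ e →
      SignType.sign (kummerValQ W e (.some x₁ y₁ h₁ + .some x₂ y₂ h₂)) =
        SignType.sign (kummerValQ W e (.some x₁ y₁ h₁)) * SignType.sign (kummerValQ W e (.some x₂ y₂ h₂)) := by
    intro x₁ y₁ x₂ y₂ h₁ h₂ hx₁ hx₂
    have hy₁ : y₁ = ye := y_eq_of_equation_twoTorsionX (V := W.toAffine) hTe h2 (hx₁ ▸ h₁.left)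
    subst hx₁ hy₁
    obtain ⟨hx₃, hsgn⟩ := sign_addX_twoTorsion hTe h2 h₂.left hx₂ hδ
    rw [Affine.Point.add_of_X_ne (fun h => hx₂ h.symm), kummerValQ_some, kummerValQ_some, kummerValQ_some, if_neg hx₃,
      if_pos rfl, if_neg hx₂, hsgn]
  rcases P with _ | ⟨x₁, y₁, h₁⟩ <;> rcases Q with _ | ⟨x₂, y₂, h₂⟩
  · simp only [← Affine.Point.zero_def, add_zero, kummerValQ_zero, sign_one, mul_one]
  · simp only [← Affine.Point.zero_def, zero_add, kummerValQ_zero, sign_one, one_mul]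
  · simp only [← Affine.Point.zero_def, add_zero, kummerValQ_zero, sign_one, mul_one]
  · by_cases hxy : x₁ = x₂ ∧ y₁ = W.toAffine.negY x₂ y₂
    · -- `Q = −P`: the sum is `O` and the two Kummer values coincide (they only see `x`)
      rw [Affine.Point.add_of_Y_eq hxy.1 hxy.2, kummerValQ_zero, sign_one]
      have hPQ : kummerValQ W e (.some x₁ y₁ h₁) = kummerValQ W e (.some x₂ y₂ h₂) := by
        simp only [kummerValQ_some, hxy.1]
      rw [hPQ, ← sign_mul, sign_pos (mul_self_pos.mpr (hk0 _))]
    · by_cases hx₁ : x₁ = e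
      · have hx₂ : x₂ ≠ e := by
          intro hx₂
          apply hxy
          have hy₁ := y_eq_of_equation_twoTorsionX (V := W.toAffine) hTe h2 (hx₁ ▸ h₁.left)
          have hy₂ := y_eq_of_equation_twoTorsionX (V := W.toAffine) hTe h2 (hx₂ ▸ h₂.left)
          refine ⟨hx₁.trans hx₂.symm, ?_⟩
          rw [hy₁, hy₂, hx₂]
          exact h2
        exact hTcase h₁ h₂ hx₁ hx₂
      · by_cases hx₂ : x₂ = e
        · rw [add_comm, mul_comm]
          exact hTcase h₂ h₁ hx₂ hx₁
        · -- generic chord: `P, Q ∉ {O, T}`, `Q ≠ −P`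
          have hsq := kummer_chord_sq (V := W.toAffine) hTe h2 h₁.left h₂.left hxy
          by_cases hx₃ : W.toAffine.addX x₁ x₂ (W.toAffine.slope x₁ x₂ y₁ y₂) = e
          · -- the sum is `T`: `Q = T + (−P)` and the translation identity gives `sign δ_T · sign(x₁ − e) = sign(x₂ − e)`
            have hS : (Affine.Point.some x₁ y₁ h₁) + (Affine.Point.some x₂ y₂ h₂) = Affine.Point.some e ye hTns := by
              rw [Affine.Point.add_some hxy]
              have hy₃ : W.toAffine.addY x₁ x₂ y₁ (W.toAffine.slope x₁ x₂ y₁ y₂) = ye :=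
                y_eq_of_equation_twoTorsionX (V := W.toAffine) hTe h2
                  (hx₃ ▸ (Affine.nonsingular_add h₁ h₂ hxy).left)
              simp only [Affine.Point.some.injEq]
              exact ⟨hx₃, hy₃⟩
            have hQ : Affine.Point.some x₂ y₂ h₂ = Affine.Point.some e ye hTns + -(Affine.Point.some x₁ y₁ h₁) := by
              rw [← hS]; abel
            rw [Affine.Point.neg_some, Affine.Point.add_of_X_ne (fun h => hx₁ h.symm)] at hQ
            simp only [Affine.Point.some.injEq] at hQ
            obtain ⟨-, hsgn⟩ :=
              sign_addX_twoTorsion hTe h2 ((Affine.equation_neg x₁ y₁).mpr h₁.left) hx₁ hδ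
            rw [← hQ.1] at hsgn
            rw [Affine.Point.add_some hxy, kummerValQ_some, kummerValQ_some, kummerValQ_some, if_pos hx₃, if_neg hx₁,
              if_neg hx₂, hsgn, mul_left_comm, ← sign_mul, sign_pos (mul_self_pos.mpr (sub_ne_zero.mpr hx₁)), mul_one]
          · rw [Affine.Point.add_some hxy, kummerValQ_some, kummerValQ_some, kummerValQ_some, if_neg hx₃, if_neg hx₁,
              if_neg hx₂]
            apply sign_eq_of_mul_mul_pos
            rw [hsq]
            have hs : W.toAffine.slope x₁ x₂ y₁ y₂ * (e - x₁) + y₁ - ye ≠ 0 := by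
              intro hs
              rw [hs, zero_pow two_ne_zero] at hsq
              rcases mul_eq_zero.mp hsq with h | h
              · rcases mul_eq_zero.mp h with h | h
                · exact hx₁ (sub_eq_zero.mp h)
                · exact hx₂ (sub_eq_zero.mp h)
              · exact hx₃ (sub_eq_zero.mp h)
            exact lt_of_le_of_ne (sq_nonneg _) (Ne.symm (pow_ne_zero 2 hs))

/-- `δ_∞` on multiples: `sign k(n • P) = (sign k(P))^n`. [folklore] -/
theorem sign_kummerValQ_nsmul [W.IsElliptic] (he : HasRationalTwoTorsionX W e) (P : W.toAffine.Point) (n : ℕ) :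
    SignType.sign (kummerValQ W e (n • P)) = SignType.sign (kummerValQ W e P) ^ n := by
  induction n with
  | zero => rw [zero_nsmul, kummerValQ_zero, sign_one, pow_zero]
  | succ n ih => rw [succ_nsmul, sign_kummerValQ_add he, ih, pow_succ]

/-- `δ_∞` on integer multiples: `sign k(n • P) = (sign k(P))^{|n|}` (`k` is even). [folklore] -/
theorem sign_kummerValQ_zsmul [W.IsElliptic] (he : HasRationalTwoTorsionX W e) (P : W.toAffine.Point) (n : ℤ) :
    SignType.sign (kummerValQ W e (n • P)) = SignType.sign (kummerValQ W e P) ^ n.natAbs := by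
  obtain ⟨m, rfl | rfl⟩ := Int.eq_nat_or_neg n
  · rw [natCast_zsmul, sign_kummerValQ_nsmul he, Int.natAbs_natCast]
  · rw [neg_zsmul, kummerValQ_neg, natCast_zsmul, sign_kummerValQ_nsmul he, Int.natAbs_neg, Int.natAbs_natCast]

/-- `δ_∞` of a difference lying in a sign-trivial subgroup: if `sign k = 1` on torsion and `P − Q` is torsion then
`sign k(P) = sign k(Q)`. [folklore] -/
theorem sign_kummerValQ_eq_of_sub_mem_torsion [W.IsElliptic] (he : HasRationalTwoTorsionX W e)
    (htors : TorsionSignTrivial W e) {P Q : W.toAffine.Point}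
    (h : P - Q ∈ AddCommGroup.torsion W.toAffine.Point) :
    SignType.sign (kummerValQ W e P) = SignType.sign (kummerValQ W e Q) := by
  have h1 := sign_kummerValQ_add he (P - Q) Q
  rw [sub_add_cancel, htors _ h, one_mul] at h1
  exact h1


/-- Halving `2`-power torsion: in an abelian group with no element of order `4`, `2^k • s = 0` forces `2 • s = 0`. [folklore] -/
theorem two_nsmul_eq_zero_of_two_pow_nsmul_eq_zero {G : Type*} [AddCommGroup G]
    (h4 : ∀ t : G, 4 • t = 0 → 2 • t = 0) (k : ℕ) (s : G) (hs : 2 ^ k • s = 0) : 2 • s = 0 := by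
  induction k generalizing s with
  | zero => rw [pow_zero, one_nsmul] at hs; rw [hs, nsmul_zero]
  | succ k ih =>
    apply h4
    have h2 : 2 ^ k • (2 • s) = 0 := by rw [← mul_nsmul', ← pow_succ, hs]
    have := ih (2 • s) h2
    rwa [← mul_nsmul'] at this

/-- **`TorsionSignTrivial` is a finite check** (row decidability of the arch floor).  If `δ_∞ = +1` on the rational `2`-torsion
`E(ℚ)[2]` (at most three points: `sign δ_T` at `T = (e, y_T)` and `sign (x − e)` at the other rational `2`-division roots) and `E(ℚ)`
has no point of order `4`, then `δ_∞ = +1` on all of `E(ℚ)_tors`: `δ_∞` is `{±1}`-valued, so an odd multiple does not change it,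
and higher `2`-power orders are excluded. [folklore] -/
theorem torsionSignTrivial_of_twoTorsion [W.IsElliptic] (he : HasRationalTwoTorsionX W e)
    (h2 : ∀ t : W.toAffine.Point, 2 • t = 0 → SignType.sign (kummerValQ W e t) = 1)
    (h4 : ∀ t : W.toAffine.Point, 4 • t = 0 → 2 • t = 0) : TorsionSignTrivial W e := by
  unfold TorsionSignTrivial
  intro t ht
  obtain ⟨n, hn, hnt⟩ := ((AddCommGroup.mem_torsion _).mp ht).exists_nsmul_eq_zero
  obtain ⟨a, m, hm, rfl⟩ := Nat.exists_eq_two_pow_mul_odd hn.ne'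
  have hs : 2 • (m • t) = 0 :=
    two_nsmul_eq_zero_of_two_pow_nsmul_eq_zero h4 a (m • t) (by rwa [← mul_nsmul'])
  have h1 := h2 _ hs
  rw [sign_kummerValQ_nsmul he] at h1
  have hne : SignType.sign (kummerValQ W e t) ≠ 0 := by
    rw [Ne, sign_eq_zero_iff]; exact kummerValQ_ne_zero he t
  obtain ⟨j, hj⟩ := hm
  rw [hj] at h1
  have hsq : SignType.sign (kummerValQ W e t) ^ 2 = 1 := by
    rw [sq]; generalize SignType.sign (kummerValQ W e t) = u at hne ⊢; cases u <;> simp_all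
  rw [pow_succ, pow_mul, hsq, one_pow, one_mul] at h1
  exact h1

/-- In any abelian group: if `4 ∤ #G_tors` (as a `Nat.card`; this already forces `G_tors` finite) then `G` has no element of order `4`:
`4 • t = 0 ⇒ 2 • t = 0`. [new, v4.8] -/
theorem two_nsmul_eq_zero_of_not_four_dvd_card_torsion {G : Type*} [AddCommGroup G]
    (h : ¬ 4 ∣ Nat.card (AddCommGroup.torsion G)) (t : G) (ht : 4 • t = 0) : 2 • t = 0 := by
  have hne : Nat.card (AddCommGroup.torsion G) ≠ 0 := fun h0 => h (h0 ▸ dvd_zero 4)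
  haveI : Finite (AddCommGroup.torsion G) := Nat.finite_of_card_ne_zero hne
  have hfin : IsOfFinAddOrder t := isOfFinAddOrder_iff_nsmul_eq_zero.mpr ⟨4, by norm_num, ht⟩
  have hmem : t ∈ AddCommGroup.torsion G := (AddCommGroup.mem_torsion _).mpr hfin
  have hdvd4 : addOrderOf t ∣ 2 ^ 2 := by simpa using addOrderOf_dvd_of_nsmul_eq_zero ht
  have hcard : addOrderOf t ∣ Nat.card (AddCommGroup.torsion G) := by
    have h1 := addOrderOf_dvd_natCard (⟨t, hmem⟩ : AddCommGroup.torsion G)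
    rwa [← AddSubgroup.addOrderOf_coe] at h1
  obtain ⟨k, hk, hk'⟩ := (Nat.dvd_prime_pow Nat.prime_two).mp hdvd4
  apply addOrderOf_dvd_iff_nsmul_eq_zero.mp
  interval_cases k
  · rw [hk', pow_zero]; exact one_dvd 2
  · rw [hk', pow_one]
  · rw [hk'] at hcard; exact absurd hcard h

/-- Instance bridge: `W.torsionOrder` is stated under `open scoped Classical` (its `E(ℚ)` group structure is built on `Classical.propDecidable`),
this file's points use `instDecidableEqRat`; the two `Nat.card`s agree because `DecidableEq ℚ` is a subsingleton. [new, v4.8] -/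
theorem torsionOrder_eq_card_torsion : W.torsionOrder = Nat.card (AddCommGroup.torsion W.toAffine.Point) := by
  unfold WeierstrassCurve.torsionOrder
  congr!

/-- **No rational `4`-torsion from the torsion ORDER** — the invariant the crux and the ledger speak (`W.torsionOrder = #E(ℚ)_tors`):
`¬ 4 ∣ W.torsionOrder ⇒ ∀ t, 4 • t = 0 → 2 • t = 0` (no finiteness fact needed). [new, v4.8] -/
theorem two_nsmul_eq_zero_of_not_four_dvd_torsionOrder (h : ¬ 4 ∣ W.torsionOrder) (t : W.toAffine.Point) (ht : 4 • t = 0) :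
    2 • t = 0 := by
  rw [torsionOrder_eq_card_torsion] at h
  exact two_nsmul_eq_zero_of_not_four_dvd_card_torsion h t ht

/-- **`TorsionSignTrivial` from `δ_∞` on `E(ℚ)[2]` and `4 ∤ #E(ℚ)_tors`** (the row datum in ledger currency: on type A `2 ∣ #E(ℚ)_tors`,
and `v₂ #E(ℚ)_tors = 1` is exactly «one rational `2`-torsion point, no rational `4`-torsion»). [new, v4.8] -/
theorem torsionSignTrivial_of_not_four_dvd_torsionOrder [W.IsElliptic] (he : HasRationalTwoTorsionX W e)
    (h2 : ∀ t : W.toAffine.Point, 2 • t = 0 → SignType.sign (kummerValQ W e t) = 1) (h4 : ¬ 4 ∣ W.torsionOrder) :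
    TorsionSignTrivial W e :=
  torsionSignTrivial_of_twoTorsion he h2 (two_nsmul_eq_zero_of_not_four_dvd_torsionOrder h4)

/-- A rational point `(x, y)` with `2 • (x, y) = O` satisfies `2y + a₁x + a₃ = 0` (it equals its negative). [new, v4.9] -/
theorem two_nsmul_some_eq_zero_imp {x y : ℚ} (h : W.toAffine.Nonsingular x y)
    (h2 : 2 • (WeierstrassCurve.Affine.Point.some x y h : W.toAffine.Point) = 0) : 2 * y + W.a₁ * x + W.a₃ = 0 := by
  rw [two_nsmul, add_eq_zero_iff_eq_neg, WeierstrassCurve.Affine.Point.neg_some,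
    WeierstrassCurve.Affine.Point.some.injEq] at h2
  obtain ⟨-, hy⟩ := h2
  rw [WeierstrassCurve.Affine.negY] at hy
  linear_combination hy

/-- **`TorsionSignTrivial` from the `2`-division CUBIC** (row datum as polynomial facts, PROVED): if `e` is the ONLY rational
`2`-division root (`E(ℚ)[2] = {O, T}`), `δ_T = f′(e) > 0` (`e` is not the middle real root) and `E(ℚ)` has no point of order `4`, then
`δ_∞ = +1` on `E(ℚ)_tors`. [new, v4.9] -/
theorem torsionSignTrivial_of_unique_twoDivisionRoot [W.IsElliptic] (he : HasRationalTwoTorsionX W e)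
    (huniq : ∀ x y : ℚ, W.toAffine.Equation x y → 2 * y + W.a₁ * x + W.a₃ = 0 → x = e) (hδ : 0 < deltaT W e)
    (h4 : ∀ t : W.toAffine.Point, 4 • t = 0 → 2 • t = 0) : TorsionSignTrivial W e := by
  refine torsionSignTrivial_of_twoTorsion he (fun t ht => ?_) h4
  rcases t with _ | ⟨x, y, h⟩
  · exact sign_one
  · have hx : x = e := huniq x y h.1 (two_nsmul_some_eq_zero_imp h ht)
    subst hx
    rw [kummerValQ_some, if_pos rfl]
    exact sign_pos hδ

/-- **`TorsionSignTrivial` in LEDGER CURRENCY** (PROVED): `e` the only rational `2`-division root, `δ_T > 0`, and `4 ∤ #E(ℚ)_tors`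
(`W.torsionOrder`; on such a row `v₂ #E(ℚ)_tors = 1`). [new, v4.9] -/
theorem torsionSignTrivial_of_unique_twoDivisionRoot_of_not_four_dvd [W.IsElliptic] (he : HasRationalTwoTorsionX W e)
    (huniq : ∀ x y : ℚ, W.toAffine.Equation x y → 2 * y + W.a₁ * x + W.a₃ = 0 → x = e) (hδ : 0 < deltaT W e)
    (h4 : ¬ 4 ∣ W.torsionOrder) : TorsionSignTrivial W e :=
  torsionSignTrivial_of_unique_twoDivisionRoot he huniq hδ (two_nsmul_eq_zero_of_not_four_dvd_torsionOrder h4)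

end KummerSignQ

/-! ### §3d  The real Kummer sign `δ_∞` on REAL complex points is a homomorphism (gen 4, PROVED)

The `E(ℝ) ⊂ E(ℂ)` half of stub 3 (c), in the exact currency of stub 3 (`IsRealPoint`, `realKummerSign`): on complex
points fixed by `conjPoint`, `realKummerSign W e` (the sign of the — real — Kummer value) is multiplicative, and it agrees
with `sign ∘ kummerValQ` on the image of `E(ℚ)`.  Same five cases as over `ℚ`; realness of the coordinates of a sum and of
the chord slope come from `conjPoint` being Mathlib's `Point.map` along `conj` (`map_add`, `baseChange_slope`). -/

section KummerSignC

open scoped ComplexConjugate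

variable (W : WeierstrassCurve ℚ) (e : ℚ)

theorem kummerValK_zero (F : Type) [Field F] [Algebra ℚ F] : kummerValK F W e 0 = 1 := rfl

theorem kummerValK_some (F : Type) [Field F] [Algebra ℚ F] {x y : F} (h : (W.baseChange F).toAffine.Nonsingular x y) :
    kummerValK F W e (.some x y h) =
      if x = algebraMap ℚ F e then algebraMap ℚ F (deltaT W e) else x - algebraMap ℚ F e := rfl

/-- `algebraMap ℚ ℂ` is the coercion. [folklore] -/
theorem algebraMap_rat_complex (q : ℚ) : algebraMap ℚ ℂ q = (q : ℂ) := eq_ratCast _ q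

/-- `sign` commutes with `ℚ ↪ ℝ`. [folklore] -/
theorem sign_ratCast_real (q : ℚ) : SignType.sign ((q : ℚ) : ℝ) = SignType.sign q := by
  rcases lt_trichotomy q 0 with h | h | h
  · rw [sign_neg h, sign_neg (by exact_mod_cast h)]
  · rw [h, Rat.cast_zero, sign_zero, sign_zero]
  · rw [sign_pos h, sign_pos (by exact_mod_cast h)]

theorem realKummerSign_zero : realKummerSign W e 0 = 1 := by
  rw [realKummerSign, kummerValK_zero, Complex.one_re, sign_one]

theorem realKummerSign_neg (P : (W.baseChange ℂ).toAffine.Point) : realKummerSign W e (-P) = realKummerSign W e P := by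
  rcases P with _ | ⟨x, y, h⟩
  · rfl
  · rw [Affine.Point.neg_some]; rfl

theorem realKummerSign_some_of_ne {x y : ℂ} (h : (W.baseChange ℂ).toAffine.Nonsingular x y) (hx : x ≠ (e : ℂ)) :
    realKummerSign W e (.some x y h) = SignType.sign (x.re - e) := by
  rw [realKummerSign, kummerValK_some, algebraMap_rat_complex, if_neg hx, Complex.sub_re, Complex.ratCast_re]

theorem realKummerSign_some_of_eq {x y : ℂ} (h : (W.baseChange ℂ).toAffine.Nonsingular x y) (hx : x = (e : ℂ)) :
    realKummerSign W e (.some x y h) = SignType.sign (deltaT W e) := by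
  rw [realKummerSign, kummerValK_some, algebraMap_rat_complex, if_pos hx, algebraMap_rat_complex, Complex.ratCast_re,
    sign_ratCast_real]

variable {W e}

/-- A complex affine point is REAL iff its two coordinates are `conj`-fixed. [folklore] -/
theorem isRealPoint_some_iff {x y : ℂ} (h : (W.baseChange ℂ).toAffine.Nonsingular x y) :
    IsRealPoint W (.some x y h) ↔ conj x = x ∧ conj y = y := by
  show Affine.Point.map _ (Affine.Point.some x y h) = Affine.Point.some x y h ↔ _
  rw [Affine.Point.map_some]
  simp only [Affine.Point.some.injEq, conjRatAlgHom_apply]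

theorem IsRealPoint.add {P Q : (W.baseChange ℂ).toAffine.Point} (hP : IsRealPoint W P) (hQ : IsRealPoint W Q) :
    IsRealPoint W (P + Q) := by
  unfold IsRealPoint at *
  rw [map_add, hP, hQ]

theorem IsRealPoint.neg {P : (W.baseChange ℂ).toAffine.Point} (hP : IsRealPoint W P) : IsRealPoint W (-P) := by
  unfold IsRealPoint at *
  rw [map_neg, hP]

/-- The real Kummer sign of a REAL point is never `0`. [folklore] -/
theorem realKummerSign_ne_zero [W.IsElliptic] (he : HasRationalTwoTorsionX W e) {P : (W.baseChange ℂ).toAffine.Point}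
    (hP : IsRealPoint W P) : realKummerSign W e P ≠ 0 := by
  rcases P with _ | ⟨x, y, h⟩
  · simp only [← Affine.Point.zero_def, realKummerSign_zero]; decide
  · obtain ⟨hxc, -⟩ := (isRealPoint_some_iff h).mp hP
    by_cases hx : x = e
    · rw [realKummerSign_some_of_eq W e _ hx]; exact sign_ne_zero.mpr (deltaT_ne_zero he)
    · rw [realKummerSign_some_of_ne W e _ hx]
      refine sign_ne_zero.mpr fun h0 => hx (Complex.ext ?_ ?_)
      · rw [Complex.ratCast_re]; linarith
      · rw [Complex.conj_eq_iff_im.mp hxc, Complex.ratCast_im]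

/-- Real and imaginary parts of a product of two real complex numbers. [folklore] -/
private theorem re_im_mul_of_im_eq_zero {z w : ℂ} (hz : z.im = 0) (hw : w.im = 0) :
    (z * w).re = z.re * w.re ∧ (z * w).im = 0 := by
  constructor
  · rw [Complex.mul_re, hz, hw, mul_zero, sub_zero]
  · rw [Complex.mul_im, hz, hw, mul_zero, zero_mul, add_zero]

/-- Signs from a positive triple product (over `ℝ`). [folklore] -/
private theorem sign_eq_of_mul_mul_pos_real {a b c : ℝ} (h : 0 < a * b * c) :
    SignType.sign c = SignType.sign a * SignType.sign b := by
  have hab0 : a * b ≠ 0 := by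
    intro h0; rw [h0, zero_mul] at h; exact lt_irrefl _ h
  have ha : a ≠ 0 := left_ne_zero_of_mul hab0
  have hb : b ≠ 0 := right_ne_zero_of_mul hab0
  rcases lt_or_gt_of_ne ha with ha | ha <;> rcases lt_or_gt_of_ne hb with hb | hb
  · have hab : 0 < a * b := mul_pos_of_neg_of_neg ha hb
    have hc : 0 < c := by
      by_contra hc; rw [not_lt] at hc; nlinarith
    rw [sign_neg ha, sign_neg hb, sign_pos hc]; simp
  · have hab : a * b < 0 := mul_neg_of_neg_of_pos ha hb
    have hc : c < 0 := by
      by_contra hc; rw [not_lt] at hc; nlinarith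
    rw [sign_neg ha, sign_pos hb, sign_neg hc]; simp
  · have hab : a * b < 0 := mul_neg_of_pos_of_neg ha hb
    have hc : c < 0 := by
      by_contra hc; rw [not_lt] at hc; nlinarith
    rw [sign_pos ha, sign_neg hb, sign_neg hc]; simp
  · have hab : 0 < a * b := mul_pos ha hb
    have hc : 0 < c := by
      by_contra hc; rw [not_lt] at hc; nlinarith
    rw [sign_pos ha, sign_pos hb, sign_pos hc]; simp

/-- Signs from an exact product (over `ℝ`): `c·b = d`, `b ≠ 0` ⟹ `sign c = sign d · sign b`. [folklore] -/
private theorem sign_eq_of_mul_eq_real {b c d : ℝ} (h : c * b = d) (hb : b ≠ 0) :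
    SignType.sign c = SignType.sign d * SignType.sign b := by
  rw [← h, sign_mul, mul_assoc, ← sign_mul, sign_pos (mul_self_pos.mpr hb), mul_one]

/-- The rational `2`-torsion point `T = (e, yₑ)` seen on `E(ℂ)`: equation, `yₑ = negY e yₑ`, and `2δ_T = 6e² + b₂e + b₄`
with the base-changed `b₂, b₄`. [folklore] -/
theorem twoTorsion_complex (he : HasRationalTwoTorsionX W e) :
    ∃ ye : ℚ, (W.baseChange ℂ).toAffine.Equation (e : ℂ) (ye : ℂ) ∧
      ((ye : ℂ) = (W.baseChange ℂ).toAffine.negY (e : ℂ) (ye : ℂ)) ∧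
      2 * ((deltaT W e : ℚ) : ℂ) = 6 * (e : ℂ) ^ 2 + (W.baseChange ℂ).toAffine.b₂ * (e : ℂ) + (W.baseChange ℂ).toAffine.b₄ := by
  obtain ⟨ye, hTe, h2e⟩ := he
  refine ⟨ye, ?_, ?_, ?_⟩
  · have h := Affine.Equation.map (algebraMap ℚ ℂ) hTe
    rw [algebraMap_rat_complex, algebraMap_rat_complex] at h
    exact h
  · have h := Affine.map_negY (W' := W.toAffine) (algebraMap ℚ ℂ) e ye
    have h2 : W.toAffine.negY e ye = ye := by
      rw [Affine.negY]; linear_combination -h2e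
    rw [h2, algebraMap_rat_complex, algebraMap_rat_complex] at h
    exact h.symm
  · have h := congrArg (algebraMap ℚ ℂ) (two_mul_deltaT (W := W) (e := e))
    simp only [map_mul, map_add, map_pow, map_ofNat, algebraMap_rat_complex] at h
    have hb₂ : (W.baseChange ℂ).toAffine.b₂ = (W.b₂ : ℂ) := by
      rw [← algebraMap_rat_complex]; exact W.map_b₂ (algebraMap ℚ ℂ)
    have hb₄ : (W.baseChange ℂ).toAffine.b₄ = (W.b₄ : ℂ) := by
      rw [← algebraMap_rat_complex]; exact W.map_b₄ (algebraMap ℚ ℂ)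
    rw [hb₂, hb₄]
    exact h

/-- **The `T`-translation case over `ℂ`, real points** (AEC X.4.9): `x ≠ e` real ⟹ `x(T+P) ≠ e`, `x(T+P)` real, and
`sign(re x(T+P) − e) = sign δ_T · sign(re x − e)`. [cite: SilvermanAEC2009, X.4.9] -/
theorem sign_re_addX_twoTorsion_complex {ye : ℚ} {x y : ℂ}
    (hT : (W.baseChange ℂ).toAffine.Equation (e : ℂ) (ye : ℂ))
    (h2 : (ye : ℂ) = (W.baseChange ℂ).toAffine.negY (e : ℂ) (ye : ℂ))
    (h2δ : 2 * ((deltaT W e : ℚ) : ℂ) =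
      6 * (e : ℂ) ^ 2 + (W.baseChange ℂ).toAffine.b₂ * (e : ℂ) + (W.baseChange ℂ).toAffine.b₄)
    (hP : (W.baseChange ℂ).toAffine.Equation x y) (hx : x ≠ (e : ℂ)) (hxim : x.im = 0) (hδ : deltaT W e ≠ 0) :
    (W.baseChange ℂ).toAffine.addX (e : ℂ) x ((W.baseChange ℂ).toAffine.slope (e : ℂ) x (ye : ℂ) y) ≠ (e : ℂ) ∧
      SignType.sign
          (((W.baseChange ℂ).toAffine.addX (e : ℂ) x ((W.baseChange ℂ).toAffine.slope (e : ℂ) x (ye : ℂ) y)).re - e) =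
        SignType.sign (deltaT W e) * SignType.sign (x.re - e) := by
  have key : ((W.baseChange ℂ).toAffine.addX (e : ℂ) x ((W.baseChange ℂ).toAffine.slope (e : ℂ) x (ye : ℂ) y) - e) *
      (x - e) = ((deltaT W e : ℚ) : ℂ) := by
    have h := kummer_twoTorsion_add (V := (W.baseChange ℂ).toAffine) hT h2 hP hx
    linear_combination h / 2 - h2δ / 2
  have hxe : x - (e : ℂ) ≠ 0 := sub_ne_zero.mpr hx
  have hne : (W.baseChange ℂ).toAffine.addX (e : ℂ) x ((W.baseChange ℂ).toAffine.slope (e : ℂ) x (ye : ℂ) y) ≠ (e : ℂ) := by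
    intro h0
    rw [h0, sub_self, zero_mul] at key
    exact hδ (by exact_mod_cast key.symm)
  refine ⟨hne, ?_⟩
  -- realness of `x(T+P) − e`: it is `δ_T / (x − e)`
  have hq : (W.baseChange ℂ).toAffine.addX (e : ℂ) x ((W.baseChange ℂ).toAffine.slope (e : ℂ) x (ye : ℂ) y) - e =
      ((deltaT W e : ℚ) : ℂ) / (x - e) := eq_div_of_mul_eq hxe key
  have hxim' : (x - (e : ℂ)).im = 0 := by rw [Complex.sub_im, hxim, Complex.ratCast_im, sub_zero]
  have him : ((W.baseChange ℂ).toAffine.addX (e : ℂ) x ((W.baseChange ℂ).toAffine.slope (e : ℂ) x (ye : ℂ) y) - e).im = 0 := by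
    rw [hq, Complex.div_im, hxim', Complex.ratCast_im, zero_mul, mul_zero, zero_div, sub_zero]
  have hre := congrArg Complex.re key
  rw [(re_im_mul_of_im_eq_zero him hxim').1] at hre
  simp only [Complex.sub_re, Complex.ratCast_re] at hre
  rw [← sign_ratCast_real (deltaT W e)]
  have hxre : x.re - (e : ℝ) ≠ 0 := by
    intro h0
    apply hxe
    apply Complex.ext
    · rw [Complex.sub_re, Complex.ratCast_re, h0, Complex.zero_re]
    · rw [hxim', Complex.zero_im]
  exact sign_eq_of_mul_eq_real hre hxre

/-- **THE REAL KUMMER SIGN `δ_∞` IS A HOMOMORPHISM ON REAL POINTS OF `E(ℂ)`** (gen 4, PROVED; the `E(ℝ)`-algebra of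
stub 3 (c), in stub 3's own currency).  For `W/ℚ` elliptic with a rational `2`-torsion point `T = (e, ·)` and complex points
`P, Q` fixed by `conjPoint`: `realKummerSign (P + Q) = realKummerSign P · realKummerSign Q`.
Cases as over `ℚ`: `O`; `Q = −P`; `T + P` (translation identity, realness of `x(T+P)` from `δ_T/(x − e)`); generic chord with
`P + Q ≠ T` (chord identity; the chord value `ℓ_T` is REAL because the slope of a chord through real points is real —
`baseChange_slope` along `conj` — so `ℓ_T² > 0`); generic chord with `P + Q = T`. [cite: SilvermanAEC2009, X.4.9] -/
theorem realKummerSign_add [W.IsElliptic] (he : HasRationalTwoTorsionX W e) {P Q : (W.baseChange ℂ).toAffine.Point}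
    (hP : IsRealPoint W P) (hQ : IsRealPoint W Q) :
    realKummerSign W e (P + Q) = realKummerSign W e P * realKummerSign W e Q := by
  haveI hEC : (W.baseChange ℂ).IsElliptic := by rw [WeierstrassCurve.baseChange]; infer_instance
  have hδ : deltaT W e ≠ 0 := deltaT_ne_zero he
  obtain ⟨ye, hTe, h2, h2δ⟩ := twoTorsion_complex he
  have hTns : (W.baseChange ℂ).toAffine.Nonsingular (e : ℂ) (ye : ℂ) :=
    (Affine.equation_iff_nonsingular (W := W.baseChange ℂ)).mp hTe
  have hPQ := hP.add hQ
  -- the affine/affine case with the FIRST point equal to `T`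
  have hTcase : ∀ {x₁ y₁ x₂ y₂ : ℂ} (h₁ : (W.baseChange ℂ).toAffine.Nonsingular x₁ y₁)
      (h₂ : (W.baseChange ℂ).toAffine.Nonsingular x₂ y₂), x₁ = e → x₂ ≠ e → x₂.im = 0 →
      realKummerSign W e (.some x₁ y₁ h₁ + .some x₂ y₂ h₂) =
        realKummerSign W e (.some x₁ y₁ h₁) * realKummerSign W e (.some x₂ y₂ h₂) := by
    intro x₁ y₁ x₂ y₂ h₁ h₂ hx₁ hx₂ hx₂i
    have hy₁ : y₁ = ye := y_eq_of_equation_twoTorsionX (V := (W.baseChange ℂ).toAffine) hTe h2 (hx₁ ▸ h₁.left)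
    subst hx₁ hy₁
    obtain ⟨hx₃, hsgn⟩ := sign_re_addX_twoTorsion_complex hTe h2 h2δ h₂.left hx₂ hx₂i hδ
    rw [Affine.Point.add_of_X_ne (fun h => hx₂ h.symm), realKummerSign_some_of_ne W e _ hx₃,
      realKummerSign_some_of_eq W e _ rfl, realKummerSign_some_of_ne W e _ hx₂, hsgn]
  rcases P with _ | ⟨x₁, y₁, h₁⟩ <;> rcases Q with _ | ⟨x₂, y₂, h₂⟩
  · simp only [← Affine.Point.zero_def, add_zero, realKummerSign_zero, mul_one]
  · simp only [← Affine.Point.zero_def, zero_add, realKummerSign_zero, one_mul]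
  · simp only [← Affine.Point.zero_def, add_zero, realKummerSign_zero, mul_one]
  · obtain ⟨hx₁c, hy₁c⟩ := (isRealPoint_some_iff h₁).mp hP
    obtain ⟨hx₂c, hy₂c⟩ := (isRealPoint_some_iff h₂).mp hQ
    have hx₁i : x₁.im = 0 := Complex.conj_eq_iff_im.mp hx₁c
    have hx₂i : x₂.im = 0 := Complex.conj_eq_iff_im.mp hx₂c
    have hy₁i : y₁.im = 0 := Complex.conj_eq_iff_im.mp hy₁c
    by_cases hxy : x₁ = x₂ ∧ y₁ = (W.baseChange ℂ).toAffine.negY x₂ y₂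
    · -- `Q = −P`: the sum is `O` and the two signs coincide (they only see `x`)
      rw [Affine.Point.add_of_Y_eq hxy.1 hxy.2, realKummerSign_zero]
      have hPQ' : realKummerSign W e (.some x₁ y₁ h₁) = realKummerSign W e (.some x₂ y₂ h₂) := by
        simp only [realKummerSign, kummerValK_some, hxy.1]
      have hk0 := realKummerSign_ne_zero he hQ
      have key : ∀ s : SignType, s ≠ 0 → (1 : SignType) = s * s := by decide
      rw [hPQ']
      exact key _ hk0
    · by_cases hx₁ : x₁ = e
      · have hx₂ : x₂ ≠ e := by
          intro hx₂
          apply hxy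
          have hy₁ := y_eq_of_equation_twoTorsionX (V := (W.baseChange ℂ).toAffine) hTe h2 (hx₁ ▸ h₁.left)
          have hy₂ := y_eq_of_equation_twoTorsionX (V := (W.baseChange ℂ).toAffine) hTe h2 (hx₂ ▸ h₂.left)
          refine ⟨hx₁.trans hx₂.symm, ?_⟩
          rw [hy₁, hy₂, hx₂]
          exact h2
        exact hTcase h₁ h₂ hx₁ hx₂ hx₂i
      · by_cases hx₂ : x₂ = e
        · rw [add_comm, mul_comm]
          exact hTcase h₂ h₁ hx₂ hx₁ hx₁i
        · -- generic chord
          have hsq := kummer_chord_sq (V := (W.baseChange ℂ).toAffine) hTe h2 h₁.left h₂.left hxy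
          -- realness of the slope, of `ℓ_T`, and of `x₃`
          have hslope : conj ((W.baseChange ℂ).toAffine.slope x₁ x₂ y₁ y₂) = (W.baseChange ℂ).toAffine.slope x₁ x₂ y₁ y₂ := by
            have h := Affine.baseChange_slope (W' := W) conjRatAlgHom x₁ x₂ y₁ y₂
            simp only [conjRatAlgHom_apply, hx₁c, hx₂c, hy₁c, hy₂c] at h
            exact h.symm
          obtain ⟨ℓ, hℓ⟩ : ∃ ℓ : ℂ, ℓ = (W.baseChange ℂ).toAffine.slope x₁ x₂ y₁ y₂ * (e - x₁) + y₁ - ye := ⟨_, rfl⟩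
          have hℓc : conj ℓ = ℓ := by
            rw [hℓ, map_sub, map_add, map_mul, map_sub, hslope, hx₁c, hy₁c, map_ratCast, map_ratCast]
          have hℓi : ℓ.im = 0 := Complex.conj_eq_iff_im.mp hℓc
          rw [← hℓ] at hsq
          have hR := hPQ
          rw [Affine.Point.add_some hxy, isRealPoint_some_iff] at hR
          have hx₃i : ((W.baseChange ℂ).toAffine.addX x₁ x₂ ((W.baseChange ℂ).toAffine.slope x₁ x₂ y₁ y₂)).im = 0 :=
            Complex.conj_eq_iff_im.mp hR.1
          have h1i : (x₁ - (e : ℂ)).im = 0 := by rw [Complex.sub_im, hx₁i, Complex.ratCast_im, sub_zero]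
          have h2i : (x₂ - (e : ℂ)).im = 0 := by rw [Complex.sub_im, hx₂i, Complex.ratCast_im, sub_zero]
          have h3i : ((W.baseChange ℂ).toAffine.addX x₁ x₂ ((W.baseChange ℂ).toAffine.slope x₁ x₂ y₁ y₂) - (e : ℂ)).im =
              0 := by
            rw [Complex.sub_im, hx₃i, Complex.ratCast_im, sub_zero]
          -- real parts of the chord identity
          have hre := congrArg Complex.re hsq
          rw [(re_im_mul_of_im_eq_zero (re_im_mul_of_im_eq_zero h1i h2i).2 h3i).1, (re_im_mul_of_im_eq_zero h1i h2i).1,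
            pow_two, (re_im_mul_of_im_eq_zero hℓi hℓi).1] at hre
          simp only [Complex.sub_re, Complex.ratCast_re] at hre
          have hx₁re : x₁.re - (e : ℝ) ≠ 0 := by
            intro h0; apply hx₁; apply Complex.ext
            · rw [Complex.ratCast_re]; linarith
            · rw [hx₁i, Complex.ratCast_im]
          by_cases hx₃ : (W.baseChange ℂ).toAffine.addX x₁ x₂ ((W.baseChange ℂ).toAffine.slope x₁ x₂ y₁ y₂) = e
          · -- the sum is `T`: `Q = T + (−P)`
            have hS : (Affine.Point.some x₁ y₁ h₁) + (Affine.Point.some x₂ y₂ h₂) = Affine.Point.some (e : ℂ) ye hTns := by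
              rw [Affine.Point.add_some hxy]
              have hy₃ : (W.baseChange ℂ).toAffine.addY x₁ x₂ y₁ ((W.baseChange ℂ).toAffine.slope x₁ x₂ y₁ y₂) = ye :=
                y_eq_of_equation_twoTorsionX (V := (W.baseChange ℂ).toAffine) hTe h2
                  (hx₃ ▸ (Affine.nonsingular_add h₁ h₂ hxy).left)
              simp only [Affine.Point.some.injEq]
              exact ⟨hx₃, hy₃⟩
            have hQ' : Affine.Point.some x₂ y₂ h₂ = Affine.Point.some (e : ℂ) ye hTns + -(Affine.Point.some x₁ y₁ h₁) := by
              rw [← hS]; abel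
            rw [Affine.Point.neg_some, Affine.Point.add_of_X_ne (fun h => hx₁ h.symm)] at hQ'
            simp only [Affine.Point.some.injEq] at hQ'
            obtain ⟨-, hsgn⟩ :=
              sign_re_addX_twoTorsion_complex hTe h2 h2δ ((Affine.equation_neg x₁ y₁).mpr h₁.left) hx₁ hx₁i hδ
            rw [← hQ'.1] at hsgn
            rw [Affine.Point.add_some hxy, realKummerSign_some_of_eq W e _ hx₃, realKummerSign_some_of_ne W e _ hx₁,
              realKummerSign_some_of_ne W e _ hx₂, hsgn, mul_left_comm, ← sign_mul, sign_pos (mul_self_pos.mpr hx₁re),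
              mul_one]
          · rw [Affine.Point.add_some hxy, realKummerSign_some_of_ne W e _ hx₃, realKummerSign_some_of_ne W e _ hx₁,
              realKummerSign_some_of_ne W e _ hx₂]
            apply sign_eq_of_mul_mul_pos_real
            rw [hre]
            have hs : ℓ ≠ 0 := by
              intro hs
              rw [hs, zero_pow two_ne_zero] at hsq
              rcases mul_eq_zero.mp hsq with h | h
              · rcases mul_eq_zero.mp h with h | h
                · exact hx₁ (sub_eq_zero.mp h)
                · exact hx₂ (sub_eq_zero.mp h)
              · exact hx₃ (sub_eq_zero.mp h)
            have hsre : ℓ.re ≠ 0 := by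
              intro h0; apply hs; apply Complex.ext
              · rw [h0, Complex.zero_re]
              · rw [hℓi, Complex.zero_im]
            exact mul_self_pos.mpr hsre

/-- Corollary: `δ_∞` kills `2·E(ℝ)` — for a real point `P`, `realKummerSign (P + P) = 1`.  (With `E⁰(ℝ) = 2E(ℝ)` for `Δ > 0`
this is the «`δ_∞` kills the connected component» clause of stub 3; that index-two statement stays inside stub 3.) [folklore] -/
theorem realKummerSign_add_self [W.IsElliptic] (he : HasRationalTwoTorsionX W e) {P : (W.baseChange ℂ).toAffine.Point}
    (hP : IsRealPoint W P) : realKummerSign W e (P + P) = 1 := by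
  rw [realKummerSign_add he hP hP]
  have key : ∀ s : SignType, s ≠ 0 → s * s = 1 := by decide
  exact key _ (realKummerSign_ne_zero he hP)

end KummerSignC


/-! ## §4  The six stub statements (stub 3 is proved in §4d, stub 4 in §4b; four `sorry`s remain) -/

/-- Stub 1 target = the OTHER half of the crux (`E(ℚ)[2] = 0`, off-slice), the sibling line BY NAME
(`Lines/refined_kolyvagin_tamagawa_shift_at_two.lean` concludes the crux from ITS stubs + our half as `stub_twoTorsionHalf`). -/
def S_halfZero : Prop := NoTwoTorsionHalf

/-- Stub 2 target = the BY-NAME INPUTS: PRINT (`S_pub`: Gross–Zagier I.6.3, Kolyvagin, Heegner rationality, GZK, modularity;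
`S_pubHL`: newform existence + Hoffstein–Luo twist non-vanishing — the sibling crux's two print stubs, verbatim tree decls;
`WeierstrassCurve.bsdRHS_eq_of_isIsogenous`: Cassels 1965 / Milne ADT I.7.3 isogeny invariance of the BSD quotient, a cite-tagged
Literature fact) and the route's four rank-`0` items (they give `S_rankZeroTwin` by `bsdp_two_of_rankZero_cruxes`, used for the
door twist). -/
def S_inputs : Prop :=
  (S_pub ∧ S_pubHL ∧ WeierstrassCurve.bsdRHS_eq_of_isIsogenous) ∧
    (GoodOrdinaryRankZeroAtTwo ∧ MultiplicativeRankZeroAtTwo ∧ SupersingularRankZeroAtTwo ∧ AdditiveRankZeroAtTwo)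

/-- **Stub 3 `RealGenusSignLawAtTwo` — THE REAL GENUS SIGN LAW (the lever; PROVED in gen 4: `realGenusSignLawAtTwo_holds`, §4d).**
Type-A `W` (`T = (e,·)`) of
analytic rank `1`, `K` imaginary quadratic with the Heegner hypothesis for `N_E`, ANY datum `Dt`, `H`, `ι`, `P ∈ E(K)` over the
complex Heegner point and of infinite order, and `R ∈ E(ℚ)` with `ι R = P` (it EXISTS: §3).  THEN the real Kummer sign of `R` is the
archimedean genus sign of the door: `sign(x(R) − e) = ∏_{Q : y_Q real} sign Re(x(y_Q) − e)`.  Proof sketch: (a) `conj ∘ φ = φ ∘ J`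
(`φ_J_smul`), `J•τ_Q'` is `Γ₀(N)`-equivalent to `𝔀•τ_Q` for a permutation `Q ↦ Q'` of `H.reps` (the `hstar` step of
`HeegnerDatum.sum_fricke_smul_eq_sum_J_smul`), and `φ(𝔀•τ) = λ_N•φ(τ) + φ(0) = φ(τ)` in analytic rank one (`φ_frickeGL_smul`,
`λ_N = −w(E) = 1` by `rootNumber_eq_neg_one_of_analyticRank_eq_one`, `φ(0) = O` by
`cuspZeroPoint_eq_zero_of_entireLFunction_one_eq_zero`): so `conj` PERMUTES the summands `y_Q`; (b) group `H.reps` by the value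
`y_Q`: a non-real value `y` and `ȳ` occur equally often and contribute multiples of `y + ȳ ∈ E⁰(ℝ)` (the identity component,
`= 2E(ℝ) ∩ E⁰(ℝ)`-divisible), real values contribute themselves; (c) `δ_∞ : E(ℝ) → {±1}`, `R ↦ sign(kummerVal R)`, is a
homomorphism (AEC X.4.9 over `ℝ`: for collinear `P₁+P₂+P₃ = O`, `∏(x(Pᵢ) − e) = ℓ(T)²`) killing `2E(ℝ) ⊇ E⁰(ℝ)`; (d) `ι P = P_ℂ`
and `P = ι_K R` give `kummerValK ℂ (P_ℂ) = x(R) − e ∈ ℚ ⊂ ℝ`.  Why it might fail: only through the conventions at `R = T`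
(`δ_T`) or a real summand equal to `O`/`T` — both excluded up to the stated normalisations by `P` non-torsion; the grouping in (b)
needs no injectivity of `φ`.  Each real factor is then EXACT: by the half-period law (§3b, proved) `y_Q ≡ uniformize(c·{∞,γ_Q∞}_f/2)`
modulo `E⁰(ℝ)`, so `sign Re(x(y_Q) − e) = (−1)^{m⁻(γ_Q)}` (`Δ > 0`; on the type-A floor `T` is the nose `2`-torsion point `Ω⁺/2`)
— a prover may land that corollary with `--supports` this stub.  presearch: AEC X.4.9 [corpus:silverman2009 p.303]; real loci /
CM points on `X₀(N)(ℝ)`: Snowden, "Real components of modular curves" [arXiv:1108.3131] (tree: `F1Sign2.traceFree_of_frickeTwistedReal`,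
`onFrickeTwistedRealLocus_iff_axis`); GZ V §2 (`N = 37`, `y_K ∈ E(ℚ)`) [corpus:GrossZagier1986 p.311]; sibling (slice) analogue:
`F1Sign2.eggLemma` / AN-13 `HeegnerPointOnEggAtTwo` (not used). -/
def RealGenusSignLawAtTwo : Prop :=
  ∀ (W : WeierstrassCurve ℚ) [W.IsElliptic] [W.IsGloballyMinimal] [NeZero (W.conductorNorm ℤ)] (e : ℚ),
    HasRationalTwoTorsionX W e → W.analyticRank = 1 →
    ∀ (K : Type) [Field K] [NumberField K], IsImaginaryQuadratic K →
      SatisfiesHeegnerHypothesis (W.conductorNorm ℤ) K →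
      ∀ (Dt : ModularParametrizationData W (W.conductorNorm ℤ))
        (H : HeegnerDatum (W.conductorNorm ℤ) (NumberField.discr K)) (ι : K →+* ℂ)
        (P : (W.baseChange K).toAffine.Point) (R : W.toAffine.Point),
        WeierstrassCurve.Affine.Point.map ι.toRatAlgHom P = heegnerPointComplex Dt H → ¬ IsOfFinAddOrder P →
        QuadraticDescent.incl K W R = P →
        SignType.sign (kummerValQ W e R) = archSign W e Dt H

/-- **Stub 4 `OddIndexOfNegativeSignAtTwo` — negative real sign ⟹ odd index ⟹ exponent `hb`.  PROVED in gen 4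
(`oddIndexOfNegativeSignAtTwo_holds`, §4b; `stub_oddIndexOfNegativeSign` is a theorem).**  Type-A `W`
with `δ_∞` trivial on `E(ℚ)_tors`, `K` imaginary quadratic with `rank E(K) = 1`, `P = ι R ∈ E(K)` with `R ∈ E(ℚ)` of real Kummer
sign `−1`.  THEN `P` has exact `2`-divisibility exponent `hb = halvBit W K` modulo torsion in `E(K)`.  Proof sketch: `δ_∞` is a
homomorphism on `E(ℚ) ⊂ E(ℝ)` (AEC X.4.9), so `R = n·g + t` has `δ_∞(R) = δ_∞(g)^n` and `n` is ODD; `σ` fixes `g ≠ 0` in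
`E(K)/tors ≅ ℤ`, so `σ = +1` there and `2g_K ∈ E(ℚ) + tors`: `[E(K) : ℤg + tors]₂ ≤ 2`, the exponent of `g` is `hb ∈ {0,1}` by the
definition of `halvBit`, and the exponent of `n·g + t` equals that of `g`.  Why it might fail: mis-normalisation of `halvBit` versus
`HasTwoDivisibilityUpToTorsion` (both are the sibling crux's tree definitions; the `m`-uniqueness lemma of line v8.4 fixes them);
finite generation of `E(K)` is available from `S_pub` if a prover needs it as an extra hypothesis.  presearch: AEC X.4.9, VIII.4
[corpus:silverman2009 p.303]. -/
def OddIndexOfNegativeSignAtTwo : Prop :=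
  ∀ (W : WeierstrassCurve ℚ) [W.IsElliptic] [W.IsGloballyMinimal] (e : ℚ), HasRationalTwoTorsionX W e →
    TorsionSignTrivial W e →
    ∀ (K : Type) [Field K] [NumberField K], IsImaginaryQuadratic K → (W.baseChange K).mordellWeilRank = 1 →
      ∀ (P : (W.baseChange K).toAffine.Point) (R : W.toAffine.Point), QuadraticDescent.incl K W R = P →
        SignType.sign (kummerValQ W e R) = -1 → HasTwoDivisibilityUpToTorsion W K P (halvBit W K)

/-- **Stub 5 `ArchLedgerAtTwo` — THE ARCH LEDGER ON THE ARCH FLOOR (the research stub; XL; BSD-consistent, refutable per row).**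
Type-A non-CM `W` of analytic rank `1`; a door (`K` imaginary quadratic, `d_K` door-admissible, `L(E^{(d_K)},1) ≠ 0`, Heegner
hypothesis), ANY datum `Dt` and `H`, a globally minimal model `Wd` of the twist; the row ON THE ARCH FLOOR (`Δ > 0`, `δ_∞|tors = 1`,
`archSign = −1`) with `Ш(W)[2] = Ш(Wd)[2] = 0`.  THEN `[Δ<0] + 2v₂#E(ℚ)_tors + 2v₂#E^d(ℚ)_tors = t + 2s + 2v₂(c_{Dt}) + 2v₂∏c_ℓ(E)`.
WHY IT IS CONSISTENT: `BSD₂(W)` + §1 give `∃! m` with the door identity; stubs 3–4 give `m = hb` on the floor; erase the trivial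
`Ш`'s.  WHY IT IS EASIER THAN THE CRUX: the floor pins `v₂` of the Gross–Zagier index WITHOUT generators or heights, so on floor
rows every quantity in the `2`-part of the GZ–BSD ledger except `Ш(E/K)[2^∞]` is explicit, and `Ш(E/K)[2]` is squeezed by
`Ш(E)[2] = Ш(E^d)[2] = 0` and the `Gal(K/ℚ)`-cohomology of the KNOWN group `E(K) ⊇ E(ℚ) ⊕ E^d(ℚ)`: the statement is a candidate
for Selmer-size bookkeeping (Cassels' `#Sel^φ/#Sel^{φ̂}` product formula incl. the REAL factor, Kramer's local norm indices at the
door primes `c_q(E^d) ∈ {2,4}` ↔ `t, s`) — genus theory of `K` on both sides; and its SIGN side is exact by §3b: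
`archSign = (−1)^{Σ_Q m⁻(γ_Q)} = χ⁻(∏_{Q Fricke-real} γ_Q)` with `χ⁻ = (m⁻ mod 2) ∈ H¹(Γ₀(N), 𝔽₂)[𝔪]`, `𝔪` the Eisenstein ideal
at `2` of type A — the plan is to evaluate `χ⁻` on the Fricke-symmetric elements `(a b; −Nb d)` as a quadratic character of `d`
and match it with the genus data `t, s, d_K mod 8` on the right.  Why it might fail: an unaccounted `2` at the real place
or at `q ∣ d_K` of identity type in the §1 bookkeeping (then the row census refutes it at once: `archSign` by interval arithmetic,
the rest by `2`-descent); or the floor is thinner than BSD predicts (rows with odd index but `archSign = +1` cannot exist by stub 3,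
so thinness can only come from `δ_∞(g) = +1` curves — those are in the residual).  presearch: Cassels, "Arithmetic on curves of
genus 1, VIII" (Crelle 1965) Thm 1.1; Kramer, "Arithmetic of elliptic curves upon quadratic extension" (Trans. AMS 1981) Thm 1
[cite: Kramer1981, Thm. 1]; Gross–Zagier V.2 [corpus:GrossZagier1986 p.311]; no hit for "real Heegner points" ∧ "2-part"
∧ "Birch Swinnerton-Dyer" in corpus(fts+vec)/galaxy beyond Tian–Yuan–Zhang genus periods [arXiv:1411.4728] (congruent numbers,
`p = 2`, CM) — the nearest prior art, different object (genus points of `X₀(32)`-type CM curves, not the real locus). -/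
def ArchLedgerAtTwo : Prop :=
  ∀ (W : WeierstrassCurve ℚ) [W.IsElliptic] [W.IsGloballyMinimal] [NeZero (W.conductorNorm ℤ)] (e : ℚ),
    HasRationalTwoTorsionX W e → ¬ W.HasCM → W.analyticRank = 1 →
    ∀ (K : Type) [Field K] [NumberField K], IsImaginaryQuadratic K →
      DoorAdmissible W (NumberField.discr K) →
      (W.quadraticTwist (NumberField.discr K : ℚ)).entireLFunction 1 ≠ 0 →
      SatisfiesHeegnerHypothesis (W.conductorNorm ℤ) K →
      ∀ (Dt : ModularParametrizationData W (W.conductorNorm ℤ))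
        (H : HeegnerDatum (W.conductorNorm ℤ) (NumberField.discr K))
        (Wd : WeierstrassCurve ℚ) [Wd.IsElliptic] [Wd.IsGloballyMinimal] (Cd : WeierstrassCurve.VariableChange ℚ),
        Cd • W.quadraticTwist (NumberField.discr K : ℚ) = Wd →
        OnArchFloor W e Dt H → ShaTwoTrivial W → ShaTwoTrivial Wd → ArchLedger W K Dt Wd

/-- **Stub 6 `ArchResidualAtTwo` (the declared OPEN residual, CURVE-GLOBAL MODULO ISOGENY; XL).**  A type-A non-CM `W` of
analytic rank `1` such that NO curve isogenous to `W` reaches the arch floor with trivial `Ш[2]`'s (`¬ ArchReach W`: in the whole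
isogeny class every model has `Δ < 0`, or `δ_∞ ≠ 1` on its torsion, or every door has `archSign = +1`, or a `Ш[2] ≠ 0`): THEN on
every door the Heegner point has an exact exponent `m` with `DoorIdentityAt … m`.  This IS the type-A crux on the complement rows —
no evasion claimed; census-able (which curves of conductor `< 1000` reach the floor is a finite certified computation per door).
Mechanisms foreseen: (a) `archSign = +1 ∧ δ_∞(g) = −1` rows give `n` EVEN, i.e. the LOWER bound `m ≥ hb + 1` and hence, through
§1, the non-triviality `Ш(W)[2] ⊕ Ш(Wd)[2] ≠ 0` or its ledger companion — a theorem-shaped by-product, not `BSD₂`; (b) several real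
ovals of `X₀(N)^{w_N∘J}(ℝ)` (Snowden) may carry real summands of both signs: a finer, oval-by-oval law could move rows from (a)
into decided ones; (c) the rest meets `DescentDefectUnbounded` head-on (line 1's Kolyvagin-at-2 territory). -/
def ArchResidualAtTwo : Prop :=
  ∀ (W : WeierstrassCurve ℚ) [W.IsElliptic] [W.IsGloballyMinimal] [NeZero (W.conductorNorm ℤ)] (e : ℚ),
    HasRationalTwoTorsionX W e → ¬ W.HasCM → W.analyticRank = 1 → ¬ ArchReach W →
    ∀ (K : Type) [Field K] [NumberField K], IsImaginaryQuadratic K →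
      DoorAdmissible W (NumberField.discr K) →
      (W.quadraticTwist (NumberField.discr K : ℚ)).entireLFunction 1 ≠ 0 →
      SatisfiesHeegnerHypothesis (W.conductorNorm ℤ) K →
      ∀ (Dt : ModularParametrizationData W (W.conductorNorm ℤ))
        (H : HeegnerDatum (W.conductorNorm ℤ) (NumberField.discr K)) (ι : K →+* ℂ)
        (P : (W.baseChange K).toAffine.Point),
        WeierstrassCurve.Affine.Point.map ι.toRatAlgHom P = heegnerPointComplex Dt H → ¬ IsOfFinAddOrder P →
        ∀ (Wd : WeierstrassCurve ℚ) [Wd.IsElliptic] [Wd.IsGloballyMinimal] (Cd : WeierstrassCurve.VariableChange ℚ),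
          Cd • W.quadraticTwist (NumberField.discr K : ℚ) = Wd →
          ∃ m : ℕ, HasTwoDivisibilityUpToTorsion W K P m ∧ DoorIdentityAt W K Dt Wd m

/-! ## §4b  STUB 4 IS A THEOREM (gen 4, PROVED): the odd-index law `OddIndexOfNegativeSignAtTwo`

From §3c (`δ_∞ := sign ∘ kummerValQ` is a homomorphism on `E(ℚ)`), the hypothesis `δ_∞|tors = 1`, a Mordell–Weil generator of
`E(K)` modulo torsion (`exists_generator_regulator_eq_of_mordellWeilRank_eq_one`, rank `E(K) = 1`) and Galois descent of `σ`-fixed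
points (`QuadraticDescent.exists_incl_eq_of_conjMap_eq`):
* `hb = 1`: `ι R ≡ 2Q`; if `Q ≡ 2Q'` then `ι R ≡ 4Q' ≡ 4σQ'`, so `2·ι R ≡ 4(Q' + σQ') = 4·ι y` and `R ≡ 2y` mod torsion — `δ_∞(R) = +1`;
* `hb = 0`: if `ι R ≡ 2Q'` then for every `y ∈ E(ℚ)` with `ι y ≡ a·g`: `a·R ≡ 2q·y` in `E(ℚ)`, so `δ_∞(R)^a = 1`, `a` is even and
  `y` is twice a point of `E(K)` modulo torsion — i.e. `hb = 1`, contradiction.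
No heights, no `L`-values: pure `2`-descent bookkeeping plus the real sign. -/

section OddIndex

variable (W : WeierstrassCurve ℚ) [W.IsElliptic] (e : ℚ)

/-- `(2 : ℕ) • x = (2 : ℤ) • x`. [folklore] -/
theorem two_nsmul_eq_two_zsmul {A : Type*} [AddCommGroup A] (x : A) : (2 : ℕ) • x = (2 : ℤ) • x := by
  rw [two_nsmul, two_zsmul]

/-- `δ_∞` kills even multiples: `sign k(b • y) = 1` for `b` even. [folklore] -/
theorem sign_kummerValQ_zsmul_of_even (he : HasRationalTwoTorsionX W e) {b : ℤ} (hb : Even b) (y : W.toAffine.Point) :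
    SignType.sign (kummerValQ W e (b • y)) = 1 := by
  obtain ⟨c, rfl⟩ := hb
  have hsq : SignType.sign (kummerValQ W e y) ^ 2 = 1 := by
    rw [pow_two, ← sign_mul, sign_pos (mul_self_pos.mpr (kummerValQ_ne_zero he y))]
  have habs : (c + c).natAbs = 2 * c.natAbs := by rw [← two_mul, Int.natAbs_mul]; rfl
  rw [sign_kummerValQ_zsmul he, habs, pow_mul, hsq, one_pow]

/-- `δ_∞` on odd multiples: `sign k(a • R) = sign k(R)` for `a` odd. [folklore] -/
theorem sign_kummerValQ_zsmul_of_odd (he : HasRationalTwoTorsionX W e) {a : ℤ} (ha : Odd a) (R : W.toAffine.Point) :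
    SignType.sign (kummerValQ W e (a • R)) = SignType.sign (kummerValQ W e R) := by
  obtain ⟨c, rfl⟩ := ha
  rw [add_zsmul, one_zsmul, sign_kummerValQ_add he, sign_kummerValQ_zsmul_of_even W e he (even_two_mul c), one_mul]

/-- `δ_∞(R) = 1` when `R ≡ b • y` modulo torsion with `b` even and `δ_∞|tors = 1`. [folklore] -/
theorem sign_kummerValQ_eq_one_of_sub_even_zsmul_mem_torsion (he : HasRationalTwoTorsionX W e) (htors : TorsionSignTrivial W e)
    {R y : W.toAffine.Point} {b : ℤ} (hb : Even b) (h : R - b • y ∈ AddCommGroup.torsion W.toAffine.Point) :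
    SignType.sign (kummerValQ W e R) = 1 := by
  rw [sign_kummerValQ_eq_of_sub_mem_torsion he htors h, sign_kummerValQ_zsmul_of_even W e he hb]

/-- Mathlib's base-change homomorphism `ι : E(ℚ) →+ E(K)` elaborated over THIS file's instances (the tree's
`QuadraticDescent.incl K W` is the same map, built over the classical `DecidableEq ℚ`: `incl_eq_inclQ`). [folklore] -/
abbrev inclQ (K : Type) [Field K] [NumberField K] : W.toAffine.Point →+ (W.baseChange K).toAffine.Point :=
  Affine.Point.baseChange (W' := W) ℚ K

omit [W.IsElliptic] in
/-- `QuadraticDescent.incl = inclQ` pointwise. [folklore] -/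
theorem incl_eq_inclQ (K : Type) [Field K] [NumberField K] (R : W.toAffine.Point) :
    QuadraticDescent.incl K W R = inclQ W K R := by
  cases R <;> rfl

omit [W.IsElliptic] in
/-- `ι` is injective. [folklore] -/
theorem inclQ_injective (K : Type) [Field K] [NumberField K] : Function.Injective (inclQ W K) :=
  Affine.Point.map_injective (W' := W) _

omit [W.IsElliptic] in
/-- `ι` reflects finite order. [folklore] -/
theorem isOfFinAddOrder_of_inclQ (K : Type) [Field K] [NumberField K] {R : W.toAffine.Point}
    (h : IsOfFinAddOrder (inclQ W K R)) : IsOfFinAddOrder R := by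
  rw [← addOrderOf_pos_iff, ← addOrderOf_injective (inclQ W K) (inclQ_injective W K) R]
  exact addOrderOf_pos_iff.mpr h

omit [W.IsElliptic] in
/-- `σ_*` fixes `ι(E(ℚ))`. [folklore] -/
theorem conjMap_inclQ (K : Type) [Field K] [NumberField K] (σ : K →ₐ[ℚ] K) (R : W.toAffine.Point) :
    QuadraticDescent.conjMap W σ (inclQ W K R) = inclQ W K R := by
  rw [← incl_eq_inclQ]; exact QuadraticDescent.conjMap_incl W σ R

/-- **STUB 4 PROVED: the odd-index law.** [new] -/
theorem oddIndexOfNegativeSignAtTwo_holds : OddIndexOfNegativeSignAtTwo := by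
  intro W _ _ e he htors K _ _ hK hrk P R hRP hR
  subst hRP
  haveI hEK : (W.baseChange K).IsElliptic := isElliptic_baseChange' W K
  unfold halvBit
  simp only [incl_eq_inclQ]
  split_ifs with hall
  · -- `hb = 1`: `ι R ≡ 2 Q`; `Q` is not twice a point modulo torsion
    obtain ⟨Q, hQ⟩ := hall R
    refine ⟨Q, by rwa [pow_one, two_nsmul_eq_two_zsmul], ?_⟩
    rintro ⟨Q', hQ'⟩
    rw [two_nsmul_eq_two_zsmul] at hQ'
    obtain ⟨σ, hσ⟩ := exists_algHom_ne_id K hK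
    have hσσ : ∀ z, σ (σ z) = z := Quadratic.apply_apply_of_ne_id hK.1 hσ
    have hfix : QuadraticDescent.conjMap W σ (Q' + QuadraticDescent.conjMap W σ Q') =
        Q' + QuadraticDescent.conjMap W σ Q' := by
      rw [map_add, QuadraticDescent.conjMap_conjMap W hσσ, add_comm]
    obtain ⟨y, hy⟩ := QuadraticDescent.exists_incl_eq_of_conjMap_eq hK.1 W hσ hfix
    rw [incl_eq_inclQ] at hy
    have h4 : inclQ W K R - (4 : ℤ) • Q' ∈ AddCommGroup.torsion (W.baseChange K).toAffine.Point := by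
      have h := add_mem hQ (AddSubgroup.zsmul_mem _ hQ' 2)
      convert h using 1
      module
    have h4c : inclQ W K R - (4 : ℤ) • QuadraticDescent.conjMap W σ Q' ∈
        AddCommGroup.torsion (W.baseChange K).toAffine.Point := by
      have h := (QuadraticDescent.conjMap W σ).isOfFinAddOrder ((AddCommGroup.mem_torsion _).mp h4)
      rw [map_sub, map_zsmul, conjMap_inclQ] at h
      exact (AddCommGroup.mem_torsion _).mpr h
    have h2 : (2 : ℤ) • (inclQ W K R - (2 : ℤ) • inclQ W K y) ∈ AddCommGroup.torsion (W.baseChange K).toAffine.Point := by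
      have h := add_mem h4 h4c
      convert h using 1
      rw [hy]
      module
    have h1 : R - (2 : ℤ) • y ∈ AddCommGroup.torsion W.toAffine.Point := by
      refine (AddCommGroup.mem_torsion _).mpr (isOfFinAddOrder_of_inclQ W K ?_)
      rw [map_sub, map_zsmul]
      exact isOfFinAddOrder_of_zsmul two_ne_zero ((AddCommGroup.mem_torsion _).mp h2)
    have := sign_kummerValQ_eq_one_of_sub_even_zsmul_mem_torsion W e he htors even_two h1
    rw [hR] at this
    exact absurd this (by decide)
  · -- `hb = 0`: `ι R` itself is not twice a point modulo torsion
    refine ⟨inclQ W K R, by rw [pow_zero, one_nsmul, sub_self]; exact zero_mem _, ?_⟩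
    rintro ⟨Q', hQ'⟩
    rw [two_nsmul_eq_two_zsmul] at hQ'
    apply hall
    intro y
    obtain ⟨g, -, hgen, -, -⟩ := exists_generator_regulator_eq_of_mordellWeilRank_eq_one (W.baseChange K) hrk
    obtain ⟨q, hq⟩ := hgen Q'
    obtain ⟨a, ha⟩ := hgen (inclQ W K y)
    have hPg : inclQ W K R - (2 * q) • g ∈ AddCommGroup.torsion (W.baseChange K).toAffine.Point := by
      have h := add_mem hQ' (AddSubgroup.zsmul_mem _ hq 2)
      convert h using 1
      module
    have hZ : a • inclQ W K R - (2 * q) • inclQ W K y ∈ AddCommGroup.torsion (W.baseChange K).toAffine.Point := by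
      have h := sub_mem (AddSubgroup.zsmul_mem _ hPg a) (AddSubgroup.zsmul_mem _ ha (2 * q))
      convert h using 1
      module
    have hZQ : a • R - (2 * q) • y ∈ AddCommGroup.torsion W.toAffine.Point := by
      refine (AddCommGroup.mem_torsion _).mpr (isOfFinAddOrder_of_inclQ W K ?_)
      rw [map_sub, map_zsmul, map_zsmul]
      exact (AddCommGroup.mem_torsion _).mp hZ
    have h1 := sign_kummerValQ_eq_one_of_sub_even_zsmul_mem_torsion W e he htors (even_two_mul q) hZQ
    rcases Int.even_or_odd a with ⟨c, hc⟩ | hodd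
    · refine ⟨c • g, ?_⟩
      rw [smul_smul, two_mul, ← hc]
      exact ha
    · rw [sign_kummerValQ_zsmul_of_odd W e he hodd, hR] at h1
      exact absurd h1 (by decide)

end OddIndex

/-! ### §4c  Bridge `E(ℚ) → E(ℂ)`: the image of a rational point is real and its real Kummer sign is `sign ∘ kummerValQ`
(gen 4, PROVED) -/

section KummerSignBridge

open scoped ComplexConjugate

variable (W : WeierstrassCurve ℚ) (e : ℚ)

/-- **Compatibility with `E(ℚ)`**: on the image of a rational point, `realKummerSign` IS `sign ∘ kummerValQ` — the
bridge between stub 3's left side and stub 4. [folklore] -/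
theorem realKummerSign_map_incl (K : Type) [Field K] [NumberField K] (ι : K →+* ℂ) (R : W.toAffine.Point) :
    realKummerSign W e (WeierstrassCurve.Affine.Point.map ι.toRatAlgHom (QuadraticDescent.incl K W R)) =
      SignType.sign (kummerValQ W e R) := by
  rcases R with _ | ⟨x, y, h⟩
  · simp only [← Affine.Point.zero_def, map_zero, realKummerSign_zero, kummerValQ_zero, sign_one]
  · have hιx : ι.toRatAlgHom (Algebra.ofId ℚ K x) = (x : ℂ) := by
      show ι (algebraMap ℚ K x) = x
      rw [← RingHom.comp_apply, eq_ratCast]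
    rw [incl_eq_inclQ]
    show realKummerSign W e (Affine.Point.map ι.toRatAlgHom (Affine.Point.map (Algebra.ofId ℚ K) (.some x y h))) = _
    rw [Affine.Point.map_some, Affine.Point.map_some, realKummerSign, kummerValK_some, hιx, kummerValQ_some,
      algebraMap_rat_complex, algebraMap_rat_complex]
    by_cases hx : x = e
    · rw [if_pos (by rw [hx]), if_pos hx, Complex.ratCast_re, sign_ratCast_real]
    · rw [if_neg (fun h => hx (by exact_mod_cast h)), if_neg hx, ← Rat.cast_sub, Complex.ratCast_re, sign_ratCast_real]

/-- The image of `E(ℚ)` consists of real points. [folklore] -/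
theorem isRealPoint_map_incl (K : Type) [Field K] [NumberField K] (ι : K →+* ℂ) (R : W.toAffine.Point) :
    IsRealPoint W (WeierstrassCurve.Affine.Point.map ι.toRatAlgHom (QuadraticDescent.incl K W R)) := by
  rcases R with _ | ⟨x, y, h⟩
  · simp only [← Affine.Point.zero_def, map_zero]
    exact map_zero _
  · have hι : ∀ q : ℚ, ι.toRatAlgHom (Algebra.ofId ℚ K q) = (q : ℂ) := by
      intro q
      show ι (algebraMap ℚ K q) = q
      rw [← RingHom.comp_apply, eq_ratCast]
    rw [incl_eq_inclQ]
    show IsRealPoint W (Affine.Point.map ι.toRatAlgHom (Affine.Point.map (Algebra.ofId ℚ K) (.some x y h)))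
    rw [Affine.Point.map_some, Affine.Point.map_some, isRealPoint_some_iff, hι, hι, map_ratCast, map_ratCast]
    exact ⟨rfl, rfl⟩

end KummerSignBridge

/-! ### §4d  STUB 3 `RealGenusSignLawAtTwo` — the proof (gen 4)

(1) `exists_conj_involution`: the representative `π Q` of the class of `(CN, B, A/N) = negB (fricke Q)` is an INVOLUTION of
`H.reps` with `τ_{πQ} ∼ J • w_N • τ_Q` (form-level: `negB ∘ fricke` is an involution on forms with `N ∣ A`, and `J`, `w_N`
descend to `Y₀(N)`); (2) in analytic rank one `conj φ(τ_{πQ}) = φ(J • τ_{πQ}) = φ(w_N • τ_Q) = ε φ(τ_Q) + φ(0) = φ(τ_Q)`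
(`ε = −w(E) = 1`, `φ(0) = O`): `conj` PERMUTES the summands through `π`; (3) `E(ℂ)` is `2`-divisible (uniformisation), so
`δ_∞(y + ȳ) = δ_∞(2(w + w̄)) = +1`; (4) the non-real summands form a `π`-stable set on which `π` is fixed-point free, so their
sum is a sum of pairs `y + ȳ`: real, of sign `+1` (strong induction on `π`-stable subsets); the real summands contribute the
product of their signs (`realKummerSign_add`); (5) `sign k(R) = realKummerSign(ι(incl R)) = realKummerSign(P_ℂ)` (§4c). -/

section RealGenusSignLawProof

open CongruenceSubgroup ComplexConjugate UpperHalfPlane HeegnerForm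
open scoped MatrixGroups ModularForm UpperHalfPlane

variable {N : ℕ} [NeZero N] {W : WeierstrassCurve ℚ} {e : ℚ}

/-- `Q ↦ (CN, B, A/N)` is an involution on triples with `N ∣ A`. [folklore] -/
theorem negB_fricke_negB_fricke {Q : ℤ × ℤ × ℤ} (hQ : (N : ℤ) ∣ Q.1) :
    negB (fricke N (negB (fricke N Q))) = Q := by
  rw [show fricke N (negB (fricke N Q)) = negB (fricke N (fricke N Q)) from rfl, HeegnerForm.negB_negB,
    fricke_fricke (by exact_mod_cast NeZero.ne N) hQ]

/-- **The conjugation involution on Heegner representatives.**  For a Heegner datum `H` (level `N`, `D < 0`, no prime of `N`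
dividing `D`) the map `Q ↦` (the representative of `(CN, B, A/N)`) is an involution `π` of `H.reps` with
`(CN, B, A/N) ∼_{Γ₀(N)} πQ` and `w_N • τ_Q ∼_{Γ₀(N)} J • τ_{πQ}`. [folklore] -/
theorem exists_conj_involution {D : ℤ} (H : HeegnerDatum N D) (hD0 : D < 0)
    (hND : ∀ p : ℕ, p.Prime → p ∣ N → ¬ (p : ℤ) ∣ D) :
    ∃ π : ℤ × ℤ × ℤ → ℤ × ℤ × ℤ, (∀ Q ∈ H.reps, π Q ∈ H.reps) ∧ (∀ Q ∈ H.reps, π (π Q) = Q) ∧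
      (∀ Q ∈ H.reps, IsGamma0Equiv N (negB (fricke N Q)) (π Q)) ∧
      ∀ Q ∈ H.reps, SameOrbit N (glCast (frickeGL N : GL (Fin 2) ℚ) • heegnerTau Q) (J • heegnerTau (π Q)) := by
  have hstar : ∀ Q ∈ H.reps, ∃ Q' ∈ H.reps, IsGamma0Equiv N (negB (fricke N Q)) Q' := by
    intro Q hQ
    obtain ⟨hQf, hβ⟩ := H.mem_heegnerForms Q hQ
    exact H.exists_isGamma0Equiv _ (negB_mem_heegnerForms (fricke_mem_heegnerForms hD0 hND hQf))
      (by simpa using hβ)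
  choose! π hπ_mem hπ using hstar
  have hπ' : ∀ Q ∈ H.reps,
      SameOrbit N (glCast (frickeGL N : GL (Fin 2) ℚ) • heegnerTau Q) (J • heegnerTau (π Q)) := by
    intro Q hQ
    have h := (isGamma0Equiv_iff_sameOrbit.mp (hπ Q hQ)).J_smul
    rwa [heegnerTau_negB_fricke hD0 (H.mem_heegnerForms Q hQ).1, J_smul_J_smul] at h
  refine ⟨π, hπ_mem, fun Q hQ => ?_, hπ, hπ'⟩
  have hQf := (H.mem_heegnerForms Q hQ).1
  obtain ⟨-, -, hNA, -⟩ := (H.mem_heegnerForms Q hQ).1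
  have hπQ := hπ_mem Q hQ
  have hπQf := (H.mem_heegnerForms (π Q) hπQ).1
  have hQsf : negB (fricke N Q) ∈ heegnerForms N D := negB_mem_heegnerForms (fricke_mem_heegnerForms hD0 hND hQf)
  have h1 : SameOrbit N (heegnerTau (negB (fricke N Q))) (heegnerTau (π Q)) :=
    isGamma0Equiv_iff_sameOrbit.mp (hπ Q hQ)
  have h2 : SameOrbit N (heegnerTau (negB (fricke N (π Q)))) (heegnerTau Q) := by
    rw [heegnerTau_negB_fricke hD0 hπQf]
    have h := (h1.symm.fricke_smul).J_smul
    rw [← heegnerTau_negB_fricke hD0 hQsf, negB_fricke_negB_fricke hNA] at h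
    exact h
  have h3 : SameOrbit N (heegnerTau (negB (fricke N (π Q)))) (heegnerTau (π (π Q))) :=
    isGamma0Equiv_iff_sameOrbit.mp (hπ (π Q) hπQ)
  have h4 : IsGamma0Equiv N (π (π Q)) Q := isGamma0Equiv_iff_sameOrbit.mpr (h3.symm.trans h2)
  by_contra hne
  exact H.pairwise_not_isGamma0Equiv (hπ_mem _ hπQ) hQ hne h4

/-- **`conj` permutes the Heegner summands in analytic rank one**: `conj φ(τ_{πQ}) = φ(τ_Q)` for the involution `π`,
because `conj φ(τ_{πQ}) = φ(J • τ_{πQ}) = φ(w_N • τ_Q) = ε•φ(τ_Q) + φ(0)` with `ε = −w(E) = 1` and `φ(0) = O`.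
[cite: GrossZagier1986, V §2, p. 311] -/
theorem exists_conj_perm_heegnerSummands (W : WeierstrassCurve ℚ) [W.IsElliptic] [W.IsGloballyMinimal]
    [NeZero (W.conductorNorm ℤ)] (hr : W.analyticRank = 1) (Dt : ModularParametrizationData W (W.conductorNorm ℤ))
    {D : ℤ} (H : HeegnerDatum (W.conductorNorm ℤ) D) (hD0 : D < 0)
    (hND : ∀ p : ℕ, p.Prime → p ∣ W.conductorNorm ℤ → ¬ (p : ℤ) ∣ D) :
    ∃ π : ℤ × ℤ × ℤ → ℤ × ℤ × ℤ, (∀ Q ∈ H.reps, π Q ∈ H.reps) ∧ (∀ Q ∈ H.reps, π (π Q) = Q) ∧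
      (∀ Q ∈ H.reps, IsGamma0Equiv (W.conductorNorm ℤ) (negB (fricke (W.conductorNorm ℤ) Q)) (π Q)) ∧
      ∀ Q ∈ H.reps, conjPoint W (Dt.φ (heegnerTau (π Q))) = Dt.φ (heegnerTau Q) := by
  obtain ⟨π, hmem, hinv, hequiv, horb⟩ := exists_conj_involution H hD0 hND
  refine ⟨π, hmem, hinv, hequiv, fun Q hQ => ?_⟩
  have hAL : ∀ (N : ℕ) [NeZero N],
      IsNewform0.exists_frickeInvolution_eq_smul (N := N) (k := (2 : ℤ)) :=
    fun N _ ↦ isNewform0_exists_frickeInvolution_eq_smul_two N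
  have hw : frickeInvolution (W.conductorNorm ℤ) 2 Dt.f = frickeEigenvalue Dt.f • Dt.f :=
    IsNewform0.frickeInvolution_eq_smul_of (hAL (W.conductorNorm ℤ)) Dt.isNewformOf.1
  obtain ⟨ε, -, hε⟩ : ∃ e : ℤ, (e = 1 ∨ e = -1) ∧ (e : ℂ) = frickeEigenvalue Dt.f := by
    rcases IsNewform0.frickeEigenvalue_eq_one_or_eq_neg_one_of (hAL (W.conductorNorm ℤ))
      Dt.isNewformOf.1 with h | h
    · exact ⟨1, Or.inl rfl, by rw [h]; norm_num⟩
    · exact ⟨-1, Or.inr rfl, by rw [h]; norm_num⟩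
  have hW : IsFrickeEigen (W.conductorNorm ℤ) Dt.f (ε : ℂ) := by
    rw [hε]
    exact isFrickeEigen_of_frickeInvolution_eq_smul _ hw
  have hroot : W.rootNumber = -ε := by
    have h := rootNumber_eq_neg_frickeEigenvalue
      (IsNewform0.exists_functional_equation_two_of_frickeInvolution_eq_smul
        fun N _ ↦ IsNewform0.frickeInvolution_eq_smul_of (hAL N))
      (fun N _ ↦ IsNewform0.frickeEigenvalue_eq_one_or_eq_neg_one_of (hAL N)) Dt.isNewformOf
    rw [← hε] at h
    exact_mod_cast h
  have hw1 : W.rootNumber = -1 := rootNumber_eq_neg_one_of_analyticRank_eq_one W Dt hr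
  have hε1 : ε = 1 := by rw [hroot] at hw1; omega
  have hL : W.entireLFunction 1 = 0 := entireLFunction_one_eq_zero_of_rootNumber_eq_neg_one hw1
  have hΦ : ∀ γ : SL(2, ℤ), γ ∈ Gamma0 (W.conductorNorm ℤ) → ∀ τ : ℍ, Dt.φ (γ • τ) = Dt.φ τ :=
    fun γ hγ τ ↦ Dt.φ_gamma0_smul_holds (eichlerIntegral_gamma_smul_holds Dt.f) ⟨γ, hγ⟩ τ
  have hΦ' : ∀ {τ τ' : ℍ}, SameOrbit (W.conductorNorm ℤ) τ τ' → Dt.φ τ = Dt.φ τ' := by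
    rintro τ τ' ⟨γ, hγ, rfl⟩
    exact (hΦ γ hγ τ).symm
  rw [← φ_J_smul, ← hΦ' (horb Q hQ), φ_frickeGL_smul Dt hW, hε1, one_zsmul,
    cuspZeroPoint_eq_zero_of_entireLFunction_one_eq_zero Dt hL, add_zero]

/-- `conjPoint` is an involution. [folklore] -/
theorem conjPoint_conjPoint (y : (W.baseChange ℂ).toAffine.Point) : conjPoint W (conjPoint W y) = y := by
  rcases y with _ | ⟨x, y, h⟩
  · rfl
  · show Affine.Point.map _ (Affine.Point.map _ (Affine.Point.some x y h)) = _
    rw [Affine.Point.map_some, Affine.Point.map_some]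
    simp only [conjRatAlgHom_apply, Complex.conj_conj]

/-- `y + ȳ` is a real point. [folklore] -/
theorem isRealPoint_add_conjPoint (y : (W.baseChange ℂ).toAffine.Point) : IsRealPoint W (y + conjPoint W y) := by
  unfold IsRealPoint
  rw [map_add, conjPoint_conjPoint, add_comm]

/-- `E(ℂ)` is `2`-divisible (through the complex uniformisation `ℂ ↠ E(ℂ)`). [folklore] -/
theorem exists_add_self_eq (Dt : ModularParametrizationData W N) (y : (W.baseChange ℂ).toAffine.Point) :
    ∃ w : (W.baseChange ℂ).toAffine.Point, w + w = y := by
  obtain ⟨z, rfl⟩ := Dt.uniformize_surjective y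
  exact ⟨Dt.uniformize (z / 2), by rw [← map_add, add_halves]⟩

/-- **`δ_∞(y + ȳ) = +1`** for every complex point `y`: `y = 2w`, `y + ȳ = 2(w + w̄)` with `w + w̄` real. [folklore] -/
theorem realKummerSign_add_conjPoint [W.IsElliptic] (he : HasRationalTwoTorsionX W e)
    (Dt : ModularParametrizationData W N) (y : (W.baseChange ℂ).toAffine.Point) :
    realKummerSign W e (y + conjPoint W y) = 1 := by
  obtain ⟨w, rfl⟩ := exists_add_self_eq Dt y
  rw [map_add, add_add_add_comm]
  exact realKummerSign_add_self he (isRealPoint_add_conjPoint w)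

/-- The sum of finitely many REAL points is real and its real Kummer sign is the product of the signs. [folklore] -/
theorem realKummerSign_sum_real [W.IsElliptic] (he : HasRationalTwoTorsionX W e) {α : Type} (S : Finset α)
    (y : α → (W.baseChange ℂ).toAffine.Point) (hS : ∀ Q ∈ S, IsRealPoint W (y Q)) :
    IsRealPoint W (∑ Q ∈ S, y Q) ∧ realKummerSign W e (∑ Q ∈ S, y Q) = ∏ Q ∈ S, realKummerSign W e (y Q) := by
  classical
  induction S using Finset.induction_on with
  | empty =>
    rw [Finset.sum_empty, Finset.prod_empty]
    exact ⟨map_zero _, realKummerSign_zero W e⟩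
  | insert a S ha ih =>
    obtain ⟨hR, hs⟩ := ih (fun Q hQ => hS Q (Finset.mem_insert_of_mem hQ))
    have ha' := hS a (Finset.mem_insert_self a S)
    rw [Finset.sum_insert ha, Finset.prod_insert ha]
    exact ⟨ha'.add hR, by rw [realKummerSign_add he ha' hR, hs]⟩

/-- **The non-real summands**: if `conj` permutes a finite family `y` through a fixed-point-compatible involution `π`
(`conj y(πQ) = y(Q)`), the sum of the NON-REAL members is real of real Kummer sign `+1` (it is a sum of pairs `y + ȳ`).
[folklore] -/
theorem realKummerSign_sum_nonreal [W.IsElliptic] (he : HasRationalTwoTorsionX W e) (Dt : ModularParametrizationData W N)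
    (reps : Finset (ℤ × ℤ × ℤ)) (y : ℤ × ℤ × ℤ → (W.baseChange ℂ).toAffine.Point) (π : ℤ × ℤ × ℤ → ℤ × ℤ × ℤ)
    (hmem : ∀ Q ∈ reps, π Q ∈ reps) (hinv : ∀ Q ∈ reps, π (π Q) = Q)
    (hconj : ∀ Q ∈ reps, conjPoint W (y (π Q)) = y Q) :
    IsRealPoint W (∑ Q ∈ reps.filter (fun Q => ¬ IsRealPoint W (y Q)), y Q) ∧
      realKummerSign W e (∑ Q ∈ reps.filter (fun Q => ¬ IsRealPoint W (y Q)), y Q) = 1 := by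
  classical
  have hπNR : ∀ Q ∈ reps.filter (fun Q => ¬ IsRealPoint W (y Q)), π Q ∈ reps.filter (fun Q => ¬ IsRealPoint W (y Q)) := by
    intro Q hQ
    obtain ⟨hQr, hQn⟩ := Finset.mem_filter.mp hQ
    refine Finset.mem_filter.mpr ⟨hmem Q hQr, fun hreal => hQn ?_⟩
    rw [← hconj Q hQr]
    unfold IsRealPoint at hreal ⊢
    rw [hreal]
    exact hreal
  have hπne : ∀ Q ∈ reps.filter (fun Q => ¬ IsRealPoint W (y Q)), π Q ≠ Q := by
    intro Q hQ hfix
    obtain ⟨hQr, hQn⟩ := Finset.mem_filter.mp hQ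
    apply hQn
    have h := hconj Q hQr
    rw [hfix] at h
    exact h
  suffices key : ∀ (n : ℕ) (S : Finset (ℤ × ℤ × ℤ)), S.card = n → S ⊆ reps.filter (fun Q => ¬ IsRealPoint W (y Q)) →
      (∀ Q ∈ S, π Q ∈ S) → IsRealPoint W (∑ Q ∈ S, y Q) ∧ realKummerSign W e (∑ Q ∈ S, y Q) = 1 from
    key _ _ rfl (Finset.Subset.refl _) hπNR
  intro n
  induction n using Nat.strong_induction_on with
  | _ n ih =>
  intro S hcard hsub hstab
  rcases S.eq_empty_or_nonempty with hS | ⟨Q₀, hQ₀⟩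
  · subst hS
    rw [Finset.sum_empty]
    exact ⟨map_zero _, realKummerSign_zero W e⟩
  · have hQ₀NR := hsub hQ₀
    have hQ₀r : Q₀ ∈ reps := (Finset.mem_filter.mp hQ₀NR).1
    have hQ₁ : π Q₀ ∈ S := hstab Q₀ hQ₀
    have hne : π Q₀ ≠ Q₀ := hπne Q₀ hQ₀NR
    have hQ₁' : π Q₀ ∈ S.erase Q₀ := Finset.mem_erase.mpr ⟨hne, hQ₁⟩
    have hpos : 0 < n := by rw [← hcard]; exact Finset.card_pos.mpr ⟨Q₀, hQ₀⟩
    have hcard' : ((S.erase Q₀).erase (π Q₀)).card < n := by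
      rw [Finset.card_erase_of_mem hQ₁', Finset.card_erase_of_mem hQ₀, hcard]
      omega
    have hsub' : (S.erase Q₀).erase (π Q₀) ⊆ reps.filter (fun Q => ¬ IsRealPoint W (y Q)) :=
      fun Q hQ => hsub (Finset.mem_of_mem_erase (Finset.mem_of_mem_erase hQ))
    have hstab' : ∀ Q ∈ (S.erase Q₀).erase (π Q₀), π Q ∈ (S.erase Q₀).erase (π Q₀) := by
      intro Q hQ
      have hQ1 : Q ≠ π Q₀ := Finset.ne_of_mem_erase hQ
      have hQS0 : Q ∈ S.erase Q₀ := Finset.mem_of_mem_erase hQ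
      have hQ0 : Q ≠ Q₀ := Finset.ne_of_mem_erase hQS0
      have hQS : Q ∈ S := Finset.mem_of_mem_erase hQS0
      have hQr : Q ∈ reps := (Finset.mem_filter.mp (hsub hQS)).1
      refine Finset.mem_erase.mpr ⟨?_, Finset.mem_erase.mpr ⟨?_, hstab Q hQS⟩⟩
      · intro h
        apply hQ0
        rw [← hinv Q hQr, h, hinv Q₀ hQ₀r]
      · intro h
        apply hQ1
        rw [← hinv Q hQr, h]
    obtain ⟨hR', hs'⟩ := ih _ hcard' _ rfl hsub' hstab'
    have hsum : ∑ Q ∈ S, y Q = (y (π Q₀) + conjPoint W (y (π Q₀))) + ∑ Q ∈ (S.erase Q₀).erase (π Q₀), y Q := by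
      rw [← Finset.add_sum_erase S y hQ₀, ← Finset.add_sum_erase (S.erase Q₀) y hQ₁', hconj Q₀ hQ₀r, ← add_assoc,
        add_comm (y Q₀)]
    have hpairR : IsRealPoint W (y (π Q₀) + conjPoint W (y (π Q₀))) := isRealPoint_add_conjPoint _
    have hpairS : realKummerSign W e (y (π Q₀) + conjPoint W (y (π Q₀))) = 1 := realKummerSign_add_conjPoint he Dt _
    rw [hsum]
    exact ⟨hpairR.add hR', by rw [realKummerSign_add he hpairR hR', hpairS, hs', mul_one]⟩

/-- **STUB 3 PROVED (gen 4): the real genus sign law.**  For a type-A curve of analytic rank one, a Heegner door `K`, any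
`Dt, H, ι` and `P = incl R` over the complex Heegner point: `sign(x(R) − e) = archSign` — the product of the real Kummer signs
of the REAL Heegner summands.  Proof: §4c turns the left side into `realKummerSign(∑_Q φ(τ_Q))`; split the sum into real and
non-real summands; the real ones multiply (`realKummerSign_add`, §3d); the non-real ones are permuted by `conj` through the
involution `π` (`exists_conj_perm_heegnerSummands`) and add up, pair by pair `y + ȳ = 2(w + w̄)`, to a real point of sign `+1`.
[cite: GrossZagier1986, V §2, p. 311] [cite: SilvermanAEC2009, X.4.9] -/
theorem realGenusSignLawAtTwo_holds : RealGenusSignLawAtTwo := by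
  intro W _ _ _ e he hr K _ _ hK hH Dt H ι P R hPH _hP hRP
  classical
  have hD0 : NumberField.discr K < 0 := hK.discr_neg
  have hND : ∀ p : ℕ, p.Prime → p ∣ W.conductorNorm ℤ → ¬ (p : ℤ) ∣ NumberField.discr K :=
    fun p hp hpN ↦ not_dvd_discr_of_satisfiesHeegnerHypothesis hK hH hp hpN
  obtain ⟨π, hπmem, hπinv, -, hπconj⟩ := exists_conj_perm_heegnerSummands W hr Dt H hD0 hND
  have hreal := realKummerSign_sum_real he (H.reps.filter (fun Q => IsRealPoint W (Dt.φ (heegnerTau Q))))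
    (fun Q => Dt.φ (heegnerTau Q)) (fun Q hQ => (Finset.mem_filter.mp hQ).2)
  have hnr := realKummerSign_sum_nonreal he Dt H.reps (fun Q => Dt.φ (heegnerTau Q)) π hπmem hπinv hπconj
  rw [← realKummerSign_map_incl W e K ι R, hRP, hPH, heegnerPointComplex,
    ← Finset.sum_filter_add_sum_filter_not H.reps (fun Q => IsRealPoint W (Dt.φ (heegnerTau Q))),
    realKummerSign_add he hreal.1 hnr.1, hreal.2, hnr.2, mul_one, archSign]

end RealGenusSignLawProof

/-! ### §4e  The HALF-PERIOD SIGN LAW (gen 4, PROVED): each real factor of `archSign` is the sign of a half-period `2`-torsion point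

For `f` Fricke-invariant with `{∞,0}_f = 0` (both automatic in analytic rank one, `isFrickeEigen_one_and_modularSymbol_zero_of_analyticRank_eq_one`)
and a Fricke-real `τ` (`γ • τ = w_N • (J • τ)`, `γ ∈ Γ₀(N)`): `φ(τ)` is a REAL point and `δ_∞(φ τ) = δ_∞(uniformize(c·{∞,γ∞}_f / 2))` — the
half-period point of the symmetry element (§3b) —, because `φ(τ) = uniformize(Re z) + uniformize(c·{∞,γ∞}_f/2)` and `δ_∞` kills `uniformize(ℝ)`
(`uniformize x = 2 • uniformize (x/2)` with `uniformize (x/2)` real: NO `E⁰(ℝ) = 2E(ℝ)` needed).  So every factor of `archSign` at a Fricke-real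
representative is the real Kummer sign of an explicit `2`-torsion point read off the modular symbol `{∞, γ∞}_f` — exact arithmetic for the census
of stub 5's floor. -/

section HalfPeriodSign

open CongruenceSubgroup ComplexConjugate UpperHalfPlane
open scoped MatrixGroups ModularForm UpperHalfPlane

variable {N : ℕ} [NeZero N] {W : WeierstrassCurve ℚ} {e : ℚ}

/-- The image of a real number under the complex uniformisation is a real point. [folklore] -/
theorem isRealPoint_uniformize_ofReal (Dt : ModularParametrizationData W N) (x : ℝ) :
    IsRealPoint W (Dt.uniformize (x : ℂ)) := by
  unfold IsRealPoint
  rw [← uniformize_conj, Complex.conj_ofReal]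

/-- **`δ_∞` kills `uniformize(ℝ)`** (the identity component): `uniformize x = 2 • uniformize (x/2)`, `uniformize (x/2)` real. [folklore] -/
theorem realKummerSign_uniformize_ofReal [W.IsElliptic] (he : HasRationalTwoTorsionX W e)
    (Dt : ModularParametrizationData W N) (x : ℝ) : realKummerSign W e (Dt.uniformize (x : ℂ)) = 1 := by
  have h : Dt.uniformize (x : ℂ) = Dt.uniformize ((x / 2 : ℝ) : ℂ) + Dt.uniformize ((x / 2 : ℝ) : ℂ) := by
    rw [← map_add]
    congr 1
    push_cast
    ring
  rw [h]
  exact realKummerSign_add_self he (isRealPoint_uniformize_ofReal Dt _)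

/-- The half-period point `uniformize(c·{∞,γ∞}_f/2)` of a Fricke-real point is REAL (its period is purely imaginary, §3b, and it is
`2`-torsion). [new] -/
theorem isRealPoint_uniformize_half_period (Dt : ModularParametrizationData W N) (τ : ℍ) (γ : Gamma0 N)
    (hW : IsFrickeEigen N Dt.f (1 : ℂ)) (h0 : modularSymbol Dt.f 0 = 0)
    (hγ : (γ : SL(2, ℤ)) • τ = glCast (frickeGL N : GL (Fin 2) ℚ) • (J • τ)) :
    IsRealPoint W (Dt.uniformize ((Dt.c : ℂ) * cuspSymbol Dt.f γ / 2)) := by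
  unfold IsRealPoint
  rw [← uniformize_conj]
  have hre : ((Dt.c : ℂ) * cuspSymbol Dt.f γ / 2).re = 0 := by
    rw [Complex.div_ofNat_re, smul_cuspSymbol_re_eq_zero Dt τ γ hW h0 hγ, zero_div]
  have hconj : conj ((Dt.c : ℂ) * cuspSymbol Dt.f γ / 2) = -((Dt.c : ℂ) * cuspSymbol Dt.f γ / 2) := by
    apply Complex.ext
    · rw [Complex.conj_re, Complex.neg_re, hre, neg_zero]
    · rw [Complex.conj_im, Complex.neg_im]
  rw [hconj, map_neg]
  have h2 := two_nsmul_uniformize_half_period Dt γ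
  rw [two_nsmul] at h2
  exact neg_eq_of_add_eq_zero_right h2

/-- **Half-period SIGN law (PROVED).**  `f` Fricke-invariant, `{∞,0}_f = 0`, `τ` Fricke-real with symmetry element `γ ∈ Γ₀(N)`:
`φ(τ)` is real and `δ_∞(φ τ) = δ_∞(uniformize(c·{∞,γ∞}_f / 2))`. [new] -/
theorem realKummerSign_φ_eq_half_period [W.IsElliptic] (he : HasRationalTwoTorsionX W e)
    (Dt : ModularParametrizationData W N) (τ : ℍ) (γ : Gamma0 N)
    (hW : IsFrickeEigen N Dt.f (1 : ℂ)) (h0 : modularSymbol Dt.f 0 = 0)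
    (hγ : (γ : SL(2, ℤ)) • τ = glCast (frickeGL N : GL (Fin 2) ℚ) • (J • τ)) :
    IsRealPoint W (Dt.φ τ) ∧
      realKummerSign W e (Dt.φ τ) = realKummerSign W e (Dt.uniformize ((Dt.c : ℂ) * cuspSymbol Dt.f γ / 2)) := by
  have hsum := φ_add_uniformize_half_period Dt τ γ hW h0 hγ
  have ht := isRealPoint_uniformize_half_period Dt τ γ hW h0 hγ
  have h2 := two_nsmul_uniformize_half_period Dt γ
  have hφ : Dt.φ τ = Dt.uniformize ((((Dt.c : ℂ) * eichlerIntegral Dt.f τ).re : ℝ) : ℂ)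
      + Dt.uniformize ((Dt.c : ℂ) * cuspSymbol Dt.f γ / 2) := by
    rw [← hsum, add_assoc, ← two_nsmul, h2, add_zero]
  have hR := isRealPoint_uniformize_ofReal Dt (((Dt.c : ℂ) * eichlerIntegral Dt.f τ).re)
  rw [hφ]
  exact ⟨hR.add ht, by rw [realKummerSign_add he hR ht, realKummerSign_uniformize_ofReal he, one_mul]⟩

/-- In analytic rank one both hypotheses of the half-period law hold for every datum `Dt`: `f` is Fricke-INVARIANT (`ε = −w(E) = +1`)
and `{∞,0}_f = L(E,1) = 0`. [cite: SilvermanAEC2009, App. C §16, Thm. C.16.3] -/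
theorem isFrickeEigen_one_and_modularSymbol_zero_of_analyticRank_eq_one
    (W : WeierstrassCurve ℚ) [W.IsElliptic] [W.IsGloballyMinimal] [NeZero (W.conductorNorm ℤ)] (hr : W.analyticRank = 1)
    (Dt : ModularParametrizationData W (W.conductorNorm ℤ)) :
    IsFrickeEigen (W.conductorNorm ℤ) Dt.f (1 : ℂ) ∧ modularSymbol Dt.f 0 = 0 := by
  have hAL : ∀ (N : ℕ) [NeZero N],
      IsNewform0.exists_frickeInvolution_eq_smul (N := N) (k := (2 : ℤ)) :=
    fun N _ ↦ isNewform0_exists_frickeInvolution_eq_smul_two N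
  have hw : frickeInvolution (W.conductorNorm ℤ) 2 Dt.f = frickeEigenvalue Dt.f • Dt.f :=
    IsNewform0.frickeInvolution_eq_smul_of (hAL (W.conductorNorm ℤ)) Dt.isNewformOf.1
  obtain ⟨ε, -, hε⟩ : ∃ e : ℤ, (e = 1 ∨ e = -1) ∧ (e : ℂ) = frickeEigenvalue Dt.f := by
    rcases IsNewform0.frickeEigenvalue_eq_one_or_eq_neg_one_of (hAL (W.conductorNorm ℤ))
      Dt.isNewformOf.1 with h | h
    · exact ⟨1, Or.inl rfl, by rw [h]; norm_num⟩
    · exact ⟨-1, Or.inr rfl, by rw [h]; norm_num⟩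
  have hW : IsFrickeEigen (W.conductorNorm ℤ) Dt.f (ε : ℂ) := by
    rw [hε]
    exact isFrickeEigen_of_frickeInvolution_eq_smul _ hw
  have hroot : W.rootNumber = -ε := by
    have h := rootNumber_eq_neg_frickeEigenvalue
      (IsNewform0.exists_functional_equation_two_of_frickeInvolution_eq_smul
        fun N _ ↦ IsNewform0.frickeInvolution_eq_smul_of (hAL N))
      (fun N _ ↦ IsNewform0.frickeEigenvalue_eq_one_or_eq_neg_one_of (hAL N)) Dt.isNewformOf
    rw [← hε] at h
    exact_mod_cast h
  have hw1 : W.rootNumber = -1 := rootNumber_eq_neg_one_of_analyticRank_eq_one W Dt hr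
  have hε1 : ε = 1 := by rw [hroot] at hw1; omega
  rw [hε1, Int.cast_one] at hW
  exact ⟨hW, by rw [Dt.isNewformOf.modularSymbol_zero_eq_entireLFunction_one,
    entireLFunction_one_eq_zero_of_rootNumber_eq_neg_one hw1]⟩

/-- **Half-period sign law in analytic rank one** (hypotheses discharged): for EVERY datum `Dt` of an analytic-rank-one curve with a rational
`2`-torsion abscissa `e` and every Fricke-real `τ` with symmetry element `γ`, `φ(τ)` is real and `δ_∞(φ τ) = δ_∞(uniformize(c·{∞,γ∞}_f/2))`. [new] -/
theorem realKummerSign_φ_eq_half_period_of_analyticRank_eq_one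
    (W : WeierstrassCurve ℚ) [W.IsElliptic] [W.IsGloballyMinimal] [NeZero (W.conductorNorm ℤ)] (e : ℚ)
    (he : HasRationalTwoTorsionX W e) (hr : W.analyticRank = 1) (Dt : ModularParametrizationData W (W.conductorNorm ℤ))
    (τ : ℍ) (γ : Gamma0 (W.conductorNorm ℤ))
    (hγ : (γ : SL(2, ℤ)) • τ = glCast (frickeGL (W.conductorNorm ℤ) : GL (Fin 2) ℚ) • (J • τ)) :
    IsRealPoint W (Dt.φ τ) ∧
      realKummerSign W e (Dt.φ τ) = realKummerSign W e (Dt.uniformize ((Dt.c : ℂ) * cuspSymbol Dt.f γ / 2)) :=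
  have h := isFrickeEigen_one_and_modularSymbol_zero_of_analyticRank_eq_one W hr Dt
  realKummerSign_φ_eq_half_period he Dt τ γ h.1 h.2 hγ

end HalfPeriodSign

/-! ## §4f  `archSign` over the Fricke-real classes (gen 4, PROVED)

The real Kummer signs of the real Heegner summands that are NOT Fricke-real cancel in pairs (`π` pairs them with equal
values), so `archSign` is the product over the **Fricke-real** representatives `Q` — those with `(CN, B, A/N) ∼_{Γ₀(N)} Q`,
a condition decidable by reduction theory — and each such factor is the real Kummer sign of an explicit half-period
2-torsion point `uniformize (c · {∞, γ_Q ∞}_f / 2)` (§3b + §4e), `γ_Q ∈ Γ₀(N)` the symmetry `γ_Q • τ_Q = w_N • (J • τ_Q)`. -/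

section ArchSignFrickeReal

open CongruenceSubgroup ComplexConjugate UpperHalfPlane HeegnerForm
open scoped MatrixGroups ModularForm UpperHalfPlane

variable {N : ℕ} [NeZero N]

/-- A Fricke-real Heegner form (`(CN, B, A/N) ∼_{Γ₀(N)} Q`) carries a symmetry `γ • τ_Q = w_N • (J • τ_Q)`, `γ ∈ Γ₀(N)`:
from `τ_{(CN,B,A/N)} = J • w_N • τ_Q`, `J² = 1`, `w_N² = 1` on `ℍ` and the normalising of `Γ₀(N)` by `J` and `w_N`.
[folklore] -/
theorem exists_symmetry_of_frickeReal {D : ℤ} (hD0 : D < 0) {Q : ℤ × ℤ × ℤ} (hQ : Q ∈ heegnerForms N D)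
    (h : IsGamma0Equiv N (negB (fricke N Q)) Q) :
    ∃ γ : Gamma0 N, (γ : SL(2, ℤ)) • heegnerTau Q = glCast (frickeGL N : GL (Fin 2) ℚ) • (J • heegnerTau Q) := by
  have h1 := isGamma0Equiv_iff_sameOrbit.mp h
  rw [heegnerTau_negB_fricke hD0 hQ] at h1
  have h2 := h1.J_smul
  rw [J_smul_J_smul] at h2
  have h3 := h2.fricke_smul
  rw [ModularForms.frickeGL_smul_frickeGL_smul] at h3
  obtain ⟨γ, hγ, hγτ⟩ := h3
  exact ⟨⟨γ, hγ⟩, hγτ⟩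

/-- A nonzero sign squares to `1`. -/
theorem signType_mul_self_of_ne_zero {s : SignType} (hs : s ≠ 0) : s * s = 1 := by
  cases s <;> simp_all

/-- **`archSign` is the product over the Fricke-real classes** (analytic rank one).  The real summands `φ(τ_Q)` with
`πQ ≠ Q` come in pairs `{Q, πQ}` with `φ(τ_{πQ}) = conj φ(τ_Q) = φ(τ_Q)`, contributing `δ_∞(φ(τ_Q))² = 1`; the fixed
points of `π` on `H.reps` are exactly the Fricke-real representatives. [cite: GrossZagier1986, V §2, p. 311] -/
theorem archSign_eq_prod_frickeReal (W : WeierstrassCurve ℚ) [W.IsElliptic] [W.IsGloballyMinimal]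
    [NeZero (W.conductorNorm ℤ)] (e : ℚ) (he : HasRationalTwoTorsionX W e) (hr : W.analyticRank = 1)
    (Dt : ModularParametrizationData W (W.conductorNorm ℤ)) {D : ℤ} (H : HeegnerDatum (W.conductorNorm ℤ) D)
    (hD0 : D < 0) (hND : ∀ p : ℕ, p.Prime → p ∣ W.conductorNorm ℤ → ¬ (p : ℤ) ∣ D) :
    archSign W e Dt H = ∏ Q ∈ H.reps.filter
        (fun Q => IsGamma0Equiv (W.conductorNorm ℤ) (negB (fricke (W.conductorNorm ℤ) Q)) Q),
      realKummerSign W e (Dt.φ (heegnerTau Q)) := by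
  classical
  obtain ⟨π, hmem, hinv, hequiv, hconj⟩ := exists_conj_perm_heegnerSummands W hr Dt H hD0 hND
  -- the fixed points of `π` on `H.reps` are the Fricke-real representatives
  have hfix : ∀ Q ∈ H.reps,
      (π Q = Q ↔ IsGamma0Equiv (W.conductorNorm ℤ) (negB (fricke (W.conductorNorm ℤ) Q)) Q) := by
    intro Q hQ
    constructor
    · intro h
      have h' := hequiv Q hQ
      rw [h] at h'
      exact h'
    · intro h
      by_contra hne
      have h' : IsGamma0Equiv (W.conductorNorm ℤ) (π Q) Q := isGamma0Equiv_iff_sameOrbit.mpr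
        ((isGamma0Equiv_iff_sameOrbit.mp (hequiv Q hQ)).symm.trans (isGamma0Equiv_iff_sameOrbit.mp h))
      exact H.pairwise_not_isGamma0Equiv (hmem Q hQ) hQ hne h'
  -- a real summand has `φ(τ_{πQ}) = φ(τ_Q)`
  have hval : ∀ Q ∈ H.reps, IsRealPoint W (Dt.φ (heegnerTau Q)) →
      Dt.φ (heegnerTau (π Q)) = Dt.φ (heegnerTau Q) := by
    intro Q hQ hreal
    rw [← conjPoint_conjPoint (Dt.φ (heegnerTau (π Q))), hconj Q hQ]
    exact hreal
  unfold archSign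
  rw [← Finset.prod_filter_mul_prod_filter_not
    (H.reps.filter (fun Q => IsRealPoint W (Dt.φ (heegnerTau Q)))) (fun Q => π Q = Q)]
  have h1 : ∏ Q ∈ (H.reps.filter (fun Q => IsRealPoint W (Dt.φ (heegnerTau Q)))).filter (fun Q => ¬ π Q = Q),
      realKummerSign W e (Dt.φ (heegnerTau Q)) = 1 := by
    refine Finset.prod_involution (fun Q _ => π Q) ?_ ?_ ?_ ?_
    · intro Q hQ
      obtain ⟨hQR, -⟩ := Finset.mem_filter.mp hQ
      obtain ⟨hQr, hQreal⟩ := Finset.mem_filter.mp hQR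
      rw [hval Q hQr hQreal]
      exact signType_mul_self_of_ne_zero (realKummerSign_ne_zero he hQreal)
    · intro Q hQ _
      exact (Finset.mem_filter.mp hQ).2
    · intro Q hQ
      obtain ⟨hQR, hQne⟩ := Finset.mem_filter.mp hQ
      obtain ⟨hQr, hQreal⟩ := Finset.mem_filter.mp hQR
      refine Finset.mem_filter.mpr ⟨Finset.mem_filter.mpr ⟨hmem Q hQr, ?_⟩, fun h => hQne ?_⟩
      · show conjPoint W (Dt.φ (heegnerTau (π Q))) = Dt.φ (heegnerTau (π Q))
        rw [hval Q hQr hQreal]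
        exact hQreal
      · have h' := hinv Q hQr
        rw [h] at h'
        exact h'
    · intro Q hQ
      obtain ⟨hQR, -⟩ := Finset.mem_filter.mp hQ
      exact hinv Q (Finset.mem_filter.mp hQR).1
  rw [h1, mul_one]
  refine Finset.prod_congr ?_ (fun _ _ => rfl)
  ext Q
  simp only [Finset.mem_filter]
  constructor
  · rintro ⟨⟨hQr, -⟩, hfixQ⟩
    exact ⟨hQr, (hfix Q hQr).mp hfixQ⟩
  · rintro ⟨hQr, hQe⟩
    have hfixQ := (hfix Q hQr).mpr hQe
    refine ⟨⟨hQr, ?_⟩, hfixQ⟩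
    show conjPoint W (Dt.φ (heegnerTau Q)) = Dt.φ (heegnerTau Q)
    have h' := hconj Q hQr
    rw [hfixQ] at h'
    exact h'

/-- **Each Fricke-real factor of `archSign` is the real Kummer sign of a half-period 2-torsion point** (analytic rank
one): for `Q` Fricke-real with symmetry `γ_Q`, `δ_∞(φ(τ_Q)) = δ_∞(uniformize (c · {∞, γ_Q ∞}_f / 2))` (§4e).
[cite: GrossZagier1986, V §2, p. 311] -/
theorem realKummerSign_φ_heegnerTau_of_frickeReal (W : WeierstrassCurve ℚ) [W.IsElliptic] [W.IsGloballyMinimal]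
    [NeZero (W.conductorNorm ℤ)] (e : ℚ) (he : HasRationalTwoTorsionX W e) (hr : W.analyticRank = 1)
    (Dt : ModularParametrizationData W (W.conductorNorm ℤ)) {D : ℤ} (hD0 : D < 0) {Q : ℤ × ℤ × ℤ}
    (hQ : Q ∈ heegnerForms (W.conductorNorm ℤ) D)
    (h : IsGamma0Equiv (W.conductorNorm ℤ) (negB (fricke (W.conductorNorm ℤ) Q)) Q) :
    ∃ γ : Gamma0 (W.conductorNorm ℤ),
      (γ : SL(2, ℤ)) • heegnerTau Q = glCast (frickeGL (W.conductorNorm ℤ) : GL (Fin 2) ℚ) • (J • heegnerTau Q) ∧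
      IsRealPoint W (Dt.φ (heegnerTau Q)) ∧
      realKummerSign W e (Dt.φ (heegnerTau Q)) =
        realKummerSign W e (Dt.uniformize ((Dt.c : ℂ) * cuspSymbol Dt.f γ / 2)) := by
  obtain ⟨γ, hγ⟩ := exists_symmetry_of_frickeReal hD0 hQ h
  exact ⟨γ, hγ, realKummerSign_φ_eq_half_period_of_analyticRank_eq_one W e he hr Dt _ γ hγ⟩

end ArchSignFrickeReal

/-! ## §4g  The sign law in closed form: ONE half-period point (gen 4, PROVED)

For ANY choice of symmetries `γ_Q ∈ Γ₀(N)` (`γ_Q • τ_Q = w_N • (J • τ_Q)`) of the Fricke-real representatives,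
`archSign = δ_∞ (uniformize (c · Σ_{Q Fricke-real} {∞, γ_Q ∞}_f / 2))`: the genus product is the real Kummer sign of a SINGLE
half-period `2`-torsion point, the half of the (scaled) sum of the minus-space modular symbols at the symmetries.  With S3 this reads
`sign k(P) = δ_∞ (uniformize (c · Σ_Q {∞, γ_Q ∞}_f / 2))` for the rational Heegner point `P`. -/

section ClosedForm

open CongruenceSubgroup ComplexConjugate UpperHalfPlane HeegnerForm
open scoped MatrixGroups ModularForm UpperHalfPlane

/-- **Closed form of the real genus sign law** (analytic rank one; any symmetries `γ_Q` of the Fricke-real representatives).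
[cite: GrossZagier1986, V §2, p. 311] -/
theorem archSign_eq_realKummerSign_uniformize_sum (W : WeierstrassCurve ℚ) [W.IsElliptic] [W.IsGloballyMinimal]
    [NeZero (W.conductorNorm ℤ)] (e : ℚ) (he : HasRationalTwoTorsionX W e) (hr : W.analyticRank = 1)
    (Dt : ModularParametrizationData W (W.conductorNorm ℤ)) {D : ℤ} (H : HeegnerDatum (W.conductorNorm ℤ) D)
    (hD0 : D < 0) (hND : ∀ p : ℕ, p.Prime → p ∣ W.conductorNorm ℤ → ¬ (p : ℤ) ∣ D)
    (γ : ℤ × ℤ × ℤ → Gamma0 (W.conductorNorm ℤ))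
    (hγ : ∀ Q ∈ H.reps, IsGamma0Equiv (W.conductorNorm ℤ) (negB (fricke (W.conductorNorm ℤ) Q)) Q →
      (γ Q : SL(2, ℤ)) • heegnerTau Q =
        glCast (frickeGL (W.conductorNorm ℤ) : GL (Fin 2) ℚ) • (J • heegnerTau Q)) :
    archSign W e Dt H = realKummerSign W e (Dt.uniformize ((Dt.c : ℂ) *
      (∑ Q ∈ H.reps.filter
          (fun Q => IsGamma0Equiv (W.conductorNorm ℤ) (negB (fricke (W.conductorNorm ℤ) Q)) Q),
        cuspSymbol Dt.f (γ Q)) / 2)) := by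
  classical
  rw [archSign_eq_prod_frickeReal W e he hr Dt H hD0 hND]
  obtain ⟨hW1, h0⟩ := isFrickeEigen_one_and_modularSymbol_zero_of_analyticRank_eq_one W hr Dt
  have hreal : ∀ Q ∈ H.reps.filter
      (fun Q => IsGamma0Equiv (W.conductorNorm ℤ) (negB (fricke (W.conductorNorm ℤ) Q)) Q),
      IsRealPoint W (Dt.uniformize ((Dt.c : ℂ) * cuspSymbol Dt.f (γ Q) / 2)) := by
    intro Q hQ
    obtain ⟨hQr, hQe⟩ := Finset.mem_filter.mp hQ
    exact isRealPoint_uniformize_half_period Dt (heegnerTau Q) (γ Q) hW1 h0 (hγ Q hQr hQe)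
  have hfac : ∀ Q ∈ H.reps.filter
      (fun Q => IsGamma0Equiv (W.conductorNorm ℤ) (negB (fricke (W.conductorNorm ℤ) Q)) Q),
      realKummerSign W e (Dt.φ (heegnerTau Q)) =
        realKummerSign W e (Dt.uniformize ((Dt.c : ℂ) * cuspSymbol Dt.f (γ Q) / 2)) := by
    intro Q hQ
    obtain ⟨hQr, hQe⟩ := Finset.mem_filter.mp hQ
    exact (realKummerSign_φ_eq_half_period_of_analyticRank_eq_one W e he hr Dt _ (γ Q) (hγ Q hQr hQe)).2
  rw [Finset.prod_congr rfl hfac, ← (realKummerSign_sum_real he _ _ hreal).2, ← map_sum, Finset.mul_sum,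
    Finset.sum_div]

/-- **The sign of the rational Heegner point, closed form** (= S3 + §4g): for type-A `W` of analytic rank one, the door field
`K`, the rational point `R` under the Heegner point and any symmetries `γ_Q` of the Fricke-real representatives,
`sign k(R) = δ_∞ (uniformize (c · Σ_{Q Fricke-real} {∞, γ_Q ∞}_f / 2))`. [cite: GrossZagier1986, V §2, p. 311] -/
theorem sign_kummerValQ_eq_realKummerSign_uniformize_sum (W : WeierstrassCurve ℚ) [W.IsElliptic] [W.IsGloballyMinimal]
    [NeZero (W.conductorNorm ℤ)] (e : ℚ) (he : HasRationalTwoTorsionX W e) (hr : W.analyticRank = 1)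
    (K : Type) [Field K] [NumberField K] (hK : IsImaginaryQuadratic K)
    (hH : SatisfiesHeegnerHypothesis (W.conductorNorm ℤ) K)
    (Dt : ModularParametrizationData W (W.conductorNorm ℤ))
    (H : HeegnerDatum (W.conductorNorm ℤ) (NumberField.discr K)) (ι : K →+* ℂ)
    (P : (W.baseChange K).toAffine.Point) (R : W.toAffine.Point)
    (hPH : WeierstrassCurve.Affine.Point.map ι.toRatAlgHom P = heegnerPointComplex Dt H) (hP : ¬ IsOfFinAddOrder P)
    (hRP : QuadraticDescent.incl K W R = P)
    (γ : ℤ × ℤ × ℤ → Gamma0 (W.conductorNorm ℤ))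
    (hγ : ∀ Q ∈ H.reps, IsGamma0Equiv (W.conductorNorm ℤ) (negB (fricke (W.conductorNorm ℤ) Q)) Q →
      (γ Q : SL(2, ℤ)) • heegnerTau Q =
        glCast (frickeGL (W.conductorNorm ℤ) : GL (Fin 2) ℚ) • (J • heegnerTau Q)) :
    SignType.sign (kummerValQ W e R) = realKummerSign W e (Dt.uniformize ((Dt.c : ℂ) *
      (∑ Q ∈ H.reps.filter
          (fun Q => IsGamma0Equiv (W.conductorNorm ℤ) (negB (fricke (W.conductorNorm ℤ) Q)) Q),
        cuspSymbol Dt.f (γ Q)) / 2)) := by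
  have hD0 : NumberField.discr K < 0 := hK.discr_neg
  have hND : ∀ p : ℕ, p.Prime → p ∣ W.conductorNorm ℤ → ¬ (p : ℤ) ∣ NumberField.discr K :=
    fun p hp hpN ↦ not_dvd_discr_of_satisfiesHeegnerHypothesis hK hH hp hpN
  rw [realGenusSignLawAtTwo_holds W e he hr K hK hH Dt H ι P R hPH hP hRP,
    archSign_eq_realKummerSign_uniformize_sum W e he hr Dt H hD0 hND γ hγ]


/-- **Parity law (the Eisenstein / minus-symbol reading).**  If the scaled symmetry symbols of the Fricke-real representatives
are integer multiples `m_Q · ω` of ONE lattice vector `ω` (`uniformize ω = O`; in practice `ω = i·Ω⁻` and `m_Q` is the minus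
modular symbol `{∞, γ_Q ∞}⁻_f` in units of `Ω⁻/c`), then `archSign = δ_∞(uniformize (ω/2))^{Σ_Q m_Q}`: `+1` if `Σ_Q m_Q` is even,
the real Kummer sign of the `2`-torsion point `uniformize (ω/2)` if it is odd. [cite: CremonaAlgorithms1997, §2.8, §2.10] -/
theorem archSign_eq_of_symbols_eq_zsmul (W : WeierstrassCurve ℚ) [W.IsElliptic] [W.IsGloballyMinimal]
    [NeZero (W.conductorNorm ℤ)] (e : ℚ) (he : HasRationalTwoTorsionX W e) (hr : W.analyticRank = 1)
    (Dt : ModularParametrizationData W (W.conductorNorm ℤ)) {D : ℤ} (H : HeegnerDatum (W.conductorNorm ℤ) D)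
    (hD0 : D < 0) (hND : ∀ p : ℕ, p.Prime → p ∣ W.conductorNorm ℤ → ¬ (p : ℤ) ∣ D)
    (γ : ℤ × ℤ × ℤ → Gamma0 (W.conductorNorm ℤ))
    (hγ : ∀ Q ∈ H.reps, IsGamma0Equiv (W.conductorNorm ℤ) (negB (fricke (W.conductorNorm ℤ) Q)) Q →
      (γ Q : SL(2, ℤ)) • heegnerTau Q =
        glCast (frickeGL (W.conductorNorm ℤ) : GL (Fin 2) ℚ) • (J • heegnerTau Q))
    (ω : ℂ) (hω : Dt.uniformize ω = 0) (m : ℤ × ℤ × ℤ → ℤ)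
    (hm : ∀ Q ∈ H.reps, IsGamma0Equiv (W.conductorNorm ℤ) (negB (fricke (W.conductorNorm ℤ) Q)) Q →
      (Dt.c : ℂ) * cuspSymbol Dt.f (γ Q) = (m Q : ℂ) * ω) :
    archSign W e Dt H =
      if Even (∑ Q ∈ H.reps.filter
          (fun Q => IsGamma0Equiv (W.conductorNorm ℤ) (negB (fricke (W.conductorNorm ℤ) Q)) Q), m Q)
      then 1 else realKummerSign W e (Dt.uniformize (ω / 2)) := by
  classical
  rw [archSign_eq_realKummerSign_uniformize_sum W e he hr Dt H hD0 hND γ hγ]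
  have hsum : (Dt.c : ℂ) * (∑ Q ∈ H.reps.filter
        (fun Q => IsGamma0Equiv (W.conductorNorm ℤ) (negB (fricke (W.conductorNorm ℤ) Q)) Q),
        cuspSymbol Dt.f (γ Q)) / 2 =
      ((∑ Q ∈ H.reps.filter
        (fun Q => IsGamma0Equiv (W.conductorNorm ℤ) (negB (fricke (W.conductorNorm ℤ) Q)) Q), m Q : ℤ) : ℂ) *
        (ω / 2) := by
    rw [Finset.mul_sum, Finset.sum_congr rfl (fun Q hQ =>
      hm Q (Finset.mem_filter.mp hQ).1 (Finset.mem_filter.mp hQ).2), ← Finset.sum_mul, Int.cast_sum]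
    ring
  rw [hsum, ← zsmul_eq_mul, map_zsmul]
  have htors : (2 : ℤ) • Dt.uniformize (ω / 2) = 0 := by
    rw [← map_zsmul, zsmul_eq_mul]
    push_cast
    rw [mul_div_cancel₀ _ (two_ne_zero' ℂ)]
    exact hω
  split_ifs with hev
  · obtain ⟨k, hk⟩ := hev
    rw [hk, ← two_mul, mul_comm, mul_zsmul, htors, zsmul_zero, realKummerSign_zero]
  · obtain ⟨k, hk⟩ := Int.not_even_iff_odd.mp hev
    rw [hk, add_zsmul, one_zsmul, mul_comm, mul_zsmul, htors, zsmul_zero, zero_add]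


/-- **End to end: odd minus-symbol sum ⟹ exact `2`-divisibility of the Heegner point** (S3 + §4h + S4, all PROVED).  Type-A `W`
of analytic rank one with `δ_∞` trivial on `E(ℚ)_tors`, a Heegner field `K` with `rank E(K) = 1`, the rational point `R` under the
Heegner point `P`; if the scaled symmetry symbols are `m_Q · ω` with `Σ_Q m_Q` ODD and the `2`-torsion point `uniformize (ω/2)` has real
Kummer sign `−1`, then `P` is divisible by exactly `2^{hb}` up to torsion in `E(K)` — the type-A door bit, from finite data.
[cite: GrossZagier1986, V §2, p. 311] -/
theorem hasTwoDivisibilityUpToTorsion_of_odd_symbols (W : WeierstrassCurve ℚ) [W.IsElliptic] [W.IsGloballyMinimal]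
    [NeZero (W.conductorNorm ℤ)] (e : ℚ) (he : HasRationalTwoTorsionX W e) (ht : TorsionSignTrivial W e)
    (hr : W.analyticRank = 1)
    (K : Type) [Field K] [NumberField K] (hK : IsImaginaryQuadratic K)
    (hH : SatisfiesHeegnerHypothesis (W.conductorNorm ℤ) K) (hrk : (W.baseChange K).mordellWeilRank = 1)
    (Dt : ModularParametrizationData W (W.conductorNorm ℤ))
    (H : HeegnerDatum (W.conductorNorm ℤ) (NumberField.discr K)) (ι : K →+* ℂ)
    (P : (W.baseChange K).toAffine.Point) (R : W.toAffine.Point)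
    (hPH : WeierstrassCurve.Affine.Point.map ι.toRatAlgHom P = heegnerPointComplex Dt H) (hP : ¬ IsOfFinAddOrder P)
    (hRP : QuadraticDescent.incl K W R = P)
    (γ : ℤ × ℤ × ℤ → Gamma0 (W.conductorNorm ℤ))
    (hγ : ∀ Q ∈ H.reps, IsGamma0Equiv (W.conductorNorm ℤ) (negB (fricke (W.conductorNorm ℤ) Q)) Q →
      (γ Q : SL(2, ℤ)) • heegnerTau Q =
        glCast (frickeGL (W.conductorNorm ℤ) : GL (Fin 2) ℚ) • (J • heegnerTau Q))
    (ω : ℂ) (hω : Dt.uniformize ω = 0) (m : ℤ × ℤ × ℤ → ℤ)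
    (hm : ∀ Q ∈ H.reps, IsGamma0Equiv (W.conductorNorm ℤ) (negB (fricke (W.conductorNorm ℤ) Q)) Q →
      (Dt.c : ℂ) * cuspSymbol Dt.f (γ Q) = (m Q : ℂ) * ω)
    (hodd : Odd (∑ Q ∈ H.reps.filter
      (fun Q => IsGamma0Equiv (W.conductorNorm ℤ) (negB (fricke (W.conductorNorm ℤ) Q)) Q), m Q))
    (hneg : realKummerSign W e (Dt.uniformize (ω / 2)) = -1) :
    HasTwoDivisibilityUpToTorsion W K P (halvBit W K) := by
  refine oddIndexOfNegativeSignAtTwo_holds W e he ht K hK hrk P R hRP ?_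
  have hD0 : NumberField.discr K < 0 := hK.discr_neg
  have hND : ∀ p : ℕ, p.Prime → p ∣ W.conductorNorm ℤ → ¬ (p : ℤ) ∣ NumberField.discr K :=
    fun p hp hpN ↦ not_dvd_discr_of_satisfiesHeegnerHypothesis hK hH hp hpN
  rw [realGenusSignLawAtTwo_holds W e he hr K hK hH Dt H ι P R hPH hP hRP,
    archSign_eq_of_symbols_eq_zsmul W e he hr Dt H hD0 hND γ hγ ω hω m hm,
    if_neg (Int.not_even_iff_odd.mpr hodd), hneg]


/-- **Floor certificate** (row decidability of S5's hypothesis `OnArchFloor`, PROVED): `Δ > 0`, `δ_∞ = +1` on `E(ℚ)[2]` and no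
rational point of order `4` (`torsionSignTrivial_of_twoTorsion`), and an ODD minus-symbol sum with `δ_∞(uniformize (ω/2)) = −1`
(§4h) put the row ON THE ARCH FLOOR — finite curve-and-door data, no `Ш`, no `L`-value, no generator. [new] -/
theorem onArchFloor_of_odd_symbols (W : WeierstrassCurve ℚ) [W.IsElliptic] [W.IsGloballyMinimal]
    [NeZero (W.conductorNorm ℤ)] (e : ℚ) (he : HasRationalTwoTorsionX W e) (hr : W.analyticRank = 1)
    (Dt : ModularParametrizationData W (W.conductorNorm ℤ)) {D : ℤ} (H : HeegnerDatum (W.conductorNorm ℤ) D)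
    (hD0 : D < 0) (hND : ∀ p : ℕ, p.Prime → p ∣ W.conductorNorm ℤ → ¬ (p : ℤ) ∣ D) (hΔ : 0 < W.Δ)
    (h2 : ∀ t : W.toAffine.Point, 2 • t = 0 → SignType.sign (kummerValQ W e t) = 1)
    (h4 : ∀ t : W.toAffine.Point, 4 • t = 0 → 2 • t = 0)
    (γ : ℤ × ℤ × ℤ → Gamma0 (W.conductorNorm ℤ))
    (hγ : ∀ Q ∈ H.reps, IsGamma0Equiv (W.conductorNorm ℤ) (negB (fricke (W.conductorNorm ℤ) Q)) Q →
      (γ Q : SL(2, ℤ)) • heegnerTau Q =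
        glCast (frickeGL (W.conductorNorm ℤ) : GL (Fin 2) ℚ) • (J • heegnerTau Q))
    (ω : ℂ) (hω : Dt.uniformize ω = 0) (m : ℤ × ℤ × ℤ → ℤ)
    (hm : ∀ Q ∈ H.reps, IsGamma0Equiv (W.conductorNorm ℤ) (negB (fricke (W.conductorNorm ℤ) Q)) Q →
      (Dt.c : ℂ) * cuspSymbol Dt.f (γ Q) = (m Q : ℂ) * ω)
    (hodd : Odd (∑ Q ∈ H.reps.filter
      (fun Q => IsGamma0Equiv (W.conductorNorm ℤ) (negB (fricke (W.conductorNorm ℤ) Q)) Q), m Q))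
    (hneg : realKummerSign W e (Dt.uniformize (ω / 2)) = -1) : OnArchFloor W e Dt H := by
  refine ⟨hΔ, torsionSignTrivial_of_twoTorsion he h2 h4, ?_⟩
  rw [archSign_eq_of_symbols_eq_zsmul W e he hr Dt H hD0 hND γ hγ ω hω m hm,
    if_neg (Int.not_even_iff_odd.mpr hodd), hneg]

/-- **Floor certificate, torsion hypothesis abstract** (PROVED): as `onArchFloor_of_odd_symbols` but with `TorsionSignTrivial W e` as an
input, to be supplied by any of `torsionSignTrivial_of_twoTorsion`, `torsionSignTrivial_of_not_four_dvd_torsionOrder`,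
`torsionSignTrivial_of_unique_twoDivisionRoot[_of_not_four_dvd]` (§3c). [new, v4.9] -/
theorem onArchFloor_of_torsionSignTrivial_of_odd_symbols (W : WeierstrassCurve ℚ) [W.IsElliptic] [W.IsGloballyMinimal]
    [NeZero (W.conductorNorm ℤ)] (e : ℚ) (he : HasRationalTwoTorsionX W e) (hr : W.analyticRank = 1)
    (Dt : ModularParametrizationData W (W.conductorNorm ℤ)) {D : ℤ} (H : HeegnerDatum (W.conductorNorm ℤ) D)
    (hD0 : D < 0) (hND : ∀ p : ℕ, p.Prime → p ∣ W.conductorNorm ℤ → ¬ (p : ℤ) ∣ D) (hΔ : 0 < W.Δ)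
    (ht : TorsionSignTrivial W e)
    (γ : ℤ × ℤ × ℤ → Gamma0 (W.conductorNorm ℤ))
    (hγ : ∀ Q ∈ H.reps, IsGamma0Equiv (W.conductorNorm ℤ) (negB (fricke (W.conductorNorm ℤ) Q)) Q →
      (γ Q : SL(2, ℤ)) • heegnerTau Q =
        glCast (frickeGL (W.conductorNorm ℤ) : GL (Fin 2) ℚ) • (J • heegnerTau Q))
    (ω : ℂ) (hω : Dt.uniformize ω = 0) (m : ℤ × ℤ × ℤ → ℤ)
    (hm : ∀ Q ∈ H.reps, IsGamma0Equiv (W.conductorNorm ℤ) (negB (fricke (W.conductorNorm ℤ) Q)) Q →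
      (Dt.c : ℂ) * cuspSymbol Dt.f (γ Q) = (m Q : ℂ) * ω)
    (hodd : Odd (∑ Q ∈ H.reps.filter
      (fun Q => IsGamma0Equiv (W.conductorNorm ℤ) (negB (fricke (W.conductorNorm ℤ) Q)) Q), m Q))
    (hneg : realKummerSign W e (Dt.uniformize (ω / 2)) = -1) : OnArchFloor W e Dt H := by
  refine ⟨hΔ, ht, ?_⟩
  rw [archSign_eq_of_symbols_eq_zsmul W e he hr Dt H hD0 hND γ hγ ω hω m hm,
    if_neg (Int.not_even_iff_odd.mpr hodd), hneg]

end ClosedForm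


theorem stub_halfZero : S_halfZero := by sorry
theorem stub_inputs : S_inputs := by sorry
theorem stub_realGenusSignLaw : RealGenusSignLawAtTwo := realGenusSignLawAtTwo_holds  -- PROVED (gen 4, §4d)
theorem stub_oddIndexOfNegativeSign : OddIndexOfNegativeSignAtTwo := oddIndexOfNegativeSignAtTwo_holds  -- PROVED (gen 4, §4b)
theorem stub_archLedger : ArchLedgerAtTwo := by sorry
theorem stub_archResidual : ArchResidualAtTwo := by sorry

/-! ## §5  Proved glue and the composition -/

/-- **Arch reach ⟹ `BSD₂` (proved: the isogeny transport).**  From the print inputs, the rank-`0` twin, Cassels' isogeny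
invariance, the sign law, the odd-index lemma and the arch ledger: if SOME `W'` isogenous to `W` has an arch-floor row with trivial
`Ш[2]`'s then `BSD₂(W)`.  Steps: `W'` has analytic rank `1`; Gross–Zagier/Kolyvagin at `(N', W', K)`; the twist model `Wd` is non-CM
of analytic rank `0`, so `BSD₂(Wd)` by the twin; the door EQUIVALENCE at `W'` (also giving `rank W'(K) = 1` and `P` non-torsion);
`P = ι R` with `R ∈ W'(ℚ)` (§3); stub 3 gives `sign(x(R) − e') = archSign = −1`, stub 4 gives the exponent `hb`; stub 5 + `Ш[2] = 0`
twice give `DoorIdentityAt … hb`; hence `BSD₂(W')`; transport to `W` by `Wuthrich2014.bsdp_of_isIsogenous` (Cassels). -/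
theorem bsdp_two_of_archReach (hpub : S_pub) (hZ : S_rankZeroTwin) (hCassels : WeierstrassCurve.bsdRHS_eq_of_isIsogenous)
    (hsign : RealGenusSignLawAtTwo) (hodd : OddIndexOfNegativeSignAtTwo) (hledger : ArchLedgerAtTwo)
    (W : WeierstrassCurve ℚ) [W.IsElliptic] [W.IsGloballyMinimal] (hr : W.analyticRank = 1) (hreach : ArchReach W) :
    BSDp W 2 := by
  haveI : Fact (Nat.Prime 2) := ⟨Nat.prime_two⟩
  obtain ⟨W', _iE, _iM, _iN, e, K, _iF, _iK, ι, Dt, H, P, Wd, _iEd, _iMd, Cd, hiso, he, hCM', hK, hadm, hLt, hHN, hP,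
    hWd, hfl, hShaW, hShaWd⟩ := hreach
  -- `W'` has analytic rank `1` (isogenous curves have the same `L`-function)
  have hr' : W'.analyticRank = 1 := by rw [← analyticRank_eq_of_isIsogenous' hiso]; exact hr
  obtain ⟨hGZ, hKo, -⟩ := hpub.1 (W'.conductorNorm ℤ) W' K
  -- the twist model is non-CM of analytic rank `0`, so `BSD(Wd, 2)` by the rank-zero twin
  have hD0 : (NumberField.discr K : ℚ) ≠ 0 := by exact_mod_cast NumberField.discr_ne_zero K
  haveI hEt : (W'.quadraticTwist (NumberField.discr K : ℚ)).IsElliptic := W'.isElliptic_quadraticTwist hD0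
  have hCMd : ¬ Wd.HasCM :=
    Summit.BirchSwinnertonDyer.BirchSwinnertonDyer.Theorems.RamifiedPairUpperBound.not_hasCM_of_smul_quadraticTwist_eq
      hD0 hWd hCM'
  have hLeq : Wd.entireLFunction = (W'.quadraticTwist (NumberField.discr K : ℚ)).entireLFunction := by
    rw [← hWd, entireLFunction_smul]
  have hrd : Wd.analyticRank = 0 :=
    (Wd.analyticRank_eq_zero_iff_holds (hpub.2.2 Wd)).2 (by rw [hLeq]; exact hLt)
  have hBd : BSDp Wd 2 := hZ Wd hCMd hrd
  -- the door equivalence at `W'`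
  obtain ⟨-, -, hPinf, hrk, hiff⟩ :=
    bsdp_two_iff_doorIdentity_at hpub.2.1 hpub.2.2 doorTwistTamagawaAtTwo W' hr' K hK hGZ hKo hadm hHN hLt Dt H ι P hP
      Wd Cd hWd hBd
  -- §3: the Heegner point is `ℚ`-rational
  obtain ⟨R, hR⟩ := exists_incl_eq_of_isHeegnerPoint_of_analyticRank_eq_one W' K hK hHN ⟨Dt, H, ι, hP⟩ hr'
  -- on the arch floor: sign law ⟹ `δ_∞(R) = −1` ⟹ exponent `hb`; the ledger ⟹ the identity at `hb`
  obtain ⟨-, htors, harch⟩ := id hfl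
  have hsgn : SignType.sign (kummerValQ W' e R) = -1 := by
    rw [hsign W' e he hr' K hK hHN Dt H ι P R hP hPinf hR, harch]
  have hB' : BSDp W' 2 := by
    refine hiff.mpr ⟨halvBit W' K, hodd W' e he htors K hK hrk P R hR hsgn, ?_⟩
    exact doorIdentityAt_halvBit_of_archLedger hShaW hShaWd
      (hledger W' e he hCM' hr' K hK hadm hLt hHN Dt H Wd Cd hWd hfl hShaW hShaWd)
  -- transport along the isogeny (Cassels)
  have hfin' : Finite W'.sha := (hpub.2.1 W' hr'.le).2
  have hlead' : W'.leadingLCoeff ≠ 0 := W'.leadingLCoeff_ne_zero_holds (hpub.2.2 W')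
  exact Literature.NumberTheory.EllipticCurves.Wuthrich2014.bsdp_of_isIsogenous hCassels hiso hfin' hlead' hB'

/-- **Type-A glue (proved).**  BY-NAME inputs + stubs 3–5 + the residual give the type-A half: if the curve REACHES THE ARCH
FLOOR (some isogenous model has a floor row with trivial `Ш[2]`'s) then `bsdp_two_of_archReach`; otherwise the Hoffstein–Luo door
(`doorSupplyAnalyticAtTwo_of_pubHL`), any datum (modularity), the `K`-rational Heegner point, a minimal model of the twist with
`BSD₂` from the rank-`0` items, the general equivalence `bsdp_two_iff_doorIdentity_at`, and the residual stub 6. -/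
theorem twoTorsionHalf_of_stubs (hin : S_inputs) (hsign : RealGenusSignLawAtTwo) (hodd : OddIndexOfNegativeSignAtTwo)
    (hledger : ArchLedgerAtTwo) (hres : ArchResidualAtTwo) : TwoTorsionHalf := by
  intro W _ _ hCM h2 hr
  obtain ⟨⟨hpub, hHL, hCassels⟩, hZ4⟩ := hin
  haveI : Fact (Nat.Prime 2) := ⟨Nat.prime_two⟩
  haveI hN : NeZero (W.conductorNorm ℤ) := ⟨(W.conductorNorm_pos_holds).ne'⟩
  -- the abscissa of a rational `2`-torsion point
  obtain ⟨e, he⟩ : ∃ e : ℚ, HasRationalTwoTorsionX W e := by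
    by_contra h
    exact h2 (fun x hx => h ⟨x, hx⟩)
  have hZ : S_rankZeroTwin := fun V _ _ hVCM hV0 => bsdp_two_of_rankZero_cruxes hZ4 V hVCM hV0
  by_cases hreach : ArchReach W
  · -- SOME isogenous model has an arch-floor row: proved transport
    exact bsdp_two_of_archReach hpub hZ hCassels hsign hodd hledger W hr hreach
  · -- NO floor row in the isogeny class: the declared residual, on the Hoffstein–Luo door
    obtain ⟨K, _iF, _iN, hK, hadm, hLt, -, hHN⟩ := doorSupplyAnalyticAtTwo_of_pubHL hHL W hr
    obtain ⟨Dt⟩ := (nonempty_modularParametrizationData_iff_exists_isNewformOf_unconditional.mpr hHL.1) W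
    obtain ⟨H, -⟩ :=
      nonempty_heegnerDatum_holds (W.conductorNorm ℤ) K hK
        (exists_dvd_sq_sub_discr_holds (W.conductorNorm ℤ) K hK hHN).choose_spec
    obtain ⟨ι⟩ : Nonempty (K →+* ℂ) := inferInstance
    obtain ⟨hGZ, hKo, hrat⟩ := hpub.1 (W.conductorNorm ℤ) W K
    obtain ⟨P, hP⟩ := hrat hK hHN Dt H ι
    -- a globally minimal model of the twist; it is non-CM of analytic rank `0`, so `BSD(Wd, 2)` by `S_rankZeroTwin`
    have hD0 : (NumberField.discr K : ℚ) ≠ 0 := by exact_mod_cast NumberField.discr_ne_zero K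
    haveI hEt : (W.quadraticTwist (NumberField.discr K : ℚ)).IsElliptic := W.isElliptic_quadraticTwist hD0
    obtain ⟨Cd, hCd⟩ := hasGlobalMinimalModel_rat_holds (W.quadraticTwist (NumberField.discr K : ℚ))
    haveI : (Cd • W.quadraticTwist (NumberField.discr K : ℚ)).IsGloballyMinimal := hCd
    set Wd := Cd • W.quadraticTwist (NumberField.discr K : ℚ) with hWd_def
    have hWd : Cd • W.quadraticTwist (NumberField.discr K : ℚ) = Wd := rfl
    have hCMd : ¬ Wd.HasCM :=
      Summit.BirchSwinnertonDyer.BirchSwinnertonDyer.Theorems.RamifiedPairUpperBound.not_hasCM_of_smul_quadraticTwist_eq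
        hD0 hWd hCM
    have hLeq : Wd.entireLFunction = (W.quadraticTwist (NumberField.discr K : ℚ)).entireLFunction := by
      rw [← hWd, entireLFunction_smul]
    have hrd : Wd.analyticRank = 0 :=
      (Wd.analyticRank_eq_zero_iff_holds (hpub.2.2 Wd)).2 (by rw [hLeq]; exact hLt)
    have hBd : BSDp Wd 2 := hZ Wd hCMd hrd
    -- the general per-datum equivalence, and the residual
    obtain ⟨-, -, hPinf, -, hiff⟩ :=
      bsdp_two_iff_doorIdentity_at hpub.2.1 hpub.2.2 doorTwistTamagawaAtTwo W hr K hK hGZ hKo hadm hHN hLt Dt H ι P hP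
        Wd Cd hWd hBd
    exact hiff.mpr (hres W e he hCM hr hreach K hK hadm hLt hHN Dt H ι P hP hPinf Wd Cd hWd)

/-- **The six-hypothesis composition** (the six stub STATEMENTS imply the crux; conclusion the local name `Crux`, so that this
theorem is not itself a crux-concluding candidate for `#h21_check_skeleton` — v4.6's `RankOneAtTwoOffBigImageOddLocal_of`, renamed v4.7). -/
theorem RankOneAtTwoOffBigImageOddLocal_of_hyps :
    S_halfZero → S_inputs → RealGenusSignLawAtTwo → OddIndexOfNegativeSignAtTwo → ArchLedgerAtTwo → ArchResidualAtTwo → Crux :=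
  fun h0 hin hsign hodd hledger hres =>
    offBigImage_of_halves h0 (twoTorsionHalf_of_stubs hin hsign hodd hledger hres)

/-- **THE SKELETON THEOREM: the crux BY NAME from exactly the six `stub_*`** (type literally the route decl
`Summit.BirchSwinnertonDyer.BirchSwinnertonDyer.Theses.ByReductionTypeAtTwo.RankOneAtTwoOffBigImageOddLocal`, no hypotheses; depends on
`sorryAx` through the four open stubs `stub_halfZero`, `stub_inputs`, `stub_archLedger`, `stub_archResidual` and through nothing else —
`stub_realGenusSignLaw` and `stub_oddIndexOfNegativeSign` are the theorems of §4d / §4b).  This is the term `ledger skeleton check`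
instantiates (v4.7: the registrable shape, after line 1 g6; the lead registers, not this seat). -/
theorem RankOneAtTwoOffBigImageOddLocal_of :
    Summit.BirchSwinnertonDyer.BirchSwinnertonDyer.Theses.ByReductionTypeAtTwo.RankOneAtTwoOffBigImageOddLocal :=
  RankOneAtTwoOffBigImageOddLocal_of_hyps stub_halfZero stub_inputs stub_realGenusSignLaw stub_oddIndexOfNegativeSign
    stub_archLedger stub_archResidual

/-- **The FIVE-stub composition (gen 4).**  Stub 4 is a theorem (§4b), so the crux follows from the remaining five:
`S_halfZero → S_inputs → RealGenusSignLawAtTwo → ArchLedgerAtTwo → ArchResidualAtTwo → crux`. [new] -/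
theorem RankOneAtTwoOffBigImageOddLocal_of_five :
    S_halfZero → S_inputs → RealGenusSignLawAtTwo → ArchLedgerAtTwo → ArchResidualAtTwo → Crux :=
  fun h0 hin hsign hledger hres =>
    RankOneAtTwoOffBigImageOddLocal_of_hyps h0 hin hsign oddIndexOfNegativeSignAtTwo_holds hledger hres

/-- **Four-hypothesis composition (gen 4).**  With stubs 3 AND 4 proved (`realGenusSignLawAtTwo_holds`,
`oddIndexOfNegativeSignAtTwo_holds`) the crux follows from the two by-name inputs (S1, S2), the floor ledger (S5) and the
off-floor residual (S6) alone (conclusion `Crux`; `Crux` unfolds to the route decl by `rfl`). -/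
theorem RankOneAtTwoOffBigImageOddLocal_of_four :
    S_halfZero → S_inputs → ArchLedgerAtTwo → ArchResidualAtTwo → Crux :=
  fun h0 hin hledger hres =>
    RankOneAtTwoOffBigImageOddLocal_of_hyps h0 hin realGenusSignLawAtTwo_holds oddIndexOfNegativeSignAtTwo_holds hledger hres

/-- `Crux` is the route decl on the nose. -/
theorem crux_iff : Crux ↔ Summit.BirchSwinnertonDyer.BirchSwinnertonDyer.Theses.ByReductionTypeAtTwo.RankOneAtTwoOffBigImageOddLocal :=
  Iff.rfl

/-! ## §6  Gen-4 CERTIFICATE (proved): on an arch-floor row the arch ledger IS `BSD₂` — stub 5 is exactly as safe as `BSD₂`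

`archLedger_of_bsdp_two`: print inputs + stub 3 + a floor row with trivial `Ш[2]`'s + `BSD₂(W)` ⟹ `ArchLedger` (stub 4 is
the theorem `oddIndexOfNegativeSignAtTwo_holds` of §4b and is used, not assumed; stub 3 is kept as the hypothesis `hsign`, now
discharged by the theorem `realGenusSignLawAtTwo_holds` of §4d).  So a floor row violating the ledger (integer arithmetic in
`t, s, v₂(c), v₂∏c_ℓ, v₂#tors`, all decidable per row) refutes `BSD₂(W)` — never an artefact of the cut; and `bsdp_two_iff_archLedger_of_onArchFloor` records the equivalence.  Ingredients: §1 (`∃ m` with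
the identity, `rank E(K) = 1`), §3 (`P = ι R`), stub 3 + §4b (the exponent is `hb`), uniqueness of the exponent
(`hasTwoDivisibilityUpToTorsion_unique`, line v8.4 of the sibling crux), erase the `Ш`'s. -/

/-- **`BSD₂ ⟹ arch ledger` on a floor row (PROVED modulo print; `hsign := realGenusSignLawAtTwo_holds`).** [new] -/
theorem archLedger_of_bsdp_two (hpub : S_pub) (hsign : RealGenusSignLawAtTwo)
    (W : WeierstrassCurve ℚ) [W.IsElliptic] [W.IsGloballyMinimal] [NeZero (W.conductorNorm ℤ)] (e : ℚ)
    (he : HasRationalTwoTorsionX W e) (hr : W.analyticRank = 1)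
    (K : Type) [Field K] [NumberField K] (hK : IsImaginaryQuadratic K)
    (hadm : DoorAdmissible W (NumberField.discr K))
    (hLt : (W.quadraticTwist (NumberField.discr K : ℚ)).entireLFunction 1 ≠ 0)
    (hHN : SatisfiesHeegnerHypothesis (W.conductorNorm ℤ) K)
    (Dt : ModularParametrizationData W (W.conductorNorm ℤ))
    (H : HeegnerDatum (W.conductorNorm ℤ) (NumberField.discr K)) (ι : K →+* ℂ)
    (P : (W.baseChange K).toAffine.Point)
    (hP : WeierstrassCurve.Affine.Point.map ι.toRatAlgHom P = heegnerPointComplex Dt H)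
    (Wd : WeierstrassCurve ℚ) [Wd.IsElliptic] [Wd.IsGloballyMinimal] (Cd : VariableChange ℚ)
    (hWd : Cd • W.quadraticTwist (NumberField.discr K : ℚ) = Wd) (hBd : BSDp Wd 2)
    (hfl : OnArchFloor W e Dt H) (hShaW : ShaTwoTrivial W) (hShaWd : ShaTwoTrivial Wd)
    (hB : BSDp W 2) : ArchLedger W K Dt Wd := by
  haveI : Fact (Nat.Prime 2) := ⟨Nat.prime_two⟩
  obtain ⟨hGZ, hKo, -⟩ := hpub.1 (W.conductorNorm ℤ) W K
  obtain ⟨-, -, hPinf, hrk, hiff⟩ :=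
    bsdp_two_iff_doorIdentity_at hpub.2.1 hpub.2.2 doorTwistTamagawaAtTwo W hr K hK hGZ hKo hadm hHN hLt Dt H ι P hP
      Wd Cd hWd hBd
  obtain ⟨R, hR⟩ := exists_incl_eq_of_isHeegnerPoint_of_analyticRank_eq_one W K hK hHN ⟨Dt, H, ι, hP⟩ hr
  obtain ⟨-, htors, harch⟩ := id hfl
  have hsgn : SignType.sign (kummerValQ W e R) = -1 := by
    rw [hsign W e he hr K hK hHN Dt H ι P R hP hPinf hR, harch]
  have hhb : HasTwoDivisibilityUpToTorsion W K P (halvBit W K) :=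
    oddIndexOfNegativeSignAtTwo_holds W e he htors K hK hrk P R hR hsgn
  obtain ⟨m, hm, hlaw⟩ := hiff.mp hB
  have hmeq : m = halvBit W K := hasTwoDivisibilityUpToTorsion_unique W K hrk P hm hhb
  rw [hmeq] at hlaw
  unfold ShaTwoTrivial at hShaW hShaWd
  unfold DoorIdentityAt at hlaw
  rw [hShaW, hShaWd, padicValNat_one_right] at hlaw
  unfold ArchLedger
  omega

/-- **On an arch-floor row with trivial `Ш[2]`'s, `BSD₂(W) ⟺ ArchLedger`** (modulo print and `BSD₂` of the twist model;
`hsign := realGenusSignLawAtTwo_holds`, stub 4 is a theorem and is used): the research stub 5 is EXACTLY the `BSD₂`-content of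
its rows. [new] -/
theorem bsdp_two_iff_archLedger_of_onArchFloor (hpub : S_pub) (hsign : RealGenusSignLawAtTwo)
    (W : WeierstrassCurve ℚ) [W.IsElliptic] [W.IsGloballyMinimal] [NeZero (W.conductorNorm ℤ)] (e : ℚ)
    (he : HasRationalTwoTorsionX W e) (hr : W.analyticRank = 1)
    (K : Type) [Field K] [NumberField K] (hK : IsImaginaryQuadratic K)
    (hadm : DoorAdmissible W (NumberField.discr K))
    (hLt : (W.quadraticTwist (NumberField.discr K : ℚ)).entireLFunction 1 ≠ 0)
    (hHN : SatisfiesHeegnerHypothesis (W.conductorNorm ℤ) K)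
    (Dt : ModularParametrizationData W (W.conductorNorm ℤ))
    (H : HeegnerDatum (W.conductorNorm ℤ) (NumberField.discr K)) (ι : K →+* ℂ)
    (P : (W.baseChange K).toAffine.Point)
    (hP : WeierstrassCurve.Affine.Point.map ι.toRatAlgHom P = heegnerPointComplex Dt H)
    (Wd : WeierstrassCurve ℚ) [Wd.IsElliptic] [Wd.IsGloballyMinimal] (Cd : VariableChange ℚ)
    (hWd : Cd • W.quadraticTwist (NumberField.discr K : ℚ) = Wd) (hBd : BSDp Wd 2)
    (hfl : OnArchFloor W e Dt H) (hShaW : ShaTwoTrivial W) (hShaWd : ShaTwoTrivial Wd) :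
    BSDp W 2 ↔ ArchLedger W K Dt Wd := by
  refine ⟨archLedger_of_bsdp_two hpub hsign W e he hr K hK hadm hLt hHN Dt H ι P hP Wd Cd hWd hBd hfl hShaW hShaWd,
    fun hL => ?_⟩
  haveI : Fact (Nat.Prime 2) := ⟨Nat.prime_two⟩
  obtain ⟨hGZ, hKo, -⟩ := hpub.1 (W.conductorNorm ℤ) W K
  obtain ⟨-, -, hPinf, hrk, hiff⟩ :=
    bsdp_two_iff_doorIdentity_at hpub.2.1 hpub.2.2 doorTwistTamagawaAtTwo W hr K hK hGZ hKo hadm hHN hLt Dt H ι P hP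
      Wd Cd hWd hBd
  obtain ⟨R, hR⟩ := exists_incl_eq_of_isHeegnerPoint_of_analyticRank_eq_one W K hK hHN ⟨Dt, H, ι, hP⟩ hr
  obtain ⟨-, htors, harch⟩ := id hfl
  have hsgn : SignType.sign (kummerValQ W e R) = -1 := by
    rw [hsign W e he hr K hK hHN Dt H ι P R hP hPinf hR, harch]
  exact hiff.mpr ⟨halvBit W K, oddIndexOfNegativeSignAtTwo_holds W e he htors K hK hrk P R hR hsgn,
    doorIdentityAt_halvBit_of_archLedger hShaW hShaWd hL⟩


end Summit.BirchSwinnertonDyer.BirchSwinnertonDyer.Cruxes.RankOneAtTwoOffBigImageOddLocal.EisensteinKummerGenus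

end
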